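import Summits.CriticalPhenomena.Ising3DConformalLimit.Theses.EnergyNotSigmaSquared
import Literature.Probability.LatticeModels.CriticalScalingDimension
import Literature.Probability.LatticeModels.CriticalUrsellFourSign
import Literature.Probability.LatticeModels.CriticalTwoPointDCPLowerHolds
import Literature.Barriers.CriticalPhenomena.BootstrapLatticeBlindness
import Summits.CriticalPhenomena.Ising3DConformalLimit.Theorems.MoebiusLimitExists.Negative.DeltaWindow
import Summits.CriticalPhenomena.Ising3DConformalLimit.Theorems.MoebiusLimitExists.Negative.EtaExists
import Summits.CriticalPhenomena.Ising3DConformalLimit.Theorems.MoebiusLimitExists.Negative.ScaleFree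
import Summits.CriticalPhenomena.Ising3DConformalLimit.Theorems.MoebiusLimitExists.Negative.ScaleRedundant
import Summits.CriticalPhenomena.Ising3DConformalLimit.Theorems.MoebiusLimitExists.Negative.DeltaUnique
import Summits.CriticalPhenomena.Ising3DConformalLimit.Theorems.MoebiusLimitExists.Negative.FreeTranslations
import Summits.CriticalPhenomena.Ising3DConformalLimit.Theorems.MoebiusLimitExists.Negative.RatioRegular
import Summits.CriticalPhenomena.Ising3DConformalLimit.Theorems.MoebiusLimitExists.Negative.FreePermutations
import Summits.CriticalPhenomena.Ising3DConformalLimit.Theorems.MoebiusLimitExists.Negative.FreeReflections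
import Summits.CriticalPhenomena.Ising3DConformalLimit.Theorems.MoebiusLimitExists.Negative.RatioRegularCorollaries
import Summits.CriticalPhenomena.Ising3DConformalLimit.Theorems.MoebiusLimitExists.Negative.CruxReduced
import Summits.CriticalPhenomena.Ising3DConformalLimit.Theorems.MoebiusLimitExists.Negative.InversionContent
import Summits.CriticalPhenomena.Ising3DConformalLimit.Theorems.MoebiusLimitExists.Negative.ReflectionWord
import Summits.CriticalPhenomena.Ising3DConformalLimit.Theorems.MoebiusLimitExists.Negative.InversionRadial
import Summits.CriticalPhenomena.Ising3DConformalLimit.Theorems.MoebiusLimitExists.Negative.RotationFromInversion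
import Summits.CriticalPhenomena.Ising3DConformalLimit.Theorems.MoebiusLimitExists.Negative.TwoPointPositivity
import Summits.CriticalPhenomena.Ising3DConformalLimit.Theorems.MoebiusLimitExists.Negative.PinnedRenormalisation
import Literature.Probability.LatticeModels.CriticalAxisRatioRegularity
import Summits.CriticalPhenomena.Ising3DConformalLimit.Theorems.HyperoctahedralRPInversionUpgradeNormalisedLatticeRP
import Summits.CriticalPhenomena.Ising3DConformalLimit.Theorems.EnergyNotSigmaSquaredMoebiusLimitExistsDefs

/-!
# Disproof of `MoebiusLimitExists` / `MoebiusLimit` (item stmt-CriticalPhenomena-1344) — findings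

Work file of the standing crux disprover (gen 2; gen 3 additions: §A⁶ and §F; gen 4 addition: §G — the
residue `stub_equicontinuity_inner` is provable by MIRROR PEDIGREES, 2026-08-16). Crux (`EnergyNotSigmaSquared.MoebiusLimit`,
verbatim `PerfectScreening.MoebiusLimitExists`, shared by 11 routes; `Iff.rfl` between the two
spellings checked in scratch `W.lean`):

  `∃ ρ Δ S, (∀ δ ∈ (0,1], 0 < ρ δ) ∧ 0 < Δ ∧ HasPointwiseScalingLimit (criticalCorr 3) ρ S ∧
     IsNondegenerateTwoPoint S ∧ IsMoebiusCovariant Δ S`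

= the summit conjunct `CritIsing3DConformalLimit` minus clause (iii) `HasNontrivialU4 S`
(`conjunct_iff_crux_and_u4`). VERDICT SO FAR: **resists** — it is the 3D-Ising-CFT conjecture
itself (Polyakov 1970; Duminil-Copin ICM 2022 §8.4 "widely open"); every formal side condition is
placed where the folklore statement needs it (inversion only off the origin, limit and
non-degeneracy only on `NonCoincident`, `S` free elsewhere), so no junk instance decides it.
Everything below is `lean check` rc 0, no `sorry`, axioms `propext/Classical.choice/Quot.sound`.

## Findings (index)

* §0 READ-BACK — `crux_iff`, `conjunct_iff_crux_and_u4`, `crux_of_conjunct`; lattice dictionary: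
  `criticalCorr_fin_zero` (`⟨1⟩ = 1`), odd correlators vanish (tree
  `criticalCorr_eq_zero_of_odd`), hence for ANY pointwise limit `S 0 ≡ 1` (`limit_zero_eq_one`) and
  `S n ≡ 0` on `NonCoincident` for odd `n` (`limit_odd_eq_zero`) — the `n = 0, 1, 3, …` clauses of
  `IsMoebiusCovariant` carry no information and no obstruction.
* §A LOAD-BEARING ANALYSIS —
  `cruxWithoutLimit_holds`: drop the lattice limit ⇒ TRUE (tree `modelFamily`, `Δ = 3/2`; and the
  whole interface limit ∧ nondeg ∧ Möbius ∧ U₄ is inhabited for SOME lattice family,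
  `interface_inhabited`) — the predicates are jointly satisfiable, no vacuity;
  `cruxWithoutNondegeneracy_holds`: drop non-degeneracy ⇒ junk-TRUE (`ρ = δ`, `S = 𝟙_{n=0}`);
  `crux_iff_cruxWithoutDeltaPos`: the clause `0 < Δ` is REDUNDANT (any witness has `Δ ≥ 1/2`);
  `crux_iff_normalised`: WLOG `S = 0` off `NonCoincident` (normalisation keeps every clause).
  So the content is exactly: existence of the limit + `S₂ > 0` + covariance ON `NonCoincident`.
* §A'' REDUNDANT CLAUSES (LANDED: `Negative/ScaleFree.lean` p70047, `Negative/ScaleRedundant.lean`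
  p70671, `Negative/FreeTranslations.lean` p70633) — for ANY non-degenerate pointwise limit of
  `criticalCorr 3`: `ρ(cδ)/ρ(δ) → Φ(c) = c^{-Δ'}` and `S_n(c·x) = c^{-nΔ'}S_n(x)` on `NonCoincident`
  (MMS in the limit + Cauchy's equation), and `S_n(x+v) = S_n(x)` for all `v ∈ ℝ³` (lattice
  translations at meshes `t/(k+1)`, three axes compose). Hence (`crux_iff_rotation_inversion`)
    `Crux ↔ ∃ ρ Δ S, ρ>0 ∧ limit ∧ nondeg ∧ IsRotationInvariant S ∧ IsInversionCovariant Δ S`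
  — translations, dilations, `0 < Δ` are automatic and `Δ` is forced; and crit-ising.S03
  `CritIsing3DEuclideanLimit ↔ ∃ ρ S, ρ>0 ∧ limit ∧ nondeg ∧ IsRotationInvariant S`
  (`euclideanLimit_iff_rotation`). WHAT A ROUTE MUST PROVE: existence of a non-degenerate limit, the
  `O(3)`-upgrade of the cubic symmetry, inversion covariance (and (iii)) — nothing else.
* §A''' FREE LATTICE SYMMETRIES (LANDED `Negative/FreePermutations.lean` p70785, `Negative/FreeReflections.lean`
  p71201) — ANY pointwise limit is invariant on `NonCoincident`
  under coordinate permutations (exact commutation with the floor) and coordinate sign flips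
  (`⌊−a⌋ = −⌊a⌋−1` off the grid: translate to irrational coordinates first, then use the lattice
  symmetry "flip and shift by −1"); with §A'' the whole affine hyperoctahedral group `B₃ ⋉ ℝ³` acts
  for free (`limit_coordPerm_of_lim`), so `IsRotationInvariant` only asks for the upgrade `B₃ → O(3)`.
* §A'''' INVERSION CONTENT (LANDED `Negative/InversionContent.lean` p71216, `Negative/CruxReduced.lean` p71209)
  — GKS II passes to any
  limit (`S₄ ≥ S₂S₂ > 0`); inversion covariance of `S₂` is AUTOMATIC for `O(3)`+scale limits;
  inversion covariance of `S₄` pins `Δ`; hence `Crux ↔ ∃ ρ Δ S, ρ>0 ∧ limit ∧ nondeg ∧ O(3) ∧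
  (inversion covariance of the EVEN correlators of order ≥ 4)`: the conformal content proper is the
  cross-ratio structure of `S₄, S₆, …`.
* §A''''' ROTATIONS FROM INVERSION (LANDED `Negative/ReflectionWord.lean` p71351: the Euclidean reflection
  `R_{m^⊥} = ι_m ∘ ι_{m/2,1/2} ∘ ι_m` as a word in inversions; `Negative/InversionRadial.lean` p71501:
  inversion covariance (Δ) + translations + dilations (Δ') + symmetric positive `S₂` force `Δ = Δ'`
  and a RADIAL `S₂` — pair `x = u+2u'`, `y = 4u+2u'`; LANDED `Negative/RotationFromInversion.lean`
  p71717: `isRotationInvariant_of_inversion` — FULL `O(3)` invariance follows from inversion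
  covariance (chain along the word, per-point factor calibrated to `1` on pairs, Cartan–Dieudonné);
  LANDED `Negative/CruxInversionOnly.lean`: **`crux_iff_inversion : Crux ↔ ∃ ρ Δ S, ρ>0 ∧ limit ∧
  nondeg ∧ IsInversionCovariant Δ S`** — THE CRUX IS: a non-degenerate pointwise limit of the
  critical correlators exists and is covariant under the single map `x ↦ x/‖x‖²`
  (`conjunct_iff_inversion` adds (iii)).) Here: `rotation_of_inversion`, `crux_iff_inversion`.
* §A⁶ (gen 3) `ρ` IS WLOG `ρ_pin` AND NON-DEGENERACY IS ONE BIT (LANDED `Negative/TwoPointPositivity.lean`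
  p73296; `Negative/PinnedRenormalisation.lean`) — for ANY limit, positivity of `S₂` at ONE
  pair propagates to ALL pairs (inward: MMS; OUTWARD: a zero at scale `t` would force geometric
  decay of `⟨σ₀σ_{Ne₀}⟩` along a geometric sequence of `N`, against Simon–Lieb), so
  `IsNondegenerateTwoPoint S ↔ S₂ ≢ 0`; the pinned zoom (`ρ_pin(δ) = ⟨σ₀σ_{⌊1/δ⌋e₀}⟩^{-1/2}`, the
  picked line's renormalisation) is `≡ 1` at `(0,e₀)`, hence EVERY pinned limit is non-degenerate,
  and `Crux ↔ ∃ Δ S, PinnedLimit Δ S ↔ ∃ Δ S, HasPointwiseScalingLimit (criticalCorr 3) rhoPin S ∧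
  IsInversionCovariant Δ S` — **THE CRUX IN TWO CLAUSES** (no `ρ`, no `0<Δ`, no non-degeneracy, no
  Euclid, no dilations). Here: `crux_nondeg_iff_exists_pos`; the pinned forms are quoted in §F.
* §F (gen 3) TARGETS = the stubs of the PICKED line `only-interaction-breaks-moebius` (skeleton
  `Lines/only-interaction-breaks-moebius.lean`, 8f8c9fdb): verdict per stub, what each silently
  contains, which hypotheses are load-bearing, and the nudges; `stub_compactness` ⇒ cluster points
  non-degenerate + lattice DOUBLING (open; `Negative/CompactnessContent.lean`) — recommend
  conditioning it on item 0634 like STUB 2; and an ERRATUM to §D: axis ratio regularity of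
  `⟨σ₀σ_x⟩_{β_c}` is a THEOREM (`Literature/…/CriticalAxisRatioRegularity.lean`, log-convexity).
* §B FORCED PARAMETERS (tightness of the numerical clauses) — any witness has `Δ ∈ [1/2, 1]`
  (`witness_delta_mem_Icc`, tree `scalingDimension_mem_Icc_holds`: infrared + Simon–Lieb bounds),
  and `ρ(δ)² ≥ c/δ → ∞` (`witness_rho_sq_tendsto_atTop`): NO bounded renormalisation.
* §B' (LANDED, `Theorems/MoebiusLimitExists/Negative/EtaExists.lean`, p69786) — any witness (indeed any
  `O(3)`+scale-covariant non-degenerate limit) FORCES THE ANOMALOUS DIMENSION TO EXIST, `η = 2Δ − 1`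
  (`witness_hasIsingExponentEta`), hence `Δ ∈ [1/2, 3/4]` (`witness_delta_mem_Icc'`, DCP25 Thm 1.5)
  and `Crux → ∃ η ∈ [0,1/2], HasIsingExponentEta 3 η` (`crux_implies_eta_exists`): the crux implies
  the open item-0635-type statement "η(3) exists"; `not_cruxWithDelta_gt_three_quarters`.
  (`Negative/DeltaWindow.lean`, p69431, carries the window/redundancy of `0 < Δ` as tree theorems.)
  `Δ` is UNIQUE across all witnesses, `Δ = (1+η)/2` (`witness_delta_unique`, LANDED
  `Negative/DeltaUnique.lean` p70537): the `∃ Δ` is a number fixed by the lattice two-point function.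
* §D LATTICE CONSEQUENCES (LANDED `Negative/RatioRegular.lean` p70403) — any witness forces the OPEN
  two-point statements on `ℤ³`: `|⟨σ₀σ_y⟩/⟨σ₀σ_x⟩ − (‖ŷ‖₂/‖x̂‖₂)^{−2Δ}| → 0` uniformly for comparable
  norms (`witness_two_point_ratio_asymptotics`), hence ratio regularity `⟨σ₀σ_{x+u}⟩/⟨σ₀σ_x⟩ → 1`,
  doubling `→ 2^{−2Δ}`, asymptotic Euclidean isotropy (corollary file pending build). So the crux
  is at least as hard as two-point ratio regularity on `ℤ³` (used unproved by RungOne-type routes).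
* §C STRENGTHENINGS REFUTED — `not_cruxWithDelta_lt_half`, `not_cruxWithDelta_gt_one`,
  `not_cruxWithDelta_gt_three_quarters`,
  `not_cruxWithBoundedRho`; junk variants: convergence demanded at ONE coincident pair is false
  (`not_cruxWithLimitAtDiagonal`), non-degeneracy on the diagonal is false
  (`not_cruxWithNondegOnDiagonal`), inversion covariance demanded at the origin is false
  (`not_cruxWithInversionAtOrigin`), a limit `S₂` continuous on all of `(ℝ³)²` is false
  (`not_cruxWithContinuousTwoPoint`), UNIFORM (not locally uniform) convergence on
  `NonCoincident 3 2` is false (`not_cruxWithUniformLimit`).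
* §G (gen 4) MIRROR PEDIGREES — lead-1's residue `stub_equicontinuity_inner` (single-variable
  asymptotic equicontinuity where no coordinate slab separates the moving point) does NOT resist:
  the cluster RP–Cauchy–Schwarz move inequality (`Pedigree.ClusterMoveIneq`, nine site mirrors of `ℤ³`;
  proved for every RP mirror, `Pedigree.clusterMoveIneq_holds`, and the nine families ARE RP mirrors,
  `isRPMirror_coord/swap/antiswap/conj`) reduces regularity at `(x, i)` to regularity at the doubled configuration `A ∪ θA` (far side
  DISCARDED; `Pedigree.PedigreeStep`), and the COVERING THEOREM (kernel-checked in G.3: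
  `Pedigree.Cover.covering` / `Pedigree.Cover.coveringE`, std axioms; also certified by `decide` for
  the octahedron / cube vertex / `3×3×3` grid and by exact search on `> 1000` configurations) ends
  every such recursion at 1″b's base case. So STUB 1″ and STUB 1
  (compactness) are provable modulo 0634; open on the line: STUBS 5′/6′ only (G.5). G.0 audits
  1″a–1″d: all sound.
* §E WHY IT RESISTS / literature — docstring of `resists`.

Gen-1 of this seat (evidence notes on the item, files not recoverable on this hub) had in addition
`ρ` regularly varying and `Δ` unique across witnesses; next revisions here go further: scale
covariance and `0 < Δ` are REDUNDANT given the limit + non-degeneracy (+ Euclid + inversion), and the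
crux forces ratio regularity / asymptotic `O(3)`-isotropy of `⟨σ₀σ_x⟩_{β_c}` on `ℤ³` (§D, to come).
-/

noncomputable section

namespace Summit.CriticalPhenomena.Ising3DConformalLimit.Cruxes.MoebiusLimitExists.Disproof

open Literature.Probability.LatticeModels Literature.Barriers.CriticalPhenomena
open Filter Set Function EuclideanGeometry
open scoped Topology
open Summit.CriticalPhenomena.Ising3DConformalLimit.MoebiusLimitExistsOnlyInteraction (rhoPin)

/-! ## §0 Read-back -/

/-- The crux, by name (route spelling `EnergyNotSigmaSquared.MoebiusLimit`; the spelling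
`PerfectScreening.MoebiusLimitExists` is the same term). [folklore] -/
abbrev Crux : Prop :=
  Summit.CriticalPhenomena.Ising3DConformalLimit.Theses.EnergyNotSigmaSquared.MoebiusLimit

/-- `(ρ, Δ, S)` is a witness of the crux: the five clauses, verbatim. [folklore] -/
def IsWitness (ρ : ℝ → ℝ) (Δ : ℝ) (S : CorrFamily 3) : Prop :=
  (∀ δ ∈ Set.Ioc (0:ℝ) 1, 0 < ρ δ) ∧ 0 < Δ ∧
    HasPointwiseScalingLimit (criticalCorr 3) ρ S ∧ IsNondegenerateTwoPoint S ∧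
      IsMoebiusCovariant Δ S

/-- Read-back: the crux is `∃ ρ Δ S, IsWitness ρ Δ S` (definitional). [folklore] -/
theorem crux_iff : Crux ↔ ∃ (ρ : ℝ → ℝ) (Δ : ℝ) (S : CorrFamily 3), IsWitness ρ Δ S := Iff.rfl

/-- Read-back: the sub-problem statement is the crux plus clause (iii) for the SAME witness.
[folklore] -/
theorem conjunct_iff_crux_and_u4 :
    _root_.Ising3DConformalLimit ↔
      ∃ (ρ : ℝ → ℝ) (Δ : ℝ) (S : CorrFamily 3), IsWitness ρ Δ S ∧ HasNontrivialU4 S := by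
  constructor
  · rintro ⟨ρ, Δ, S, h1, h2, h3, h4, h5, h6⟩
    exact ⟨ρ, Δ, S, ⟨h1, h2, h3, h4, h5⟩, h6⟩
  · rintro ⟨ρ, Δ, S, ⟨h1, h2, h3, h4, h5⟩, h6⟩
    exact ⟨ρ, Δ, S, h1, h2, h3, h4, h5, h6⟩

/-- The conjunct implies the crux (so refuting the crux refutes the sub-problem). [folklore] -/
theorem crux_of_conjunct (h : _root_.Ising3DConformalLimit) : Crux := by
  obtain ⟨ρ, Δ, S, hw, -⟩ := conjunct_iff_crux_and_u4.1 h
  exact ⟨ρ, Δ, S, hw⟩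

namespace IsWitness

variable {ρ : ℝ → ℝ} {Δ : ℝ} {S : CorrFamily 3}

/-- Accessor. [folklore] -/
theorem rho_pos (h : IsWitness ρ Δ S) : ∀ δ ∈ Set.Ioc (0:ℝ) 1, 0 < ρ δ := h.1
/-- Accessor. [folklore] -/
theorem delta_pos (h : IsWitness ρ Δ S) : 0 < Δ := h.2.1
/-- Accessor. [folklore] -/
theorem lim (h : IsWitness ρ Δ S) : HasPointwiseScalingLimit (criticalCorr 3) ρ S := h.2.2.1
/-- Accessor. [folklore] -/
theorem nondeg (h : IsWitness ρ Δ S) : IsNondegenerateTwoPoint S := h.2.2.2.1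
/-- Accessor. [folklore] -/
theorem moebius (h : IsWitness ρ Δ S) : IsMoebiusCovariant Δ S := h.2.2.2.2
/-- Accessor. [folklore] -/
theorem scale (h : IsWitness ρ Δ S) : IsScaleCovariant Δ S := h.moebius.isScaleCovariant
/-- Accessor. [folklore] -/
theorem euclid (h : IsWitness ρ Δ S) : IsEuclideanInvariant S := h.moebius.isEuclideanInvariant
/-- Accessor. [folklore] -/
theorem inversion (h : IsWitness ρ Δ S) : IsInversionCovariant Δ S := h.moebius.isInversionCovariant

end IsWitness

/-! ### Lattice dictionary: `n = 0` and odd `n` -/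

/-- `⟨1⟩⁺_{β_c} = 1`: the empty spin monomial. [folklore] -/
theorem criticalCorr_fin_zero (x : Fin 0 → Site 3) : criticalCorr 3 0 x = 1 := by
  have hx : spinMonomial x = fun _ => (1:ℝ) := by
    funext s; simp [spinMonomial]
  show plusExpect 3 (criticalBeta 3) 0 (spinMonomial x) = 1
  rw [hx]
  show limUnder atTop
      (fun L : ℕ => isingExpect (zdGraph 3) (box 3 L) (criticalBeta 3) 0 .plus (fun _ => (1:ℝ))) = 1
  simp_rw [isingExpect_const]
  exact tendsto_const_nhds.limUnder_eq

/-- The rescaled `0`-point correlator is the constant `1`. [folklore] -/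
theorem rescaledCorrelator_zero (ρ : ℝ → ℝ) (δ : ℝ) (x : Fin 0 → EuclideanSpace ℝ (Fin 3)) :
    rescaledCorrelator (criticalCorr 3) ρ 0 δ x = 1 := by
  rw [rescaledCorrelator_apply, pow_zero, one_mul, criticalCorr_fin_zero]

/-- The rescaled odd correlators vanish identically (odd critical correlators vanish on `ℤ³`,
`m*(β_c) = 0`, ADS 2015). [cite: AizenmanDuminilCopinSidoraviciusCMP2015, Thm. 1.2] -/
theorem rescaledCorrelator_odd (ρ : ℝ → ℝ) {n : ℕ} (hn : Odd n) (δ : ℝ)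
    (x : Fin n → EuclideanSpace ℝ (Fin 3)) :
    rescaledCorrelator (criticalCorr 3) ρ n δ x = 0 := by
  rw [rescaledCorrelator_apply, criticalCorr_eq_zero_of_odd (d := 3) le_rfl hn, mul_zero]

/-- Pointwise convergence at a non-coincident configuration (from locally uniform convergence).
[folklore] -/
theorem tendsto_of_lim {ρ : ℝ → ℝ} {S : CorrFamily 3}
    (hlim : HasPointwiseScalingLimit (criticalCorr 3) ρ S) {n : ℕ}
    {x : Fin n → EuclideanSpace ℝ (Fin 3)} (hx : x ∈ NonCoincident 3 n) :
    Tendsto (fun δ => rescaledCorrelator (criticalCorr 3) ρ n δ x) (𝓝[>] (0:ℝ)) (𝓝 (S n x)) :=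
  (hlim n).tendsto_at hx

/-- ANY pointwise limit of the critical correlators has `S 0 ≡ 1`. [folklore] -/
theorem limit_zero_eq_one {ρ : ℝ → ℝ} {S : CorrFamily 3}
    (hlim : HasPointwiseScalingLimit (criticalCorr 3) ρ S) (x : Fin 0 → EuclideanSpace ℝ (Fin 3)) :
    S 0 x = 1 := by
  have hx : x ∈ NonCoincident 3 0 := by
    rw [mem_nonCoincident]; intro i; exact Fin.elim0 i
  have h := tendsto_of_lim hlim hx
  simp_rw [rescaledCorrelator_zero] at h
  exact (tendsto_nhds_unique tendsto_const_nhds h).symm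

/-- ANY pointwise limit of the critical correlators vanishes on non-coincident configurations of
odd length. [folklore] -/
theorem limit_odd_eq_zero {ρ : ℝ → ℝ} {S : CorrFamily 3}
    (hlim : HasPointwiseScalingLimit (criticalCorr 3) ρ S) {n : ℕ} (hn : Odd n)
    {x : Fin n → EuclideanSpace ℝ (Fin 3)} (hx : x ∈ NonCoincident 3 n) : S n x = 0 := by
  have h := tendsto_of_lim hlim hx
  simp_rw [rescaledCorrelator_odd ρ hn] at h
  exact (tendsto_nhds_unique tendsto_const_nhds h).symm

/-- In particular `S 1 ≡ 0` (every singleton configuration is non-coincident). [folklore] -/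
theorem limit_one_eq_zero {ρ : ℝ → ℝ} {S : CorrFamily 3}
    (hlim : HasPointwiseScalingLimit (criticalCorr 3) ρ S) (x : Fin 1 → EuclideanSpace ℝ (Fin 3)) :
    S 1 x = 0 :=
  limit_odd_eq_zero hlim odd_one (by rw [mem_nonCoincident]; intro i j _; exact Subsingleton.elim i j)

/-! ## §A Load-bearing analysis -/

/-- The crux with the lattice-limit clause DROPPED. [folklore] -/
def CruxWithoutLimit : Prop :=
  ∃ (ρ : ℝ → ℝ) (Δ : ℝ) (S : CorrFamily 3), (∀ δ ∈ Set.Ioc (0:ℝ) 1, 0 < ρ δ) ∧ 0 < Δ ∧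
    IsNondegenerateTwoPoint S ∧ IsMoebiusCovariant Δ S

/-- Dropping the lattice limit makes the crux TRUE (witness: the tree's Möbius-covariant
`modelFamily`, `Δ = 3/2`). So the covariance/non-degeneracy interface is consistent and the whole
content of the crux is carried by `HasPointwiseScalingLimit (criticalCorr 3)`. [folklore] -/
theorem cruxWithoutLimit_holds : CruxWithoutLimit :=
  ⟨fun _ => 1, 3 / 2, modelFamily, fun _ _ => one_pos, by norm_num,
    modelFamily_isNondegenerateTwoPoint, modelFamily_isMoebiusCovariant⟩

/-- Non-vacuity of the full interface: for SOME lattice family (the lattice restriction of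
`modelFamily`) all clauses of the conjunct — limit, non-degeneracy, Möbius covariance, `U₄ ≢ 0` —
hold simultaneously (tree `hasPointwiseScalingLimit_latticeRestrict`). [folklore] -/
theorem interface_inhabited :
    ∃ (G : LatticeCorrFamily 3) (ρ : ℝ → ℝ) (Δ : ℝ) (S : CorrFamily 3),
      (∀ δ ∈ Set.Ioc (0:ℝ) 1, 0 < ρ δ) ∧ 0 < Δ ∧ HasPointwiseScalingLimit G ρ S ∧
        IsNondegenerateTwoPoint S ∧ IsMoebiusCovariant Δ S ∧ HasNontrivialU4 S :=
  ⟨latticeRestrict modelFamily, modelRenorm, 3 / 2, modelFamily, fun _ hδ => modelRenorm_pos hδ.1,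
    by norm_num, hasPointwiseScalingLimit_latticeRestrict, modelFamily_isNondegenerateTwoPoint,
    modelFamily_isMoebiusCovariant, modelFamily_hasNontrivialU4⟩

/-- The crux with the non-degeneracy clause DROPPED. [folklore] -/
def CruxWithoutNondegeneracy : Prop :=
  ∃ (ρ : ℝ → ℝ) (Δ : ℝ) (S : CorrFamily 3), (∀ δ ∈ Set.Ioc (0:ℝ) 1, 0 < ρ δ) ∧ 0 < Δ ∧
    HasPointwiseScalingLimit (criticalCorr 3) ρ S ∧ IsMoebiusCovariant Δ S

/-- The "vacuum family": `S 0 = 1`, all other `S n = 0`. [folklore] -/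
def vacuumFamily : CorrFamily 3 := fun n _ => if n = 0 then 1 else 0

/-- The vacuum family is Möbius covariant for every `Δ`. [folklore] -/
theorem vacuumFamily_isMoebiusCovariant (Δ : ℝ) : IsMoebiusCovariant Δ vacuumFamily := by
  refine ⟨⟨fun n v x => rfl, fun n R x => rfl⟩, fun n c hc x => ?_, fun n x hx => ?_⟩
  · by_cases hn : n = 0
    · subst hn; simp [vacuumFamily]
    · simp [vacuumFamily, hn]
  · by_cases hn : n = 0
    · subst hn; simp [vacuumFamily]
    · simp [vacuumFamily, hn]

/-- With `ρ(δ) = δ` the rescaled critical correlators converge to the vacuum family (uniformly):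
`|δ^n ⟨∏σ⟩| ≤ δ^n ≤ δ` for `n ≥ 1`, and the `0`-point function is `1`. [folklore] -/
theorem hasPointwiseScalingLimit_vacuum :
    HasPointwiseScalingLimit (criticalCorr 3) (fun δ => δ) vacuumFamily := by
  intro n
  apply TendstoUniformlyOn.tendstoLocallyUniformlyOn
  rw [Metric.tendstoUniformlyOn_iff]
  intro ε hε
  by_cases hn : n = 0
  · subst hn
    filter_upwards with δ x _
    rw [rescaledCorrelator_zero]
    simp [vacuumFamily, hε]
  · have hmem : Set.Ioo (0:ℝ) (min ε 1) ∈ 𝓝[>] (0:ℝ) :=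
      Ioo_mem_nhdsGT (lt_min hε one_pos)
    filter_upwards [hmem] with δ hδ x _
    have hδ0 : 0 < δ := hδ.1
    have hδε : δ < ε := lt_of_lt_of_le hδ.2 (min_le_left _ _)
    have hδ1 : δ ≤ 1 := (lt_of_lt_of_le hδ.2 (min_le_right _ _)).le
    simp only [vacuumFamily, if_neg hn, rescaledCorrelator_apply, dist_zero_left, norm_mul,
      norm_pow, Real.norm_eq_abs, abs_of_pos hδ0]
    have h1 : |criticalCorr 3 n fun i => latticeApprox δ (x i)| ≤ 1 := abs_criticalCorr_le_one le_rfl _ _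
    have h2 : δ ^ n ≤ δ := by
      obtain ⟨m, rfl⟩ := Nat.exists_eq_succ_of_ne_zero hn
      rw [pow_succ]
      exact mul_le_of_le_one_left hδ0.le (pow_le_one₀ hδ0.le hδ1)
    calc δ ^ n * |criticalCorr 3 n fun i => latticeApprox δ (x i)| ≤ δ ^ n * 1 :=
          mul_le_mul_of_nonneg_left h1 (pow_nonneg hδ0.le _)
      _ ≤ δ := by rw [mul_one]; exact h2
      _ < ε := hδε

/-- Dropping non-degeneracy makes the crux junk-TRUE (`ρ = δ`, `Δ = 1`, vacuum family): the
clause `IsNondegenerateTwoPoint S` is load-bearing — it is what forces `ρ` to be the genuine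
renormalisation `≈ δ^{-Δ_σ}`. [folklore] -/
theorem cruxWithoutNondegeneracy_holds : CruxWithoutNondegeneracy :=
  ⟨fun δ => δ, 1, vacuumFamily, fun _ hδ => hδ.1, one_pos, hasPointwiseScalingLimit_vacuum,
    vacuumFamily_isMoebiusCovariant 1⟩

/-- The crux with the clause `0 < Δ` DROPPED. [folklore] -/
def CruxWithoutDeltaPos : Prop :=
  ∃ (ρ : ℝ → ℝ) (Δ : ℝ) (S : CorrFamily 3), (∀ δ ∈ Set.Ioc (0:ℝ) 1, 0 < ρ δ) ∧
    HasPointwiseScalingLimit (criticalCorr 3) ρ S ∧ IsNondegenerateTwoPoint S ∧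
      IsMoebiusCovariant Δ S

/-- `0 < Δ` is REDUNDANT: limit + scale covariance + non-degeneracy force `Δ ∈ [1/2, 1]` (tree
`scalingDimension_mem_Icc_holds`, from `c‖x‖⁻² ≤ ⟨σ₀σ_x⟩_{β_c} ≤ C‖x‖⁻¹`). [cite: Simon1980, Thm. 1] -/
theorem crux_iff_cruxWithoutDeltaPos : Crux ↔ CruxWithoutDeltaPos := by
  constructor
  · rintro ⟨ρ, Δ, S, h1, -, h3, h4, h5⟩
    exact ⟨ρ, Δ, S, h1, h3, h4, h5⟩
  · rintro ⟨ρ, Δ, S, h1, h3, h4, h5⟩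
    have hΔ := scalingDimension_mem_Icc_holds ρ Δ S h3 h5.isScaleCovariant h4 h1
    exact ⟨ρ, Δ, S, h1, by linarith [hΔ.1], h3, h4, h5⟩

/-- `S` vanishes off the non-coincident configurations. [folklore] -/
def IsNormalised (S : CorrFamily 3) : Prop :=
  ∀ n (x : Fin n → EuclideanSpace ℝ (Fin 3)), x ∉ NonCoincident 3 n → S n x = 0

open Classical in
/-- Normalisation of a family: keep it on `NonCoincident`, set it to `0` elsewhere. [folklore] -/
def normalise (S : CorrFamily 3) : CorrFamily 3 :=
  fun n x => if x ∈ NonCoincident 3 n then S n x else 0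

/-- `normalise S` agrees with `S` on `NonCoincident`. [folklore] -/
theorem normalise_of_mem {S : CorrFamily 3} {n : ℕ} {x : Fin n → EuclideanSpace ℝ (Fin 3)}
    (hx : x ∈ NonCoincident 3 n) : normalise S n x = S n x := by
  simp [normalise, hx]

/-- `normalise S` vanishes off `NonCoincident`. [folklore] -/
theorem normalise_of_not_mem {S : CorrFamily 3} {n : ℕ} {x : Fin n → EuclideanSpace ℝ (Fin 3)}
    (hx : x ∉ NonCoincident 3 n) : normalise S n x = 0 := by
  simp [normalise, hx]

/-- `normalise S` is normalised. [folklore] -/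
theorem isNormalised_normalise (S : CorrFamily 3) : IsNormalised (normalise S) :=
  fun _ _ hx => normalise_of_not_mem hx

/-- Composition with an injective map preserves (non-)coincidence. [folklore] -/
theorem comp_mem_nonCoincident_iff {n : ℕ} {f : EuclideanSpace ℝ (Fin 3) → EuclideanSpace ℝ (Fin 3)}
    (hf : Injective f) (x : Fin n → EuclideanSpace ℝ (Fin 3)) :
    (fun i => f (x i)) ∈ NonCoincident 3 n ↔ x ∈ NonCoincident 3 n := by
  rw [mem_nonCoincident, mem_nonCoincident]
  exact hf.of_comp_iff x

/-- Normalisation preserves Möbius covariance (all four generators act by injective maps, which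
preserve `NonCoincident`). [folklore] -/
theorem isMoebiusCovariant_normalise {Δ : ℝ} {S : CorrFamily 3} (h : IsMoebiusCovariant Δ S) :
    IsMoebiusCovariant Δ (normalise S) := by
  obtain ⟨⟨htr, hrot⟩, hsc, hinv⟩ := h
  refine ⟨⟨fun n v x => ?_, fun n R x => ?_⟩, fun n c hc x => ?_, fun n x hx0 => ?_⟩
  · have hiff := comp_mem_nonCoincident_iff (f := fun p => p + v) (add_left_injective v) x
    by_cases hx : x ∈ NonCoincident 3 n
    · rw [normalise_of_mem hx, normalise_of_mem (hiff.2 hx), htr]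
    · rw [normalise_of_not_mem hx, normalise_of_not_mem (mt hiff.1 hx)]
  · have hiff := comp_mem_nonCoincident_iff (f := R) R.injective x
    by_cases hx : x ∈ NonCoincident 3 n
    · rw [normalise_of_mem hx, normalise_of_mem (hiff.2 hx), hrot]
    · rw [normalise_of_not_mem hx, normalise_of_not_mem (mt hiff.1 hx)]
  · have hiff := comp_mem_nonCoincident_iff (f := fun p => c • p) (smul_right_injective _ hc.ne') x
    by_cases hx : x ∈ NonCoincident 3 n
    · rw [normalise_of_mem hx, normalise_of_mem (hiff.2 hx), hsc n c hc]
    · rw [normalise_of_not_mem hx, normalise_of_not_mem (mt hiff.1 hx), mul_zero]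
  · have hiff := comp_mem_nonCoincident_iff (f := inversion (0 : EuclideanSpace ℝ (Fin 3)) 1)
      (inversion_injective _ one_ne_zero) x
    by_cases hx : x ∈ NonCoincident 3 n
    · rw [normalise_of_mem hx, normalise_of_mem (hiff.2 hx), hinv n x hx0]
    · rw [normalise_of_not_mem hx, normalise_of_not_mem (mt hiff.1 hx), mul_zero]

/-- Normalising a witness gives a (normalised) witness. [folklore] -/
theorem IsWitness.normalise {ρ : ℝ → ℝ} {Δ : ℝ} {S : CorrFamily 3} (h : IsWitness ρ Δ S) :
    IsWitness ρ Δ (normalise S) :=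
  ⟨h.rho_pos, h.delta_pos, fun n => (h.lim n).congr_right fun _ hx => (normalise_of_mem hx).symm,
    fun x hx => by rw [normalise_of_mem hx]; exact h.nondeg x hx, isMoebiusCovariant_normalise h.moebius⟩

/-- WLOG the witness vanishes off `NonCoincident`: the values of `S` at (partially) coincident
configurations are unconstrained junk (the refutations of items 0632/0637,
`Theorems/IsingEuclidUpgradeRefutations.lean`, exploit exactly this freedom in ∀-form upgrades;
in the ∃-form crux it is harmless). [folklore] -/
theorem crux_iff_normalised :
    Crux ↔ ∃ (ρ : ℝ → ℝ) (Δ : ℝ) (S : CorrFamily 3), IsWitness ρ Δ S ∧ IsNormalised S := by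
  constructor
  · rintro ⟨ρ, Δ, S, h⟩
    exact ⟨ρ, Δ, normalise S, IsWitness.normalise h, isNormalised_normalise S⟩
  · rintro ⟨ρ, Δ, S, h, -⟩
    exact ⟨ρ, Δ, S, h⟩

/-! ## §A'' Redundant clauses: translations, dilations, `0 < Δ` (tree: `Negative/ScaleFree.lean`,
`Negative/ScaleRedundant.lean`, `Negative/FreeTranslations.lean`) -/

/-- The crux WITHOUT `0 < Δ` and WITHOUT `IsScaleCovariant` (landed
`MoebiusLimitExistsNegative.moebiusLimit_iff_without_scale`). [folklore] -/
theorem crux_iff_without_scale :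
    Crux ↔ ∃ (ρ : ℝ → ℝ) (Δ : ℝ) (S : CorrFamily 3), (∀ δ ∈ Set.Ioc (0:ℝ) 1, 0 < ρ δ) ∧
      HasPointwiseScalingLimit (criticalCorr 3) ρ S ∧ IsNondegenerateTwoPoint S ∧
        IsEuclideanInvariant S ∧ IsInversionCovariant Δ S :=
  MoebiusLimitExistsNegative.moebiusLimit_iff_without_scale

/-- **THE CRUX, REDUCED**: existence of a non-degenerate pointwise limit which is `O(3)` invariant
and inversion covariant for some `Δ`; translations (`FreeTranslations`), dilations and `0 < Δ`
(`ScaleFree`/`ScaleRedundant`) are automatic. [folklore] -/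
theorem crux_iff_rotation_inversion :
    Crux ↔ ∃ (ρ : ℝ → ℝ) (Δ : ℝ) (S : CorrFamily 3), (∀ δ ∈ Set.Ioc (0:ℝ) 1, 0 < ρ δ) ∧
      HasPointwiseScalingLimit (criticalCorr 3) ρ S ∧ IsNondegenerateTwoPoint S ∧
        IsRotationInvariant S ∧ IsInversionCovariant Δ S := by
  constructor
  · rintro ⟨ρ, Δ, S, h1, -, h3, h4, h5⟩
    exact ⟨ρ, Δ, S, h1, h3, h4, h5.1.2, h5.2.2⟩
  · rintro ⟨ρ, Δ, S, hρ, hlim, hnd, hrot, hinv⟩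
    exact MoebiusLimitExistsNegative.moebiusLimit_iff_without_scale.2 ⟨ρ, Δ, _, hρ,
      MoebiusLimitExistsNegative.normalised_hasLimit hlim, MoebiusLimitExistsNegative.normalised_nondeg hnd,
      ⟨MoebiusLimitExistsNegative.isTranslationInvariant_normalised_of_limit hlim,
        MoebiusLimitExistsNegative.normalised_rotation hrot⟩,
      MoebiusLimitExistsNegative.normalised_inversion hinv⟩

/-- crit-ising.S03 REDUCED: `CritIsing3DEuclideanLimit ↔` existence of a non-degenerate pointwise
limit of the critical correlators that is `O(3)` invariant. [folklore] -/
theorem euclideanLimit_iff_rotation :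
    CritIsing3DEuclideanLimit ↔ ∃ (ρ : ℝ → ℝ) (S : CorrFamily 3), (∀ δ ∈ Set.Ioc (0:ℝ) 1, 0 < ρ δ) ∧
      HasPointwiseScalingLimit (criticalCorr 3) ρ S ∧ IsNondegenerateTwoPoint S ∧ IsRotationInvariant S := by
  constructor
  · rintro ⟨ρ, Δ, S, h1, -, h3, h4, h5, -⟩
    exact ⟨ρ, S, h1, h3, h4, h5.2⟩
  · rintro ⟨ρ, S, hρ, hlim, hnd, hrot⟩
    exact MoebiusLimitExistsNegative.critIsing3DEuclideanLimit_iff_without_scale.2 ⟨ρ, _, hρ,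
      MoebiusLimitExistsNegative.normalised_hasLimit hlim, MoebiusLimitExistsNegative.normalised_nondeg hnd,
      ⟨MoebiusLimitExistsNegative.isTranslationInvariant_normalised_of_limit hlim,
        MoebiusLimitExistsNegative.normalised_rotation hrot⟩⟩

/-- Any witness's `S` is translation invariant on `NonCoincident` for free (no covariance used).
[cite: FriedliVelenik2017, Thm. 3.17] -/
theorem limit_translate_of_lim {ρ : ℝ → ℝ} {S : CorrFamily 3}
    (hlim : HasPointwiseScalingLimit (criticalCorr 3) ρ S) {n : ℕ} (v : EuclideanSpace ℝ (Fin 3))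
    {x : Fin n → EuclideanSpace ℝ (Fin 3)} (hx : x ∈ NonCoincident 3 n) :
    S n (fun i => x i + v) = S n x :=
  MoebiusLimitExistsNegative.limit_translate hlim v hx

/-- Any non-degenerate limit is scale covariant on `NonCoincident` for free, with some `Δ' ≥ 0`.
[folklore] -/
theorem scale_free_of_lim {ρ : ℝ → ℝ} {S : CorrFamily 3} (hρ : ∀ δ ∈ Set.Ioc (0:ℝ) 1, 0 < ρ δ)
    (hlim : HasPointwiseScalingLimit (criticalCorr 3) ρ S) (hnd : IsNondegenerateTwoPoint S) :
    ∃ Δ' : ℝ, 0 ≤ Δ' ∧ ∀ (n : ℕ) (c : ℝ), 0 < c → ∀ x ∈ NonCoincident 3 n,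
      S n (fun i => c • x i) = c ^ (-(n : ℝ) * Δ') * S n x :=
  MoebiusLimitExistsNegative.exists_scaleCovariant_on_nonCoincident hρ hlim hnd

/-- Any limit is invariant under coordinate permutations of `ℝ³` on `NonCoincident`, for free
(landed `Negative/FreePermutations.lean`). [cite: FriedliVelenik2017, Exercise 3.14, p. 115] -/
theorem limit_coordPerm_of_lim {ρ : ℝ → ℝ} {S : CorrFamily 3}
    (hlim : HasPointwiseScalingLimit (criticalCorr 3) ρ S) (π : Equiv.Perm (Fin 3)) {n : ℕ}
    {x : Fin n → EuclideanSpace ℝ (Fin 3)} (hx : x ∈ NonCoincident 3 n) :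
    S n (fun i => LinearIsometryEquiv.piLpCongrLeft 2 ℝ ℝ π (x i)) = S n x :=
  MoebiusLimitExistsNegative.limit_coordPerm hlim π hx

/-- Any limit is invariant under coordinate sign flips of `ℝ³` on `NonCoincident`, for free
(landed `Negative/FreeReflections.lean`). [cite: FriedliVelenik2017, Exercise 3.14, p. 115] -/
theorem limit_signFlip_of_lim {ρ : ℝ → ℝ} {S : CorrFamily 3}
    (hlim : HasPointwiseScalingLimit (criticalCorr 3) ρ S) (ε : Fin 3 → ℤˣ)
    (R : EuclideanSpace ℝ (Fin 3) ≃ₗᵢ[ℝ] EuclideanSpace ℝ (Fin 3))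
    (hR : ∀ (p : EuclideanSpace ℝ (Fin 3)) (j : Fin 3), R p j = ((ε j : ℤ) : ℝ) * p j)
    {n : ℕ} {x : Fin n → EuclideanSpace ℝ (Fin 3)} (hx : x ∈ NonCoincident 3 n) :
    S n (fun i => R (x i)) = S n x :=
  MoebiusLimitExistsNegative.limit_signFlip hlim ε R hR hx

/-- The crux with inversion demanded only for EVEN `n ≥ 4` (landed `Negative/InversionContent.lean`).
[folklore] -/
theorem crux_iff_rotation_inversion_ge_four :
    Crux ↔ ∃ (ρ : ℝ → ℝ) (Δ : ℝ) (S : CorrFamily 3), (∀ δ ∈ Set.Ioc (0:ℝ) 1, 0 < ρ δ) ∧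
      HasPointwiseScalingLimit (criticalCorr 3) ρ S ∧ IsNondegenerateTwoPoint S ∧ IsRotationInvariant S ∧
        ∀ n : ℕ, 4 ≤ n → Even n → ∀ x : Fin n → EuclideanSpace ℝ (Fin 3), (∀ i, x i ≠ 0) →
          S n (fun i => EuclideanGeometry.inversion 0 1 (x i)) = (∏ i, ‖x i‖ ^ (2 * Δ)) * S n x :=
  MoebiusLimitExistsNegative.moebiusLimit_iff_rotation_inversion_ge_four

/-- **The two-point function is radial from inversion covariance alone** (translations + dilations
+ symmetric positive `S₂`; no rotation input; landed `Negative/InversionRadial.lean`).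
[cite: FrancescoMathieuSenechal1997, §4.3.1 eq. (4.55)] -/
theorem two_point_radial_of_inversion' {Δ : ℝ} {S : CorrFamily 3} (htr : IsTranslationInvariant S)
    (hsc : IsScaleCovariant Δ S) (hinv : IsInversionCovariant Δ S)
    (hsym : ∀ p q : EuclideanSpace ℝ (Fin 3), p ≠ q → S 2 ![p, q] = S 2 ![q, p])
    {v : EuclideanSpace ℝ (Fin 3)} (hv : v ≠ 0) :
    S 2 ![0, v] = ‖v‖ ^ (-(2:ℝ) * Δ) * S 2 ![0, EuclideanSpace.single 0 1] :=
  MoebiusLimitExistsNegative.two_point_radial_of_inversion htr hsc hinv hsym hv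

/-- **`O(3)` INVARIANCE FOLLOWS FROM INVERSION COVARIANCE** (landed `Negative/RotationFromInversion.lean`).
[cite: FrancescoMathieuSenechal1997, §4.1 eqs. (4.13)–(4.19)] -/
theorem rotation_of_inversion {Δ : ℝ} {S : CorrFamily 3} (htr : IsTranslationInvariant S)
    (hsc : IsScaleCovariant Δ S) (hinv : IsInversionCovariant Δ S)
    (hsym : ∀ p q : EuclideanSpace ℝ (Fin 3), p ≠ q → S 2 ![p, q] = S 2 ![q, p])
    (hnd : IsNondegenerateTwoPoint S) : IsRotationInvariant S :=
  MoebiusLimitExistsNegative.isRotationInvariant_of_inversion htr hsc hinv hsym hnd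

/-- The two-point function of any limit is symmetric on non-coincident pairs (lattice symmetry).
[folklore] -/
theorem limit_two_symm' {ρ : ℝ → ℝ} {S : CorrFamily 3}
    (hlim : HasPointwiseScalingLimit (criticalCorr 3) ρ S) {p q : EuclideanSpace ℝ (Fin 3)}
    (hpq : p ≠ q) : S 2 ![p, q] = S 2 ![q, p] := by
  have h1 := (hlim 2).tendsto_at (pair_mem_nonCoincident hpq)
  have h2 := (hlim 2).tendsto_at (pair_mem_nonCoincident hpq.symm)
  refine tendsto_nhds_unique h1 (h2.congr fun δ => ?_)
  rw [rescaledCorrelator_apply, rescaledCorrelator_apply, latticeApprox_comp_two, latticeApprox_comp_two,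
    criticalCorr_two_pair, criticalCorr_two_pair]
  simp only [Matrix.cons_val_zero, Matrix.cons_val_one, Matrix.cons_val_fin_one]
  rw [criticalTwoPoint_sub_comm]

/-- **THE CRUX, FINAL FORM: a non-degenerate pointwise limit exists and is covariant under the unit
inversion** (same statement landed as `MoebiusLimitExistsNegative.moebiusLimit_iff_inversion`,
`Negative/CruxInversionOnly.lean`; re-proved here from the landed ingredients). [folklore] -/
theorem crux_iff_inversion :
    Crux ↔ ∃ (ρ : ℝ → ℝ) (Δ : ℝ) (S : CorrFamily 3), (∀ δ ∈ Set.Ioc (0:ℝ) 1, 0 < ρ δ) ∧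
      HasPointwiseScalingLimit (criticalCorr 3) ρ S ∧ IsNondegenerateTwoPoint S ∧ IsInversionCovariant Δ S := by
  classical
  constructor
  · rintro ⟨ρ, Δ, S, h1, -, h3, h4, h5⟩
    exact ⟨ρ, Δ, S, h1, h3, h4, h5.2.2⟩
  · rintro ⟨ρ, Δ, S, hρ, hlim, hnd, hinv⟩
    set S' : CorrFamily 3 := fun n x => if x ∈ NonCoincident 3 n then S n x else 0 with hS'
    have hlim' : HasPointwiseScalingLimit (criticalCorr 3) ρ S' :=
      MoebiusLimitExistsNegative.normalised_hasLimit hlim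
    have hnd' : IsNondegenerateTwoPoint S' := MoebiusLimitExistsNegative.normalised_nondeg hnd
    have htr' : IsTranslationInvariant S' :=
      MoebiusLimitExistsNegative.isTranslationInvariant_normalised_of_limit hlim
    have hinv' : IsInversionCovariant Δ S' := MoebiusLimitExistsNegative.normalised_inversion hinv
    obtain ⟨Δ', hwin, hsc'⟩ := MoebiusLimitExistsNegative.exists_scaleCovariant_normalised hρ hlim hnd
    have hsym' : ∀ p q : EuclideanSpace ℝ (Fin 3), p ≠ q → S' 2 ![p, q] = S' 2 ![q, p] := by
      intro p q hpq
      simp only [hS', if_pos (pair_mem_nonCoincident hpq), if_pos (pair_mem_nonCoincident hpq.symm)]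
      exact limit_two_symm' hlim hpq
    have hΔ : Δ = Δ' := MoebiusLimitExistsNegative.delta_eq_of_inversion_of_scale' htr' hsc' hinv' hsym' hnd'
    subst hΔ
    have hrot' : IsRotationInvariant S' := rotation_of_inversion htr' hsc' hinv' hsym' hnd'
    exact ⟨ρ, Δ, S', hρ, by linarith [hwin.1], hlim', hnd', ⟨⟨htr', hrot'⟩, hsc', hinv'⟩⟩

/-- The sub-problem statement in the same final form (plus (iii)). [folklore] -/
theorem conjunct_iff_inversion :
    _root_.Ising3DConformalLimit ↔ ∃ (ρ : ℝ → ℝ) (Δ : ℝ) (S : CorrFamily 3), (∀ δ ∈ Set.Ioc (0:ℝ) 1, 0 < ρ δ) ∧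
      HasPointwiseScalingLimit (criticalCorr 3) ρ S ∧ IsNondegenerateTwoPoint S ∧ IsInversionCovariant Δ S ∧
        HasNontrivialU4 S := by
  rw [conjunct_iff_crux_and_u4]
  constructor
  · rintro ⟨ρ, Δ, S, ⟨h1, -, h3, h4, h5⟩, h6⟩
    exact ⟨ρ, Δ, S, h1, h3, h4, h5.2.2, h6⟩
  · rintro ⟨ρ, Δ, S, hρ, hlim, hnd, hinv, hU⟩
    -- run the crux direction on the normalised family and transport (iii)
    classical
    set S' : CorrFamily 3 := fun n x => if x ∈ NonCoincident 3 n then S n x else 0 with hS'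
    have hlim' : HasPointwiseScalingLimit (criticalCorr 3) ρ S' :=
      MoebiusLimitExistsNegative.normalised_hasLimit hlim
    have hnd' : IsNondegenerateTwoPoint S' := MoebiusLimitExistsNegative.normalised_nondeg hnd
    have htr' : IsTranslationInvariant S' :=
      MoebiusLimitExistsNegative.isTranslationInvariant_normalised_of_limit hlim
    have hinv' : IsInversionCovariant Δ S' := MoebiusLimitExistsNegative.normalised_inversion hinv
    obtain ⟨Δ', hwin, hsc'⟩ := MoebiusLimitExistsNegative.exists_scaleCovariant_normalised hρ hlim hnd
    have hsym' : ∀ p q : EuclideanSpace ℝ (Fin 3), p ≠ q → S' 2 ![p, q] = S' 2 ![q, p] := by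
      intro p q hpq
      simp only [hS', if_pos (pair_mem_nonCoincident hpq), if_pos (pair_mem_nonCoincident hpq.symm)]
      exact limit_two_symm' hlim hpq
    have hΔ : Δ = Δ' := MoebiusLimitExistsNegative.delta_eq_of_inversion_of_scale' htr' hsc' hinv' hsym' hnd'
    subst hΔ
    have hrot' : IsRotationInvariant S' := rotation_of_inversion htr' hsc' hinv' hsym' hnd'
    exact ⟨ρ, Δ, S', ⟨hρ, by linarith [hwin.1], hlim', hnd', ⟨⟨htr', hrot'⟩, hsc', hinv'⟩⟩,
      MoebiusLimitExistsNegative.hasNontrivialU4_normalised_iff.2 hU⟩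

/-! ## §B Forced parameters -/

/-- **Any witness has `Δ ∈ [1/2, 1]`** (tree `scalingDimension_mem_Icc_holds`: infrared bound
`⟨σ₀σ_x⟩_{β_c} ≤ C‖x‖⁻¹` and the Simon–Lieb lower bound `≥ c‖x‖⁻²` on `ℤ³`). The predicted value
is `Δ_σ = 0.5181489(10)`. [cite: Simon1980, Thm. 1] -/
theorem witness_delta_mem_Icc {ρ : ℝ → ℝ} {Δ : ℝ} {S : CorrFamily 3} (h : IsWitness ρ Δ S) :
    Δ ∈ Set.Icc (1 / 2 : ℝ) 1 :=
  scalingDimension_mem_Icc_holds ρ Δ S h.lim h.scale h.nondeg h.rho_pos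

/-- The unit vector `e₀ ∈ ℝ³`. [folklore] -/
def e₀ : EuclideanSpace ℝ (Fin 3) := EuclideanSpace.single 0 1

/-- `t • e₀ = (t, 0, 0)`. [folklore] -/
theorem smul_e₀ (t : ℝ) : t • e₀ = EuclideanSpace.single 0 t := by
  ext j
  by_cases hj : j = 0
  · subst hj; simp [e₀]
  · simp [e₀, hj]

/-- The configuration `(0, e₀)`. [folklore] -/
def cfg01 : Fin 2 → EuclideanSpace ℝ (Fin 3) := ![0, e₀]

/-- `(0, e₀)` is non-coincident. [folklore] -/
theorem cfg01_mem : cfg01 ∈ NonCoincident 3 2 :=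
  zero_unitVec_mem_nonCoincident one_ne_zero

/-- `(0, t e₀)` is non-coincident for `t ≠ 0`. [folklore] -/
theorem axisCfg_mem {t : ℝ} (ht : t ≠ 0) :
    (![0, t • e₀] : Fin 2 → EuclideanSpace ℝ (Fin 3)) ∈ NonCoincident 3 2 := by
  rw [smul_e₀]; exact zero_unitVec_mem_nonCoincident ht

/-- **No bounded renormalisation**: for any witness `ρ(δ)² → ∞` as `δ → 0⁺` — indeed
`ρ(δ)⁻² ≤ K δ` eventually (tree `exists_eventually_inv_sq_rho_le`: `S₂ > 0` at one pair plus the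
infrared bound). [cite: AizenmanCDM2020, §8.1 eq. (8.4)] -/
theorem witness_rho_sq_tendsto_atTop {ρ : ℝ → ℝ} {Δ : ℝ} {S : CorrFamily 3} (h : IsWitness ρ Δ S) :
    Tendsto (fun δ => ρ δ ^ 2) (𝓝[>] (0:ℝ)) atTop := by
  obtain ⟨K, hK⟩ := exists_eventually_inv_sq_rho_le (d := 3) le_rfl h.lim cfg01_mem
    (h.nondeg _ cfg01_mem)
  -- `0 < ρ(δ)⁻² ≤ K δ → 0`, so `ρ(δ)⁻² → 0⁺` and `ρ(δ)² → ∞`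
  have hup : Tendsto (fun δ : ℝ => K * δ ^ (3 - 2)) (𝓝[>] (0:ℝ)) (𝓝 0) := by
    have h0 : Tendsto (fun δ : ℝ => δ ^ (3 - 2)) (𝓝 (0:ℝ)) (𝓝 0) := by
      simpa using (continuous_pow (3 - 2)).tendsto (0:ℝ)
    simpa using (h0.const_mul K).mono_left nhdsWithin_le_nhds
  have hinv : Tendsto (fun δ => (ρ δ ^ 2)⁻¹) (𝓝[>] (0:ℝ)) (𝓝[>] 0) := by
    refine tendsto_nhdsWithin_iff.2 ⟨?_, ?_⟩
    · refine tendsto_of_tendsto_of_tendsto_of_le_of_le' tendsto_const_nhds hup ?_ ?_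
      · filter_upwards [hK] with δ hδ using (inv_pos.2 hδ.1).le
      · filter_upwards [hK] with δ hδ using hδ.2
    · filter_upwards [hK] with δ hδ using inv_pos.2 hδ.1
  refine (tendsto_inv_nhdsGT_zero.comp hinv).congr fun δ => ?_
  simp [Function.comp]

/-! ## §B' The anomalous dimension is forced to exist (tree: `Negative/EtaExists.lean`) -/

/-- Any witness forces `η` to exist with `η = 2Δ − 1` (landed theorem
`MoebiusLimitExistsNegative.hasIsingExponentEta_of_covariantLimit`; uses only `O(3)` + scale).
[cite: FrancescoMathieuSenechal1997, §4.3.1 eq. (4.56)] -/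
theorem witness_hasIsingExponentEta {ρ : ℝ → ℝ} {Δ : ℝ} {S : CorrFamily 3} (h : IsWitness ρ Δ S) :
    HasIsingExponentEta 3 (2 * Δ - 1) :=
  MoebiusLimitExistsNegative.hasIsingExponentEta_of_covariantLimit h.rho_pos h.lim h.nondeg
    h.euclid.2 h.scale

/-- Any witness has `Δ ∈ [1/2, 3/4]` (DCP25 Thm 1.5 on top of §B'). [cite: DuminilCopinPanis2025LowerBounds, Theorem 1.5] -/
theorem witness_delta_mem_Icc' {ρ : ℝ → ℝ} {Δ : ℝ} {S : CorrFamily 3} (h : IsWitness ρ Δ S) :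
    Δ ∈ Set.Icc (1 / 2 : ℝ) (3 / 4) :=
  MoebiusLimitExistsNegative.delta_mem_Icc_of_covariantLimit h.rho_pos h.lim h.nondeg h.euclid.2 h.scale

/-- The crux implies that `η(3)` exists, in `[0, 1/2]` (an open lattice statement, item 0635-type).
[cite: DuminilCopinPanis2025LowerBounds, Theorem 1.5] -/
theorem crux_implies_eta_exists (h : Crux) : ∃ η : ℝ, η ∈ Set.Icc (0:ℝ) (1 / 2) ∧ HasIsingExponentEta 3 η :=
  MoebiusLimitExistsNegative.moebiusLimit_implies_eta_exists h

/-- **`Δ` is unique across witnesses** (landed `Negative/DeltaUnique.lean`). [cite: FrancescoMathieuSenechal1997, §4.3.1 eq. (4.56)] -/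
theorem witness_delta_unique {ρ₁ ρ₂ : ℝ → ℝ} {Δ₁ Δ₂ : ℝ} {S₁ S₂ : CorrFamily 3}
    (h₁ : IsWitness ρ₁ Δ₁ S₁) (h₂ : IsWitness ρ₂ Δ₂ S₂) : Δ₁ = Δ₂ :=
  MoebiusLimitExistsNegative.delta_unique_of_covariantLimits h₁.rho_pos h₁.lim h₁.nondeg h₁.euclid.2
    h₁.scale h₂.rho_pos h₂.lim h₂.nondeg h₂.euclid.2 h₂.scale

/-! ## §D Lattice consequences of the crux (tree: `Negative/RatioRegular.lean`) -/

/-- **Any witness forces two-point ratio asymptotics on `ℤ³`**: for comparable Euclidean norms,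
`⟨σ₀σ_y⟩/⟨σ₀σ_x⟩ − (‖ŷ‖₂/‖x̂‖₂)^{−2Δ} → 0` uniformly — ratio regularity, doubling and asymptotic
isotropy of the critical two-point function follow (all open on `ℤ³`). [folklore] -/
theorem witness_two_point_ratio_asymptotics {ρ : ℝ → ℝ} {Δ : ℝ} {S : CorrFamily 3}
    (h : IsWitness ρ Δ S) {ε : ℝ} (hε : 0 < ε) :
    ∃ R : ℝ, ∀ x y : Site 3, R ≤ ‖x‖ → ‖siteVec x‖ / 2 ≤ ‖siteVec y‖ →
      ‖siteVec y‖ ≤ 2 * ‖siteVec x‖ →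
        |criticalTwoPoint 3 y / criticalTwoPoint 3 x -
          (‖siteVec y‖ / ‖siteVec x‖) ^ (-(2:ℝ) * Δ)| ≤ ε :=
  MoebiusLimitExistsNegative.two_point_ratio_asymptotics h.rho_pos h.lim h.nondeg h.euclid.2 h.scale hε

/-- **Any witness forces ratio regularity** `⟨σ₀σ_{x+u}⟩/⟨σ₀σ_x⟩ → 1` (landed
`Negative/RatioRegularCorollaries.lean`). [folklore] -/
theorem crux_implies_ratio_regularity (h : Crux) (u : Site 3) :
    Tendsto (fun x : Site 3 => criticalTwoPoint 3 (x + u) / criticalTwoPoint 3 x) cofinite (𝓝 1) :=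
  MoebiusLimitExistsNegative.moebiusLimit_implies_ratio_regularity h u

/-- **Any witness forces two-point doubling** with exponent `Δ ∈ [1/2, 3/4]`. [folklore] -/
theorem crux_implies_doubling (h : Crux) :
    ∃ Δ : ℝ, Δ ∈ Set.Icc (1 / 2 : ℝ) (3 / 4) ∧
      Tendsto (fun x : Site 3 => criticalTwoPoint 3 ((2:ℤ) • x) / criticalTwoPoint 3 x) cofinite
        (𝓝 ((2:ℝ) ^ (-(2:ℝ) * Δ))) :=
  MoebiusLimitExistsNegative.moebiusLimit_implies_doubling h

/-! ## §C Strengthenings refuted -/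

/-- The crux with an extra constraint on `Δ`. [folklore] -/
def CruxWithDelta (P : ℝ → Prop) : Prop :=
  ∃ (ρ : ℝ → ℝ) (Δ : ℝ) (S : CorrFamily 3), IsWitness ρ Δ S ∧ P Δ

/-- REFUTED STRENGTHENING: no witness with `Δ < 1/2` (infrared bound). [cite: Simon1980, Thm. 1] -/
theorem not_cruxWithDelta_lt_half : ¬ CruxWithDelta (· < 1 / 2) := by
  rintro ⟨ρ, Δ, S, h, hΔ⟩
  exact absurd (witness_delta_mem_Icc h).1 (not_le.2 hΔ)

/-- REFUTED STRENGTHENING: no witness with `1 < Δ` (Simon–Lieb lower bound). [cite: Simon1980, Thm. 1] -/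
theorem not_cruxWithDelta_gt_one : ¬ CruxWithDelta (1 < ·) := by
  rintro ⟨ρ, Δ, S, h, hΔ⟩
  exact absurd (witness_delta_mem_Icc h).2 (not_le.2 hΔ)

/-- REFUTED STRENGTHENING: no witness with `3/4 < Δ` (DCP25 Thm 1.5 via §B').
[cite: DuminilCopinPanis2025LowerBounds, Theorem 1.5] -/
theorem not_cruxWithDelta_gt_three_quarters : ¬ CruxWithDelta (3 / 4 < ·) := by
  rintro ⟨ρ, Δ, S, h, hΔ⟩
  exact absurd (witness_delta_mem_Icc' h).2 (not_le.2 hΔ)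

/-- The crux with a BOUNDED renormalisation. [folklore] -/
def CruxWithBoundedRho : Prop :=
  ∃ (ρ : ℝ → ℝ) (Δ : ℝ) (S : CorrFamily 3), IsWitness ρ Δ S ∧ ∃ M : ℝ, ∀ δ ∈ Set.Ioc (0:ℝ) 1, ρ δ ≤ M

/-- REFUTED STRENGTHENING: the renormalisation cannot stay bounded (`ρ² → ∞`). [folklore] -/
theorem not_cruxWithBoundedRho : ¬ CruxWithBoundedRho := by
  rintro ⟨ρ, Δ, S, h, M, hM⟩
  have ht := witness_rho_sq_tendsto_atTop h
  have hev : ∀ᶠ δ in 𝓝[>] (0:ℝ), ρ δ ^ 2 ≤ M ^ 2 := by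
    have hmem : Set.Ioc (0:ℝ) 1 ∈ 𝓝[>] (0:ℝ) := Ioc_mem_nhdsGT one_pos
    filter_upwards [hmem] with δ hδ
    have h0 : 0 < ρ δ := h.rho_pos δ hδ
    exact pow_le_pow_left₀ h0.le (hM δ hδ) 2
  have hbig := ht.eventually_gt_atTop (M ^ 2)
  obtain ⟨δ, h1, h2⟩ := (hev.and hbig).exists
  exact absurd h1 (not_le.2 h2)

/-- JUNK VARIANT: the limit demanded also at ONE coincident pair `(0, 0)` (the crux with
`NonCoincident` enlarged). [folklore] -/
def CruxWithLimitAtDiagonal : Prop :=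
  ∃ (ρ : ℝ → ℝ) (Δ : ℝ) (S : CorrFamily 3), IsWitness ρ Δ S ∧
    Tendsto (fun δ => rescaledCorrelator (criticalCorr 3) ρ 2 δ ![0, 0]) (𝓝[>] (0:ℝ)) (𝓝 (S 2 ![0, 0]))

/-- REFUTED: at a coincident pair the lattice correlator is `⟨σ²⟩ = 1`, so convergence of
`ρ(δ)²·1` would bound `ρ`, contradicting `ρ² → ∞`. Any proof must keep the limit clause on
`NonCoincident` only (as the crux does). [folklore] -/
theorem not_cruxWithLimitAtDiagonal : ¬ CruxWithLimitAtDiagonal := by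
  rintro ⟨ρ, Δ, S, h, hdiag⟩
  have hresc : ∀ δ, rescaledCorrelator (criticalCorr 3) ρ 2 δ ![0, 0] = ρ δ ^ 2 := by
    intro δ
    rw [rescaledCorrelator_apply]
    have : (fun i => latticeApprox δ ((![0, 0] : Fin 2 → EuclideanSpace ℝ (Fin 3)) i)) = ![0, 0] := by
      funext i; fin_cases i <;> simp [latticeApprox_zero]
    rw [this, criticalCorr_two_pair, sub_zero, criticalTwoPoint_zero', mul_one]
  simp_rw [hresc] at hdiag
  have ht := witness_rho_sq_tendsto_atTop h
  exact not_tendsto_nhds_of_tendsto_atTop ht _ hdiag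

/-- JUNK VARIANT: non-degeneracy demanded on the diagonal too. [folklore] -/
def CruxWithNondegOnDiagonal : Prop :=
  ∃ (ρ : ℝ → ℝ) (Δ : ℝ) (S : CorrFamily 3), IsWitness ρ Δ S ∧ ∀ x : Fin 2 → EuclideanSpace ℝ (Fin 3), 0 < S 2 x

/-- REFUTED (pure algebra): scale covariance at the fixed configuration `(0,0)` reads
`S₂(0,0) = 2^{-2Δ} S₂(0,0)`, so `S₂(0,0) = 0` since `Δ > 0`. [folklore] -/
theorem not_cruxWithNondegOnDiagonal : ¬ CruxWithNondegOnDiagonal := by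
  rintro ⟨ρ, Δ, S, h, hpos⟩
  have hsc := h.scale 2 2 two_pos ![0, 0]
  have hcfg : (fun i => (2:ℝ) • (![0, 0] : Fin 2 → EuclideanSpace ℝ (Fin 3)) i) = ![0, 0] := by
    funext i; fin_cases i <;> simp
  rw [hcfg] at hsc
  have hlt : (2:ℝ) ^ (-((2:ℕ):ℝ) * Δ) < 1 := by
    apply Real.rpow_lt_one_of_one_lt_of_neg one_lt_two
    have := h.delta_pos
    push_cast; linarith
  have h0 := hpos ![0, 0]
  have h1 := mul_lt_mul_of_pos_right hlt h0
  rw [one_mul] at h1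
  linarith

/-- JUNK VARIANT: inversion covariance demanded at ALL configurations (origin included; Mathlib's
`inversion 0 1 0 = 0`). [folklore] -/
def CruxWithInversionAtOrigin : Prop :=
  ∃ (ρ : ℝ → ℝ) (Δ : ℝ) (S : CorrFamily 3), IsWitness ρ Δ S ∧
    ∀ n (x : Fin n → EuclideanSpace ℝ (Fin 3)),
      S n (fun i => inversion 0 1 (x i)) = (∏ i, ‖x i‖ ^ (2 * Δ)) * S n x

/-- REFUTED (pure algebra): at `(0, e₀)` the weight `‖0‖^{2Δ} = 0` kills `S₂(0,e₀) > 0`. So the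
side condition `∀ i, x i ≠ 0` of `IsInversionCovariant` is load-bearing. [folklore] -/
theorem not_cruxWithInversionAtOrigin : ¬ CruxWithInversionAtOrigin := by
  rintro ⟨ρ, Δ, S, h, hinv⟩
  have h1 := hinv 2 cfg01
  have hfix : (fun i => inversion (0 : EuclideanSpace ℝ (Fin 3)) 1 (cfg01 i)) = cfg01 := by
    have he : inversion (0 : EuclideanSpace ℝ (Fin 3)) 1 e₀ = e₀ :=
      inversion_of_mem_sphere (by simp [e₀])
    funext i
    fin_cases i
    · simp [cfg01, inversion_self]
    · simp [cfg01, he]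
  have hprod : (∏ i, ‖cfg01 i‖ ^ (2 * Δ)) = 0 := by
    rw [Fin.prod_univ_two]
    have hΔ : (2 * Δ) ≠ 0 := by have := h.delta_pos; positivity
    simp [cfg01, e₀, Real.zero_rpow hΔ]
  rw [hfix, hprod, zero_mul] at h1
  exact absurd h1 (h.nondeg _ cfg01_mem).ne'

/-- Explicit two-point function on the axis: `S₂(0, t e₀) = t^{-2Δ} S₂(0, e₀)` for `t > 0`
(scale covariance alone). [cite: FrancescoMathieuSenechal1997, §4.3.1 eq. (4.49)] -/
theorem two_point_axis {Δ : ℝ} {S : CorrFamily 3} (hsc : IsScaleCovariant Δ S) {t : ℝ} (ht : 0 < t) :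
    S 2 ![0, t • e₀] = t ^ (-(2:ℝ) * Δ) * S 2 cfg01 := by
  have h := hsc 2 t ht cfg01
  have hcfg : (fun i => t • cfg01 i) = ![0, t • e₀] := by
    funext i; fin_cases i <;> simp [cfg01]
  rw [hcfg] at h
  rw [h]; push_cast; rfl

/-- The two-point function of a witness is unbounded near the diagonal:
`S₂(0, t e₀) → ∞` as `t → 0⁺`. [folklore] -/
theorem two_point_tendsto_atTop {ρ : ℝ → ℝ} {Δ : ℝ} {S : CorrFamily 3} (h : IsWitness ρ Δ S) :
    Tendsto (fun t : ℝ => S 2 ![0, t • e₀]) (𝓝[>] (0:ℝ)) atTop := by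
  have hA : 0 < S 2 cfg01 := h.nondeg _ cfg01_mem
  have hexp : -(2:ℝ) * Δ < 0 := by have := h.delta_pos; linarith
  have h1 : Tendsto (fun t : ℝ => t ^ (-(2:ℝ) * Δ)) (𝓝[>] (0:ℝ)) atTop :=
    tendsto_rpow_neg_nhdsGT_zero hexp
  have h2 := h1.atTop_mul_const hA
  refine h2.congr' ?_
  filter_upwards [self_mem_nhdsWithin] with t ht
  exact (two_point_axis h.scale ht).symm

/-- JUNK VARIANT: a limit whose two-point function is continuous on ALL of `(ℝ³)²`. [folklore] -/
def CruxWithContinuousTwoPoint : Prop :=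
  ∃ (ρ : ℝ → ℝ) (Δ : ℝ) (S : CorrFamily 3), IsWitness ρ Δ S ∧ Continuous (S 2)

/-- REFUTED: `S₂(0, t e₀) = t^{-2Δ}S₂(0,e₀) → ∞` at the diagonal, so `S₂` is not continuous at
`(0,0)`; continuity can only be asked on `NonCoincident`. [folklore] -/
theorem not_cruxWithContinuousTwoPoint : ¬ CruxWithContinuousTwoPoint := by
  rintro ⟨ρ, Δ, S, h, hcont⟩
  -- the path `t ↦ (0, t e₀)` is continuous and hits `(0,0)` at `t = 0`
  have hpath : Continuous (fun t : ℝ => (![0, t • e₀] : Fin 2 → EuclideanSpace ℝ (Fin 3))) := by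
    refine continuous_pi fun i => ?_
    fin_cases i
    · simpa using continuous_const
    · exact (continuous_id.smul continuous_const : Continuous fun a : ℝ => a • e₀)
  have hT := ((hcont.comp hpath).tendsto 0).mono_left (nhdsWithin_le_nhds (s := Set.Ioi (0:ℝ)))
  exact not_tendsto_nhds_of_tendsto_atTop (two_point_tendsto_atTop h) _ hT

/-- JUNK VARIANT: UNIFORM convergence on all of `NonCoincident 3 2`. [folklore] -/
def CruxWithUniformLimit : Prop :=
  ∃ (ρ : ℝ → ℝ) (Δ : ℝ) (S : CorrFamily 3), IsWitness ρ Δ S ∧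
    TendstoUniformlyOn (rescaledCorrelator (criticalCorr 3) ρ 2) (S 2) (𝓝[>] (0:ℝ)) (NonCoincident 3 2)

/-- REFUTED: at fixed mesh the rescaled lattice correlator is bounded by `ρ(δ)²` (`|⟨σσ⟩| ≤ 1`),
while `S₂(0, t e₀) → ∞` as `t → 0⁺`; uniform closeness within `1` on all non-coincident pairs is
impossible. Local uniformity is the right clause. [folklore] -/
theorem not_cruxWithUniformLimit : ¬ CruxWithUniformLimit := by
  rintro ⟨ρ, Δ, S, h, hunif⟩
  rw [Metric.tendstoUniformlyOn_iff] at hunif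
  obtain ⟨δ, hδ⟩ := (hunif 1 one_pos).exists
  -- a pair `(0, t e₀)` with `S₂ > ρ(δ)² + 1`
  have hbig := (two_point_tendsto_atTop h).eventually_gt_atTop (ρ δ ^ 2 + 1)
  obtain ⟨t, ht, htpos⟩ := (hbig.and self_mem_nhdsWithin).exists
  have hmem : (![0, t • e₀] : Fin 2 → EuclideanSpace ℝ (Fin 3)) ∈ NonCoincident 3 2 :=
    axisCfg_mem (ne_of_gt (Set.mem_Ioi.1 htpos))
  have hd := hδ _ hmem
  rw [Real.dist_eq] at hd
  have hbound : |rescaledCorrelator (criticalCorr 3) ρ 2 δ ![0, t • e₀]| ≤ ρ δ ^ 2 := by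
    rw [rescaledCorrelator_apply, abs_mul, abs_pow, ← sq_abs, sq_abs]
    calc |ρ δ| ^ 2 * |criticalCorr 3 2 _| ≤ |ρ δ| ^ 2 * 1 :=
          mul_le_mul_of_nonneg_left (abs_criticalCorr_le_one le_rfl _ _) (by positivity)
      _ = ρ δ ^ 2 := by rw [mul_one, sq_abs]
  have := abs_sub_abs_le_abs_sub (S 2 ![0, t • e₀])
    (rescaledCorrelator (criticalCorr 3) ρ 2 δ ![0, t • e₀])
  have hSpos : 0 < S 2 ![0, t • e₀] := by
    have := sq_nonneg (ρ δ); linarith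
  rw [abs_of_pos hSpos] at this
  linarith

/-! ## §A⁶ Non-degeneracy is ONE BIT; `ρ` is WLOG `ρ_pin` (gen 3; tree `Negative/TwoPointPositivity.lean`
p73296, `Negative/PinnedRenormalisation.lean`) -/

/-- **Dichotomy**: for ANY pointwise limit of the critical correlators, `S₂ > 0` at one non-coincident
pair iff at all of them (inward Messager–Miracle-Solé; OUTWARD by the chain-of-meshes argument
`two_pos_propagates_outward`: a zero at scale `t` forces `⟨σ₀σ_{N_j e₀}⟩ ≤ ε^j` along
`N_j ≈ (s/δ₀)(t/s)^j` for every `ε`, against Simon–Lieb `≥ c N^{-2}`). [cite: Simon1980, Thm. 1] -/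
theorem crux_nondeg_iff_exists_pos {ρ : ℝ → ℝ} {S : CorrFamily 3}
    (hlim : HasPointwiseScalingLimit (criticalCorr 3) ρ S) :
    IsNondegenerateTwoPoint S ↔ ∃ x ∈ NonCoincident 3 2, 0 < S 2 x :=
  MoebiusLimitExistsNegative.isNondegenerateTwoPoint_iff_exists_pos hlim

/-- The crux with non-degeneracy WEAKENED to "`S₂ ≢ 0` on non-coincident pairs" (and only the
inversion generator): still equivalent. So the clause `IsNondegenerateTwoPoint` carries one bit —
it excludes exactly the vacuum-type limits of `cruxWithoutNondegeneracy_holds`. [folklore] -/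
theorem crux_iff_weak_nondeg :
    Crux ↔ ∃ (ρ : ℝ → ℝ) (Δ : ℝ) (S : CorrFamily 3), (∀ δ ∈ Set.Ioc (0:ℝ) 1, 0 < ρ δ) ∧
      HasPointwiseScalingLimit (criticalCorr 3) ρ S ∧ (∃ x ∈ NonCoincident 3 2, 0 < S 2 x) ∧
        IsInversionCovariant Δ S := by
  rw [crux_iff_inversion]
  constructor
  · rintro ⟨ρ, Δ, S, hρ, hlim, hnd, hinv⟩
    exact ⟨ρ, Δ, S, hρ, hlim, (crux_nondeg_iff_exists_pos hlim).1 hnd, hinv⟩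
  · rintro ⟨ρ, Δ, S, hρ, hlim, hex, hinv⟩
    exact ⟨ρ, Δ, S, hρ, hlim, (crux_nondeg_iff_exists_pos hlim).2 hex, hinv⟩

/-- **`ρ` IS WLOG `ρ_pin`** (landed `Negative/PinnedRenormalisation.lean`): the crux holds iff the
PINNED zoom has a non-degenerate Möbius covariant pointwise limit. [folklore] -/
theorem crux_iff_pinnedLimit :
    Crux ↔ ∃ (Δ : ℝ) (S : CorrFamily 3), MoebiusLimitExistsOnlyInteraction.PinnedLimit Δ S :=
  MoebiusLimitExistsNegative.moebiusLimit_iff_pinnedLimit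

/-- Every pointwise limit for the pinned renormalisation is non-degenerate (landed). [folklore] -/
theorem pinned_nondeg_free {S : CorrFamily 3}
    (hlim : HasPointwiseScalingLimit (criticalCorr 3) MoebiusLimitExistsOnlyInteraction.rhoPin S) :
    IsNondegenerateTwoPoint S :=
  MoebiusLimitExistsNegative.isNondegenerateTwoPoint_of_pinnedLimit hlim

/-- **THE CRUX IN TWO CLAUSES** (landed `Negative/PinnedRenormalisation.lean`): the pinned zoom of
the critical `ℤ³` correlators converges (locally uniformly off diagonals, all `n`) to a family
covariant under `x ↦ x/‖x‖²`. Nothing else. [folklore] -/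
theorem crux_iff_pinned_inversion :
    Crux ↔ ∃ (Δ : ℝ) (S : CorrFamily 3),
      HasPointwiseScalingLimit (criticalCorr 3) MoebiusLimitExistsOnlyInteraction.rhoPin S ∧
        IsInversionCovariant Δ S :=
  MoebiusLimitExistsNegative.moebiusLimit_iff_pinned_inversion

/-- The sub-problem in three clauses (landed): pinned limit ∧ inversion ∧ `U₄ ≢ 0`. [folklore] -/
theorem conjunct_iff_pinned_inversion :
    _root_.Ising3DConformalLimit ↔ ∃ (Δ : ℝ) (S : CorrFamily 3),
      HasPointwiseScalingLimit (criticalCorr 3) MoebiusLimitExistsOnlyInteraction.rhoPin S ∧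
        IsInversionCovariant Δ S ∧ HasNontrivialU4 S :=
  MoebiusLimitExistsNegative.critIsing3DConformalLimit_iff_pinned_inversion


/-! ## §F Targets: the stubs of the picked line `only-interaction-breaks-moebius` (gen 3)

Skeleton `Cruxes/MoebiusLimitExists/Lines/only-interaction-breaks-moebius.lean` (sha 8f8c9fdb…, lead
`prover-line-stmt-CriticalPhenomena-1344-0`); objects `Theorems/EnergyNotSigmaSquaredMoebiusLimitExistsDefs.lean`
(`rhoPin`, `IsClusterPoint`, `IsRegular`, `wickPower`, `PinnedLimit`). Composition:
`IsingEuclidUpgradeR2RotInvPowerLaw (0634) → MoebiusOfTranslationInversion (4726) → Crux` modulo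
STUBS 1–6. Verdicts of the disprover, stub by stub (no stub is refuted; two are landed by the lead). -/

/-- **F.1 `stub_compactness` (OPEN; NOT SOFT).** Statement: every mesh sequence has a subsequence
along which the pinned zoom converges for all `n`, locally uniformly off diagonals, to a REGULAR `S`.
(a) Cannot be refuted here: its failure modes (local unboundedness of the pinned two-point zoom =
failure of doubling; failure of asymptotic equicontinuity) are lattice statements nobody can prove
false; and the crux IMPLIES it verbatim (deep-refuter, `Negative/OnlyInteractionTightness.lean`,
`stub1_of_crux`). (b) But it is NOT an Arzelà–Ascoli formality (`Negative/CompactnessContent.lean`,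
rc 0, landing after `PinnedRenormalisation`): already its `n = 2` clause FORCES (i) every cluster
point to be NON-DEGENERATE (`clusterPoint_nondeg_of_stub`: a zero of `S₂` at scale `T` makes the
pinned zoom at meshes `u_k/T` blow up at `(0, e₀/T)`, where no subsequence can converge), hence
(ii) TWO-POINT DOUBLING on `ℤ³`, `⟨σ₀σ_{Ne₀}⟩ ≤ K⟨σ₀σ_{2Ne₀}⟩` (`twoPoint_doubling_of_stub`), which is
OPEN (the window `cN⁻² ≤ ⟨σ₀σ_{Ne₀}⟩ ≤ CN⁻¹` allows ratios of order `N`; log-convexity gives only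
`G(2N) ≥ G(N)²`) and follows from 0634, which the line assumes anyway. SANDWICH:
crux ⇒ STUB 1 ⇒ doubling. (c) CORRECTION of a folklore "open" (gen-2 §D, several routes): AXIS RATIO
REGULARITY `⟨σ₀σ_{(k+1)eᵢ}⟩/⟨σ₀σ_{keᵢ}⟩ ↑ 1` at `β_c` on `ℤ³` is a THEOREM —
`Literature/Probability/LatticeModels/CriticalAxisRatioRegularity.lean` (this seat): the tree's
infinite-volume log-convexity `axisForm_sq_le` (Aizenman–Duminil-Copin 2021 Prop. 5.3/5.9) at
`m*(β_c) = 0` makes the ratios nondecreasing and `≤ 1`, and a limit `< 1` contradicts Simon–Lieb;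
what stays open is the RATE `1 − r_k = O(1/k)` (= doubling) and off-axis uniform versions (the
cofinite ratio regularity of `RatioRegularCorollaries`). (Printed quantitative form: ADC21
Remark 5.10, `G(Ne₁) − G((N+1)e₁) ≤ (2+o(1))(log N/N) G(Ne₁)` — the `log N` is exactly the slack
between this and doubling; the deep-refuter filed the same theorem in parallel as
`Negative/AxisRatioRegularity.lean`, and `Negative/LocalBoundsDoubling.lean` shows that the lead's
sub-stub `pinnedZoomLocallyBounded` contains axis doubling by its conclusion alone.) (d) RECOMMENDATION to the lead
(stub-sharpening, not a kill): condition STUB 1 on the two-point law exactly as STUB 2 is — DONE in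
the reshaped skeleton (sha 06794ee2…, lead's line report `Cruxes/MoebiusLimitExists/NOTES.md`):
STUB 1 is now the theorem `pinnedZoom_compactness` (schema + 0634-bounds + translation + low orders)
modulo the registered residue `stub_equicontinuity_ge_four` = asymptotic equicontinuity of the
`2m`-point zooms, `m ≥ 2`, under 0634; item 4726 was eliminated through `moebiusLimit_iff_inversion`. (e) NUDGE: the RP/transfer-matrix spectral measure
behind `axisForm_sq_le` and `twoPointFree_criticalBeta_gradient_estimate` (DCP25 (1.11)) bounds
one-point increments of `⟨σ_x σ_B⟩` by Cauchy–Schwarz, `|⟨F,Tᵏ(1−T)G⟩| ≤ ⟨F,Tᵏ(1−T)F⟩^{1/2}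
⟨G,Tᵏ(1−T)G⟩^{1/2}`, whenever a coordinate hyperplane separates `x` from `B`; the genuinely open
residue is equicontinuity at configurations with a point inside the coordinate hull of the others,
and the quantitative rate (doubling). (f) WHY DOUBLING IS GENUINELY OPEN (consistency check, on
paper): the whole a-priori toolkit along an axis — the window `cN⁻² ≤ G(N) ≤ CN⁻¹`, log-convexity
(`A = −log G` concave), MMS monotonicity and the gradient estimate — admits profiles with
`G(2N_j)/G(N_j) = N_j⁻¹ → 0`: take `A` concave piecewise linear with slope `(log N_j)/N_j` on
`[N_j/2, 2N_j]` and `N_{j+1} = N_j²` (the strip `log N − c ≤ A ≤ 2 log N + c` and concavity are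
compatible with `N A'(N) ≍ log N` at sparse scales, and the gradient bound `a_k ≤ 2G(k/2)/(kG(k))` is
then slack by a factor `N^{1/2}`). So two-point doubling needs input beyond reflection-positivity
convexity and the window — e.g. item 0634, or a sliding-scale argument controlling `N·a_N`.
[cite: AizenmanDuminilCopinAnnals2021, arXiv:1912.07973 Prop. 5.3 (5.17) and §5.5 proof of Prop. 5.9 (p. 19)]
[cite: DuminilCopinPanis2025LowerBounds, eq. (1.11)] [cite: DuminilCopinICM2022, §8.4 p. 29] -/
theorem target_stub_compactness : True := trivial

/-- **ERRATUM to §D / F.1(c) in Lean** (landed `Literature/Probability/LatticeModels/CriticalAxisRatioRegularity.lean`):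
axis ratio regularity of the critical two-point function on `ℤ³` is a THEOREM —
`⟨σ₀σ_{(k+1)eᵢ}⟩_{β_c}/⟨σ₀σ_{keᵢ}⟩_{β_c} → 1` (log-convexity from reflection positivity + Simon–Lieb).
[cite: AizenmanDuminilCopinAnnals2021, arXiv:1912.07973 Prop. 5.3 (5.17) and §5.5 proof of Prop. 5.9 (p. 19)] -/
theorem axis_ratio_regularity_free (i : Fin 3) :
    Tendsto (fun k : ℕ => criticalTwoPoint 3 (Pi.single i ((k + 1 : ℕ) : ℤ)) /
      criticalTwoPoint 3 (Pi.single i (k : ℤ))) atTop (𝓝 1) :=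
  criticalTwoPoint_axis_ratio_tendsto_one' i


/-- **F.2 `stub_pinnedTwoPoint` (LANDED by the lead, `Theorems/EnergyNotSigmaSquaredMoebiusLimitExistsPinnedTwoPoint.lean`).**
Remark for the record: WITHOUT the two-point law the exponent of a cluster point is not pinned at
all — not even to the window `[1/2, 1]` that binds full-filter limits (`witness_delta_mem_Icc`): along
a sparse mesh sequence `N_k⁻¹` the a-priori bounds `cN⁻² ≤ ⟨σ₀σ_{Ne₀}⟩ ≤ CN⁻¹` are compatible with a
pure power `r^{-2Δ}` on every window `[εN_k, N_k/ε]` for ANY `Δ ≥ 0` (arithmetic: needs only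
`N_k ≥ (c/C) ε^{3−4Δ}`, resp. plateaus for `Δ = 0`), the gaps between windows absorbing the
mismatch; only `Δ ≥ 0` (MMS) survives. So 0634 is consumed exactly here, as the triage said.
TIGHTNESS CAVEAT for the planners (the line is now conditional on 0634 ONLY): 0634 is STRICTLY
STRONGER than anything the crux yields at the two-point level — a crux witness has `ρ` regularly
varying of index `−Δ`, `ρ(δ) = δ^{-Δ} ℓ(δ)` with `ℓ` slowly varying and otherwise FREE, i.e. the crux
is compatible with `⟨σ₀σ_x⟩_{β_c} = ‖x‖^{-2Δ} L(‖x‖)` for any slowly varying `L` (absorbed by `ρ`), while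
0634 demands `L → c`. So `crux ⇏ 0634` (logically; no log-correction is expected in `d = 3`, but
none is excluded), whereas the crux DOES imply every use the reshaped skeleton makes of 0634
(pure-power CONTINUUM `S₂`: deep-refuter `stub2_conclusion_of_crux`; local bounds and
equicontinuity: `stub1_of_crux`). A tight variant of the line would replace the 0634 hypothesis by
the crux-implied datum "the pinned PAIR zoom converges locally uniformly on `NonCoincident 3 2` to a
continuous function of `‖x₀ − x₁‖`" (which gives `Δ`, non-degeneracy, doubling of the pinned ratios
and the `n = 2` equicontinuity, and is all that STUBS 2–6 consume). [folklore] -/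
theorem target_stub_pinnedTwoPoint : True := trivial

/-- **F.3 `stub_freeClusterPointWick` (LANDED by the lead, `…FreeClusterPointWick.lean`).** Its
hypothesis `IsClusterPoint S` is load-bearing in the obvious way: for an abstract family with the
pure-power two-point function and `U₄ ≡ 0` nothing constrains `S₆` (take `S = wickPower Δ` except
`S₆ := wickPower Δ 6 + 1` on `NonCoincident`), so the Aizenman–Newman lattice structure behind the
Wick dichotomy is what is used. [cite: AizenmanCMP1982, Prop. 12.1] -/
theorem target_stub_freeClusterPointWick : True := trivial

/-- **F.4 `stub_wickPowerMoebius : ∀ Δ, IsMoebiusCovariant Δ (wickPower Δ)` (TRUE, prover's; checked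
on paper at the edges).** All four generators act by injective maps, so they preserve
`NonCoincident` and the zero extension; on `NonCoincident` each pairing term transforms with the right
factor (`‖ιp − ιq‖ = ‖p−q‖/(‖p‖‖q‖)`, `EuclideanGeometry.dist_inversion_inversion`; dilations give
`c^{-2Δ}` per pair, `m` pairs, exponent bookkeeping `-(2m:ℝ)Δ`). Edge cases that do NOT bite:
`Δ ≤ 0` (the statement is for every real `Δ`; for `Δ = 0`, `powerKernel 0 ≡ 1` by `rpow_zero`, so
`W_{2m} ≡ (2m−1)!!` on `NonCoincident`, covariant with trivial factors), odd `n` and `n = 0`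
(`wickPower_of_odd`, `wickPower_zero`; empty product `= 1`), configurations through the origin
(excluded by `IsInversionCovariant`'s side condition) and coincident configurations (both sides `0`).
No refutation; not landed here (positive statement, D-0016). [cite: FrancescoMathieuSenechal1997, §4.3.1 eqs. (4.49)–(4.56)] -/
theorem target_stub_wickPowerMoebius : True := trivial

/-- **F.5 `stub_interactingInversion` (OPEN, XL; IMMUNE to cheap refutation).** Hypotheses:
`IsClusterPoint S`, `IsRegular S`, pure-power `S₂`, `HasNontrivialU4 S`; conclusion
`IsInversionCovariant Δ S`. (a) `IsClusterPoint S` is inhabited only by subsequential limits of the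
critical `ℤ³` correlators, none of which is constructible, so no instance can be exhibited against the
conclusion; every refutation must be a THEOREM about all cluster points, and the only free theorems
(§0, §A‴, `Negative/ClusterPointBasics.lean`: `S₀ = 1`, odd `S_n = 0`, `B₃`-symmetry of regular
cluster points, `S₂(0,e₀) = 1`, MMS, GKS/Lebowitz signs) are all compatible with inversion
covariance. (b) Load-bearing: dropping `IsClusterPoint` makes it false (regular `S` with
`S₂ = ‖x−y‖^{-2Δ}`, `S₄ := 𝟙_{NonCoincident}`: `U₄ ≢ 0`, and at `x = (e₀,2e₀,4e₀,8e₀)` the covariance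
law would read `S₄(ιx) ≤ 1 < 4096 = ∏‖xᵢ‖² · S₄(x)` for `Δ = 1`); `HasNontrivialU4 S` is NOT
load-bearing (by STUBS 3–4 a `U₄`-free regular cluster point with that `S₂` is `wickPower Δ`, which is
inversion covariant), so STUB 5 is exactly card `invert-the-cluster-points`' (I𝒞) at pinned `Δ`;
whether `IsRegular` (translation invariance + continuity of a SEQUENTIAL limit) is load-bearing is
unknown — it is not automatic along a sequence (the full-filter proofs `FreeTranslations` use meshes
`t/(k+1)`). (c) In print there is no interacting, reflection-positive, scale- but not conformally-
covariant Euclidean family in `d = 3` to instantiate even the abstract shadow of STUB 5: the catalogued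
scale-without-conformal examples are free or non-unitary (elasticity / Maxwell in `d ≠ 4`,
`ScaleCovarianceNotMoebius_holds`; the scale-averaged DSI generalised free field of TRIAGE-r1-2/3 is
Gaussian). [cite: PolandRychkovVichi2019, §II eq. (2)] [cite: DuminilCopinICM2022, §8.4 p. 29] -/
theorem target_stub_interactingInversion : True := trivial

/-- **F.6 `stub_interactingUnique` (OPEN, XL; IMMUNE likewise).** Two regular cluster points with
the same pure-power `S₂`, the first interacting, agree off the diagonals. Same immunity as F.5 (both
`S₁`, `S₂` must be cluster points). Dropping `IsClusterPoint` on either side makes it false (perturb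
`S₄` by `𝟙_{NonCoincident}`); the asymmetry (only `S₁` is asked to be interacting) is intended and is
what excludes free/interacting COEXISTENCE — note that under STUBS 1–4 coexistence at the same `Δ` is
not excluded by anything in the tree: the free cluster point `wickPower Δ` and an interacting one have
the same `S₂`, `S₀`, odd `S_n`, symmetries. What would kill it: two distinct interacting
scale-covariant RP families with equal `S₂` reachable along different mesh sequences (log-periodic
drift); no lattice mechanism known either way. [cite: DuminilCopinICM2022, §8.4 p. 29] -/
theorem target_stub_interactingUnique : True := trivial

/-- **F.7 `compactnessSchema` (lead's registered sub-goal; TRUE).** Eventual local bounds +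
asymptotic equicontinuity on compacts of the open sets `NonCoincident 3 n` ⇒ a common subsequence
with continuous normalised locally uniform limits: countable dense set + diagonal extraction +
Cauchy criterion on compact exhaustions (`σ`-compactness of open subsets of `(ℝ³)ⁿ`); the `F n k`
need not be continuous (asymptotic equicontinuity suffices). No objection. [folklore] -/
theorem target_compactnessSchema : True := trivial

/-- **F.8 item 4726 `MoebiusOfTranslationInversion` (used by the interacting branch; TRUE for every
`S` and every real `Δ`, no regularity).** In `SL₂`-coordinates on each plane through an axis,
`diag(λ^{1/2}, λ^{-1/2})` is a product of four elementary unipotents, i.e. the dilation `D_λ` is a word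
`T_a K_b T_c K_d` with `K_v = ι T_v ι`; for a GIVEN configuration `x` conjugate by a generic
translation `w` (`D_λ = T_{λw} D_λ T_{−w}`, translation invariance holds everywhere) so that no
intermediate point meets the pole; the accumulated factor is `∏ᵢ |w'(xᵢ)|^{-Δ} = λ^{-nΔ}` by the chain
rule for conformal factors. Reflections: `R_{m⊥} = ι_m ι_{m/2,1/2} ι_m` (landed `Negative/ReflectionWord.lean`)
with `ι_{c,r} = T_c D_r ι D_{1/r} T_{−c}`; rotations by Cartan–Dieudonné. Coincident configurations
are covered because `IsInversionCovariant` is demanded at coincident configurations too (only the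
origin is excluded): e.g. `n = 2`, `x = y ≠ 0` gives `f(0) = ‖x‖^{4Δ} f(0)`, so `f(0) = 0` for
`Δ ≠ 0`, consistent with scale covariance at `(x,x)`. No refutation. [cite: FrancescoMathieuSenechal1997, §4.1 eqs. (4.13)–(4.19)] -/
theorem target_item4726 : True := trivial

/-- **F.9 THE REGISTERED RESIDUES of the reshaped skeleton (06794ee2…; targets for the next arming).**
* `stub_equicontinuity_ge_four` (under 0634; `m ≥ 2`): IMPLIED BY THE CRUX (locally uniform
  convergence to a continuous limit on a compact `K` gives asymptotic equicontinuity by the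
  `ε/3`-argument; deep-refuter `Negative/AsympEquicontinuity.lean`), hence not refutable short of the
  crux; correctly ASYMPTOTIC (`∀ᶠ k` after `η`: each fixed zoom is a step function). What it contains
  beyond 0634: one-site ratio regularity of `⟨σ_x σ_B⟩_{β_c}` at scale, `|B| ≥ 3`. Nudge: for `x`
  separated from `B` by a coordinate hyperplane, `4⟨σ_{(k,x_⊥)}σ_B⟩ = q⁺_k − q⁻_k` with `q^±` axis
  forms of the tree's `axisForm_sq_le` type (log-convex, bounded), so each `q^±_{k+1}/q^±_k ↑ L^± ≤ 1`;
  if `L⁻ < 1` the difference inherits `→ 1` from `q⁺` (polynomial lower bounds by GKS), the delicate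
  case is near-cancellation `L⁺ = L⁻ = 1` — this is where a genuinely new estimate is needed, and
  configurations with a point inside the coordinate hull of the others are not covered at all.
* `stub_interactingInversion_ge_four`, `stub_interactingUnique_ge_four`: F.5/F.6 verbatim at even
  orders `≥ 4` on `NonCoincident` off the origin — IMMUNE (quantify over `IsClusterPoint`), crux-implied
  (`stub5_of_crux`, `stub6_of_crux`), false without the lattice (`StubsNeedLattice`,
  `StubsWithoutLattice`). With `crux_iff_pinned_inversion` the first IS the covariance clause of the
  conjecture on the realised branch; the lead promotes it (`promote-stub`). Nothing to kill. [folklore] -/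
theorem target_residues_ge_four : True := trivial


/-! ## §G (gen 4) The residue `stub_equicontinuity_inner` does NOT resist: MIRROR PEDIGREES

Lead-1 (prover-line-stmt-CriticalPhenomena-1344-1) reshaped STUB 1″ (asymptotic equicontinuity of
the pinned `2m`-point zoom, `m ≥ 2`, under 0634) into `moveIneq_latticeRP` (1″a), `sepMove_equicontinuity`
(1″b), `telescoping_equicontinuity` (1″c) — all provable — and the residue `stub_equicontinuity_inner`
(1″d): single-variable asymptotic equicontinuity at configurations whose moving point is NOT separated
from the others by a coordinate slab, described as "where Harnack-type regularity of critical multi-spin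
correlations on `ℤ³` lives … what no mirror argument reaches is a point (or balanced cluster) with no
separating mirror in any of the nine directions, e.g. each half of an axis-parallel `2×2×2` cube".
FINDING OF THIS GENERATION: the residue is reached by mirror arguments alone. The RP–Cauchy–Schwarz
move inequality for a CLUSTER `A ∋ i` (not only `A = {i}`) turns regularity of the `N`-point zoom at
`(x, i)` into regularity of the `2|A|`-point zoom at the DOUBLED configuration `A ∪ θA` — the points on
the far side of the mirror are DISCARDED — and a finite sequence of such cuts in the nine cubic mirror
directions always ends at a configuration where `x_i` is the strict extreme point in a coordinate
direction (the base case 1″b). The combinatorial heart is the COVERING THEOREM §G.3 (every finite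
configuration has a "mirror pedigree"), KERNEL-CHECKED below (`Pedigree.Cover.covering`, Euclidean
form `Pedigree.Cover.coveringE`; standard axioms), besides being verified by exact arithmetic on
`> 1000` configurations (`pedigree/covering.py`, kit job j012425) and certified by `decide` for the
octahedron star, the cube vertex and the `3×3×3` grid. Consequence: STUB 1″, hence STUB 1 (compactness of the
pinned zoom), is PROVABLE modulo item 0634 — the line's open content is STUBS 5′/6′ only. -/

/-- **G.0 AUDIT of the reshaped pieces 1″a–1″d (all sound; nothing mis-stated).**
* 1″a `moveIneq_latticeRP`: TRUE. With the PSD Gram form `Q(G₁,G₂) = ⟨θG₁·G₂⟩` on the closed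
  half-algebra, `F = σ_{θyᵢ}`, `F' = σ_{θy'ᵢ}`, `G = Π_{j≠i}σ_{yⱼ}`: `Q(F,G) = ⟨Πσ_y⟩`,
  Cauchy–Schwarz; the printed middle term `−2G(yᵢ − θy'ᵢ)` is right because
  `G(yᵢ − θy'ᵢ) = G(y'ᵢ − θyᵢ)` (`y'ᵢ − θyᵢ = −R(yᵢ − θy'ᵢ)`, `G` even and `R`-invariant). Edge cases
  (sites on the mirror, `y = y'`) give `0 ≤ 0`-type instances. Site-mirror RP of the infinite-volume
  critical state: `stub_latticeRP` + `criticalCorr_translate`.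
* 1″b `sepMove_equicontinuity`: TRUE. Mirror at `c = ⌊(xᵢτ + κ/2)/δ⌋`; the three vectors have
  macroscopic lengths within `3η + O(δ)` of `κ`, so the bracket is `≤ 12·Lip(t^{-2Δ}|[κ/2,2κ])·η + o(1)`
  uniformly on `K` (uniform two-point asymptotics on annuli from the cofinite law and
  `ρ_pin² = 1/G(⌊1/δ⌋e₀)`); `ρ^{2(N−1)}⟨σ_{θB}σ_B⟩` bounded by Newman (all `2(N−1)` sites pairwise
  `≥ min(sep K, κ)/δ − 2` apart); `N = 1` and odd `N` are trivial (`⟨σ⟩ = 0`). `Δ, c` are universally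
  quantified: for `Δ` outside `[1/2, 3/4]` the two-point hypothesis is vacuous, harmless.
* 1″c `telescoping_equicontinuity`: TRUE (closed `r`-thickening `K' ⊆ s`, hybrids
  `z_l = (y_{<l}, x_{≥l})` satisfy `dist z_l x ≤ dist y x` in the sup metric, so lie in `K'`;
  `N` increments `< ε/N`; `N = 0` trivial).
* 1″d `stub_equicontinuity_inner`: crux-implied (landed `Negative/AsympEquicontinuity.lean`), hence
  immune to refutation — and, by §G.1–G.4, PROVABLE modulo 0634. Note its `∃ κ > 0` (prover's choice)
  is harmless but unnecessary: the pedigree argument proves the unrestricted single-variable statement.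
[folklore] -/
theorem target_stub1pp_pieces : True := trivial

namespace Pedigree

/-! ### G.2 The combinatorial model over `ℤ³` (exact certificates by `decide`) -/

/-- A lattice point / direction of the certificate model. [folklore] -/
abbrev IPt := ℤ × ℤ × ℤ

/-- Dot product on `ℤ³`. [folklore] -/
def idot (f v : IPt) : ℤ := f.1 * v.1 + f.2.1 * v.2.1 + f.2.2 * v.2.2

/-- The reflection in the mirror `{f · v = T}` for a cubic reflection direction `f` (`‖f‖² ∈ {1, 2}`):
`v ↦ v − (2 (f·v − T) / ‖f‖²) f`, kept integral (coordinate `f`: factor `2(f·v − T)`; diagonal `f`: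
factor `f·v − T`). [folklore] -/
def irefl (f : IPt) (T : ℤ) (v : IPt) : IPt :=
  let c : ℤ := if idot f f = 1 then 2 * (idot f v - T) else idot f v - T
  (v.1 - c * f.1, v.2.1 - c * f.2.1, v.2.2 - c * f.2.2)

/-- One cut: keep the points strictly below the mirror, add their mirror images. [folklore] -/
def icut (f : IPt) (T : ℤ) (P : List IPt) : List IPt :=
  let A := P.filter fun p => decide (idot f p < T)
  A ++ A.map (irefl f T)

/-- A cut is admissible if `T > 0` (the moving point `0` is kept, off the mirror) and no point lies
on the mirror. [folklore] -/
def icutOK (f : IPt) (T : ℤ) (P : List IPt) : Bool :=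
  decide (0 < T) && P.all fun p => decide (idot f p ≠ T)

/-- Terminal: `0` is the STRICT `v₁`-minimum of the configuration. [folklore] -/
def iterminal (P : List IPt) : Bool :=
  P.all fun p => decide (p = (0, 0, 0)) || decide (0 < p.1)

/-- The nine cubic reflection directions `eᵢ, eᵢ ± eⱼ` and their negatives. [folklore] -/
def idirs : List IPt :=
  [(1,0,0),(0,1,0),(0,0,1),(1,1,0),(1,-1,0),(1,0,1),(1,0,-1),(0,1,1),(0,1,-1),
   (-1,0,0),(0,-1,0),(0,0,-1),(-1,-1,0),(-1,1,0),(-1,0,-1),(-1,0,1),(0,-1,-1),(0,-1,1)]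

/-- Check a pedigree certificate: every cut admissible with a cubic direction, final configuration
terminal. [folklore] -/
def pedigreeOK : List (IPt × ℤ) → List IPt → Bool
  | [], P => iterminal P
  | (f, T) :: cs, P => decide (f ∈ idirs) && icutOK f T P && pedigreeOK cs (icut f T P)

/-- The octahedron star: centre `0` and its six neighbours `±64 eᵢ` (scaled). [folklore] -/
def octahedron : List IPt :=
  [(0,0,0),(64,0,0),(-64,0,0),(0,64,0),(0,-64,0),(0,0,64),(0,0,-64)]

/-- **The centre of the octahedron has a mirror pedigree of depth 6** (certificate produced by the
general construction of `pedigree/covering.py`; checked by the kernel). [folklore] -/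
theorem octahedron_pedigree :
    pedigreeOK [((-1,1,0), 32), ((0,1,0), 24), ((1,0,1), 8), ((1,0,-1), 4), ((1,1,0), 2), ((1,-1,0), 1)]
      octahedron = true := by
  decide

/-- The eight vertices of a cube of side `16`, one of them at the origin. [folklore] -/
def cubeVertices : List IPt :=
  [(0,0,0),(0,0,16),(0,16,0),(0,16,16),(16,0,0),(16,0,16),(16,16,0),(16,16,16)]

/-- **A cube vertex has a mirror pedigree of depth 4** (the lead's "half of a `2×2×2` cube").
[folklore] -/
theorem cube_pedigree :
    pedigreeOK [((1,0,1), 8), ((1,0,-1), 4), ((1,1,0), 2), ((1,-1,0), 1)] cubeVertices = true := by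
  decide

/-- The `3 × 3 × 3` grid of spacing `64` centred at the origin (26 neighbours in all nine
directions). [folklore] -/
def grid27 : List IPt :=
  [(-64,-64,-64),(-64,-64,0),(-64,-64,64),(-64,0,-64),(-64,0,0),(-64,0,64),(-64,64,-64),(-64,64,0),
   (-64,64,64),(0,-64,-64),(0,-64,0),(0,-64,64),(0,0,-64),(0,0,0),(0,0,64),(0,64,-64),(0,64,0),(0,64,64),
   (64,-64,-64),(64,-64,0),(64,-64,64),(64,0,-64),(64,0,0),(64,0,64),(64,64,-64),(64,64,0),(64,64,64)]

/-- **The centre of the `3×3×3` grid has a mirror pedigree of depth 8.** [folklore] -/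
theorem grid27_pedigree :
    pedigreeOK [((-1,1,0), 32), ((0,1,0), 24), ((0,-1,0), 24), ((0,1,0), 72), ((1,0,1), 8),
      ((1,0,-1), 4), ((1,1,0), 2), ((1,-1,0), 1)] grid27 = true := by
  decide

/-! ### G.3 THE COVERING THEOREM, kernel-checked (`Cover.covering`, `Cover.coveringE`)

Model: configurations = finite sets of triples (`Cover.Pt = ℝ × ℝ × ℝ`, moving point `0`); a CUT
`Cover.pcut f T P` keeps `{pdot f · < T}` and adds the mirror images `Cover.prefl f T` of the kept
points (far side DISCARDED); `Cover.HasPedigree`: terminal = `0` strictly extreme in a coordinate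
direction, step = admissible cut (`f ∈ Cover.dirs`, the 18 signed cubic directions; `T > 0`; no
point on the mirror). PROOF = the two-phase construction: Phase 2 (`hasPedigree_of_noBlocker`:
four cuts `e₁+e₃, e₁−e₃, e₁+e₂, e₁−e₂` with tiny thresholds make a blocker-free configuration
terminal), Phase 1 = step (i) (`noAxis_after_diag`: one `(−e₁+e₂)` cut kills the axis blockers),
game (Z) (`gameZ`: `±e₃` cuts kill the blockers of the plane `p₂ = 0`), game (M) (`gameM`: `±e₂`
cuts kill all blockers), each game by induction on the measure `⌊A/b₊⌋₊ + ⌊A/b₋⌋₊` (level bound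
`A`, lower bounds `b_±` of the relevant modulus on either side; one cut at a generic
`T ∈ (x/2, x)`, `x` the least modulus, discards that side and re-creates blockers only beyond `2x`:
`floor_half_lt`). Bridge to `EuclideanSpace ℝ (Fin 3)`: `Cover.φ`, `Cover.reflect`, `Cover.rcut`,
`Cover.HasPedigreeE`, `Cover.coveringE`; positive MARGINS for the compactness argument:
`Cover.HasPedigreeM`, `Cover.coveringM`. Axioms: `propext`, `Classical.choice`, `Quot.sound`. -/

namespace Cover

open Classical

/-- Points / directions of `ℝ³` as triples. [folklore] -/
abbrev Pt := ℝ × ℝ × ℝ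

/-- Dot product. [folklore] -/
def pdot (f v : Pt) : ℝ := f.1 * v.1 + f.2.1 * v.2.1 + f.2.2 * v.2.2

/-- Reflection in the affine mirror `{pdot f · = T}`. [folklore] -/
def prefl (f : Pt) (T : ℝ) (v : Pt) : Pt :=
  (v.1 - 2 * (pdot f v - T) / pdot f f * f.1, v.2.1 - 2 * (pdot f v - T) / pdot f f * f.2.1,
    v.2.2 - 2 * (pdot f v - T) / pdot f f * f.2.2)

/-- One cut: keep `{pdot f · < T}`, add the mirror images of the kept points. [folklore] -/
def pcut (f : Pt) (T : ℝ) (P : Finset Pt) : Finset Pt :=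
  (P.filter fun p => pdot f p < T) ∪ (P.filter fun p => pdot f p < T).image (prefl f T)

/-- The 18 signed cubic reflection directions. [folklore] -/
def dirs : List Pt :=
  [(1,0,0),(0,1,0),(0,0,1),(1,1,0),(1,-1,0),(1,0,1),(1,0,-1),(0,1,1),(0,1,-1),
   (-1,0,0),(0,-1,0),(0,0,-1),(-1,-1,0),(-1,1,0),(-1,0,-1),(-1,0,1),(0,-1,-1),(0,-1,1)]

/-- MIRROR PEDIGREE (moving point `0`): terminal = `0` strictly extreme in a coordinate direction;
step = an admissible cut (cubic direction, `T > 0`, no point on the mirror). [folklore] -/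
inductive HasPedigree : Finset Pt → Prop
  | terminal {P : Finset Pt} (g : Pt) (hg : g ∈ [((1:ℝ),(0:ℝ),(0:ℝ)), (0,1,0), (0,0,1), (-1,0,0), (0,-1,0), (0,0,-1)])
      (h : ∀ p ∈ P, p ≠ 0 → 0 < pdot g p) : HasPedigree P
  | cut {P : Finset Pt} (f : Pt) (T : ℝ) (hf : f ∈ dirs) (hT : 0 < T)
      (hoff : ∀ p ∈ P, pdot f p ≠ T) (h : HasPedigree (pcut f T P)) : HasPedigree P

/-! ### Membership in a cut -/

theorem mem_pcut {f : Pt} {T : ℝ} {P : Finset Pt} {q : Pt} (hq : q ∈ pcut f T P) :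
    (q ∈ P ∧ pdot f q < T) ∨ ∃ p ∈ P, pdot f p < T ∧ q = prefl f T p := by
  simp only [pcut, Finset.mem_union, Finset.mem_filter, Finset.mem_image] at hq
  rcases hq with h | ⟨p, ⟨hp, hc⟩, rfl⟩
  · exact Or.inl h
  · exact Or.inr ⟨p, hp, hc, rfl⟩

theorem mem_pcut_of_kept {f : Pt} {T : ℝ} {P : Finset Pt} {p : Pt} (hp : p ∈ P) (hc : pdot f p < T) :
    p ∈ pcut f T P := by
  simp only [pcut, Finset.mem_union, Finset.mem_filter]
  exact Or.inl ⟨hp, hc⟩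

theorem image_mem_pcut {f : Pt} {T : ℝ} {P : Finset Pt} {p : Pt} (hp : p ∈ P) (hc : pdot f p < T) :
    prefl f T p ∈ pcut f T P := by
  simp only [pcut, Finset.mem_union, Finset.mem_filter, Finset.mem_image]
  exact Or.inr ⟨p, ⟨hp, hc⟩, rfl⟩

/-! ### The concrete reflections -/

@[simp] theorem pdot_101 (v : Pt) : pdot (1,0,1) v = v.1 + v.2.2 := by simp [pdot]
@[simp] theorem pdot_10m1 (v : Pt) : pdot (1,0,-1) v = v.1 - v.2.2 := by simp [pdot]; ring
@[simp] theorem pdot_110 (v : Pt) : pdot (1,1,0) v = v.1 + v.2.1 := by simp [pdot]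
@[simp] theorem pdot_1m10 (v : Pt) : pdot (1,-1,0) v = v.1 - v.2.1 := by simp [pdot]; ring
@[simp] theorem pdot_m110 (v : Pt) : pdot (-1,1,0) v = v.2.1 - v.1 := by simp [pdot]; ring
@[simp] theorem pdot_010 (v : Pt) : pdot (0,1,0) v = v.2.1 := by simp [pdot]
@[simp] theorem pdot_0m10 (v : Pt) : pdot (0,-1,0) v = -v.2.1 := by simp [pdot]
@[simp] theorem pdot_001 (v : Pt) : pdot (0,0,1) v = v.2.2 := by simp [pdot]
@[simp] theorem pdot_00m1 (v : Pt) : pdot (0,0,-1) v = -v.2.2 := by simp [pdot]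
@[simp] theorem pdot_100 (v : Pt) : pdot (1,0,0) v = v.1 := by simp [pdot]

@[simp] theorem prefl_101 (T : ℝ) (v : Pt) : prefl (1,0,1) T v = (T - v.2.2, v.2.1, T - v.1) := by
  simp only [prefl, pdot, Prod.mk.injEq]; refine ⟨?_, ?_, ?_⟩ <;> ring
@[simp] theorem prefl_10m1 (T : ℝ) (v : Pt) : prefl (1,0,-1) T v = (v.2.2 + T, v.2.1, v.1 - T) := by
  simp only [prefl, pdot, Prod.mk.injEq]; refine ⟨?_, ?_, ?_⟩ <;> ring
@[simp] theorem prefl_110 (T : ℝ) (v : Pt) : prefl (1,1,0) T v = (T - v.2.1, T - v.1, v.2.2) := by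
  simp only [prefl, pdot, Prod.mk.injEq]; refine ⟨?_, ?_, ?_⟩ <;> ring
@[simp] theorem prefl_1m10 (T : ℝ) (v : Pt) : prefl (1,-1,0) T v = (v.2.1 + T, v.1 - T, v.2.2) := by
  simp only [prefl, pdot, Prod.mk.injEq]; refine ⟨?_, ?_, ?_⟩ <;> ring
@[simp] theorem prefl_m110 (T : ℝ) (v : Pt) : prefl (-1,1,0) T v = (v.2.1 - T, v.1 + T, v.2.2) := by
  simp only [prefl, pdot, Prod.mk.injEq]; refine ⟨?_, ?_, ?_⟩ <;> ring
@[simp] theorem prefl_010 (T : ℝ) (v : Pt) : prefl (0,1,0) T v = (v.1, 2 * T - v.2.1, v.2.2) := by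
  simp only [prefl, pdot, Prod.mk.injEq]; refine ⟨?_, ?_, ?_⟩ <;> ring
@[simp] theorem prefl_0m10 (T : ℝ) (v : Pt) : prefl (0,-1,0) T v = (v.1, -2 * T - v.2.1, v.2.2) := by
  simp only [prefl, pdot, Prod.mk.injEq]; refine ⟨?_, ?_, ?_⟩ <;> ring
@[simp] theorem prefl_001 (T : ℝ) (v : Pt) : prefl (0,0,1) T v = (v.1, v.2.1, 2 * T - v.2.2) := by
  simp only [prefl, pdot, Prod.mk.injEq]; refine ⟨?_, ?_, ?_⟩ <;> ring
@[simp] theorem prefl_00m1 (T : ℝ) (v : Pt) : prefl (0,0,-1) T v = (v.1, v.2.1, -2 * T - v.2.2) := by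
  simp only [prefl, pdot, Prod.mk.injEq]; refine ⟨?_, ?_, ?_⟩ <;> ring

/-! ### Thresholds: strictly below the positive values of a functional, avoiding a finite set -/

/-- There is `t ∈ (a, b)` (`a < b`) avoiding any finite set of reals. [folklore] -/
theorem exists_Ioo_not_mem (a b : ℝ) (hab : a < b) (S : Finset ℝ) : ∃ t, a < t ∧ t < b ∧ t ∉ S := by
  obtain ⟨t, ht, htS⟩ := (Set.Ioo_infinite hab).exists_notMem_finset S
  exact ⟨t, ht.1, ht.2, htS⟩

/-- The least positive value of `g` on `Q`, or `1` if there is none: a positive number `m` with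
`m ≤ g q` whenever `g q > 0`. [folklore] -/
theorem exists_pos_le_all (Q : Finset Pt) (g : Pt → ℝ) :
    ∃ m : ℝ, 0 < m ∧ ∀ q ∈ Q, 0 < g q → m ≤ g q := by
  by_cases h : (Q.filter fun q => 0 < g q).Nonempty
  · obtain ⟨m, hm, hmin⟩ := (Q.filter fun q => 0 < g q).exists_min_image g h
    exact ⟨g m, (Finset.mem_filter.1 hm).2, fun q hq hgq => hmin q (Finset.mem_filter.2 ⟨hq, hgq⟩)⟩
  · exact ⟨1, one_pos, fun q hq hgq => absurd ⟨q, Finset.mem_filter.2 ⟨hq, hgq⟩⟩ h⟩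

/-- A TINY GENERIC threshold: `0 < t`, `t < g q` for every positive value `g q` on `Q`, and `t`
outside a given finite set. [folklore] -/
theorem exists_tiny (Q : Finset Pt) (g : Pt → ℝ) (S : Finset ℝ) :
    ∃ t : ℝ, 0 < t ∧ (∀ q ∈ Q, 0 < g q → t < g q) ∧ t ∉ S := by
  obtain ⟨m, hm, hmle⟩ := exists_pos_le_all Q g
  obtain ⟨t, ht0, htm, htS⟩ := exists_Ioo_not_mem 0 m hm S
  exact ⟨t, ht0, fun q hq hgq => lt_of_lt_of_le htm (hmle q hq hgq), htS⟩

/-- With a tiny threshold no point lies on the mirror. [folklore] -/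
theorem off_mirror_of_tiny {Q : Finset Pt} {g : Pt → ℝ} {t : ℝ} (ht : 0 < t)
    (htin : ∀ q ∈ Q, 0 < g q → t < g q) : ∀ q ∈ Q, g q ≠ t := by
  intro q hq h
  have := htin q hq (h ▸ ht)
  rw [h] at this; exact lt_irrefl _ this

/-! ### PHASE 2: four good cuts make a blocker-free configuration terminal -/

/-- A BLOCKER for the target "`0` is the strict `v₁`-minimum": a point of the closed backward
`ℓ^∞`-pyramid `{p₁ ≤ −|p₂|, p₁ ≤ −|p₃|}` other than `0`. [folklore] -/
def IsBlocker (p : Pt) : Prop := p ≠ 0 ∧ p.1 ≤ -|p.2.1| ∧ p.1 ≤ -|p.2.2|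

/-- GOOD point: `0` itself or strictly positive first coordinate. [folklore] -/
def Good (p : Pt) : Prop := p = 0 ∨ 0 < p.1

/-- Non-blocker, bad, with `|p₃| ≤ −p₁`: then `|p₂| > −p₁`. [folklore] -/
theorem sticker_of_not_blocker {p : Pt} (hnb : ¬ IsBlocker p) (hp0 : p ≠ 0) (h3 : p.1 ≤ -|p.2.2|) :
    -p.1 < |p.2.1| := by
  by_contra h
  exact hnb ⟨hp0, by linarith [not_lt.1 h], h3⟩

/-- Invariant after the cuts `(e₁+e₃, t)`, `(e₁−e₃, t')`: every point is good or a `v₂`-sticker. [folklore] -/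
theorem inv_after_two {P : Finset Pt} (hnb : ∀ p ∈ P, ¬ IsBlocker p) {t t' : ℝ} (ht : 0 < t) (ht' : 0 < t')
    (H1 : ∀ p ∈ P, 0 < p.1 + p.2.2 → t < p.1 + p.2.2)
    (H2 : ∀ q ∈ pcut (1,0,1) t P, 0 < q.1 - q.2.2 → t' < q.1 - q.2.2) :
    ∀ q ∈ pcut (1,0,-1) t' (pcut (1,0,1) t P), Good q ∨ (q.1 ≤ 0 ∧ -q.1 < |q.2.1|) := by
  intro q hq
  have K1 : ∀ p ∈ P, pdot (1,0,1) p < t → p.1 + p.2.2 ≤ 0 := fun p hp hc =>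
    not_lt.1 fun h => absurd (H1 p hp h) (by simp only [pdot_101] at hc; linarith)
  have K2 : ∀ q ∈ pcut (1,0,1) t P, pdot (1,0,-1) q < t' → q.1 - q.2.2 ≤ 0 := fun q hq hc =>
    not_lt.1 fun h => absurd (H2 q hq h) (by simp only [pdot_10m1] at hc; linarith)
  rcases mem_pcut hq with ⟨hq1, hqc⟩ | ⟨p', hp', hp'c, rfl⟩
  · have hq2 := K2 q hq1 hqc
    rcases mem_pcut hq1 with ⟨hqP, hqc1⟩ | ⟨p, hp, hpc, rfl⟩
    · -- (KK) original kept twice: |q₃| ≤ −q₁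
      have h1 := K1 q hqP hqc1
      by_cases hg : Good q
      · exact Or.inl hg
      · right
        simp only [Good, not_or, not_lt] at hg
        refine ⟨hg.2, sticker_of_not_blocker (hnb q hqP) hg.1 ?_⟩
        have : |q.2.2| ≤ -q.1 := abs_le.2 ⟨by linarith, by linarith⟩
        linarith
    · -- (IK) stage-1 image of an original p (p₁ + p₃ ≤ 0), kept at stage 2
      have h1 := K1 p hp hpc
      simp only [prefl_101] at hq2 ⊢
      by_cases hg : 0 < t - p.2.2
      · exact Or.inl (Or.inr hg)
      · right
        have hg' : t - p.2.2 ≤ 0 := not_lt.1 hg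
        have hp3 : t ≤ p.2.2 := by linarith
        have hp0 : p ≠ 0 := by
          intro h0; rw [h0] at hp3; simp at hp3; linarith
        have hb := hnb p hp
        have hst : -p.1 < |p.2.1| := by
          by_contra h
          have h' : |p.2.1| ≤ -p.1 := not_lt.1 h
          apply hb
          refine ⟨hp0, by linarith, ?_⟩
          rw [abs_of_pos (by linarith : (0:ℝ) < p.2.2)]; linarith
        exact ⟨hg', by linarith⟩
  · have hp'2 := K2 p' hp' hp'c
    rcases mem_pcut hp' with ⟨hpP, hpc1⟩ | ⟨p, hp, hpc, rfl⟩
    · -- (KI) p' original kept at stage 1; its stage-2 image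
      have h1 := K1 p' hpP hpc1
      simp only [prefl_10m1]
      by_cases hg : 0 < p'.2.2 + t'
      · exact Or.inl (Or.inr hg)
      · right
        have hg : p'.2.2 + t' ≤ 0 := not_lt.1 hg
        have hp0 : p' ≠ 0 := by
          intro h0; rw [h0] at hg; simp at hg; linarith
        have hst := sticker_of_not_blocker (hnb p' hpP) hp0
          (by rw [abs_of_nonpos (by linarith : p'.2.2 ≤ 0)]; linarith)
        refine ⟨hg, ?_⟩
        have : |p'.2.2| = -p'.2.2 := abs_of_nonpos (by linarith)
        linarith [neg_abs_le p'.2.2]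
    · -- (II) p' = stage-1 image of an original p; its stage-2 image is good
      have h1 := K1 p hp hpc
      simp only [prefl_101, prefl_10m1] at hp'2 ⊢
      exact Or.inl (Or.inr (by linarith))

/-- Invariant after the third cut `(e₁+e₂, s)`: every point is good or has `q₂ < q₁ ≤ 0`. [folklore] -/
theorem inv_after_three {Q : Finset Pt} (hQ : ∀ q ∈ Q, Good q ∨ (q.1 ≤ 0 ∧ -q.1 < |q.2.1|))
    {s : ℝ} (hs : 0 < s) (H3 : ∀ q ∈ Q, 0 < q.1 + q.2.1 → s < q.1 + q.2.1) :
    ∀ r ∈ pcut (1,1,0) s Q, Good r ∨ (r.1 ≤ 0 ∧ r.2.1 < r.1) := by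
  have K3 : ∀ q ∈ Q, pdot (1,1,0) q < s → q.1 + q.2.1 ≤ 0 := fun q hq hc =>
    not_lt.1 fun h => absurd (H3 q hq h) (by simp only [pdot_110] at hc; linarith)
  intro r hr
  rcases mem_pcut hr with ⟨hrQ, hrc⟩ | ⟨q, hq, hqc, rfl⟩
  · have h3 := K3 r hrQ hrc
    rcases hQ r hrQ with hg | ⟨hr1, hst⟩
    · exact Or.inl hg
    · right; refine ⟨hr1, ?_⟩
      rcases lt_abs.1 hst with h | h <;> linarith
  · have h3 := K3 q hq hqc
    simp only [prefl_110]
    rcases hQ q hq with (rfl | hg) | ⟨hq1, hst⟩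
    · left; right; simp; linarith
    · left; right; show 0 < s - q.2.1; linarith
    · left; right; show 0 < s - q.2.1
      rcases lt_abs.1 hst with h | h <;> linarith

/-- Terminality after the fourth cut `(e₁−e₂, s')`. [folklore] -/
theorem terminal_after_four {R : Finset Pt} (hR : ∀ r ∈ R, Good r ∨ (r.1 ≤ 0 ∧ r.2.1 < r.1))
    {s' : ℝ} (hs' : 0 < s') (H4 : ∀ r ∈ R, 0 < r.1 - r.2.1 → s' < r.1 - r.2.1) :
    ∀ w ∈ pcut (1,-1,0) s' R, Good w := by
  have K4 : ∀ r ∈ R, pdot (1,-1,0) r < s' → r.1 - r.2.1 ≤ 0 := fun r hr hc =>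
    not_lt.1 fun h => absurd (H4 r hr h) (by simp only [pdot_1m10] at hc; linarith)
  have keptGood : ∀ r ∈ R, pdot (1,-1,0) r < s' → Good r := fun r hr hc => by
    rcases hR r hr with hg | ⟨_, hlt⟩
    · exact hg
    · exfalso; linarith [K4 r hr hc]
  intro w hw
  rcases mem_pcut hw with ⟨hwR, hwc⟩ | ⟨r, hr, hrc, rfl⟩
  · exact keptGood w hwR hwc
  · simp only [prefl_1m10]
    rcases keptGood r hr hrc with rfl | hg
    · right; simp; exact hs'
    · right; show 0 < r.2.1 + s'
      have := K4 r hr hrc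
      linarith

/-- **PHASE 2**: a blocker-free configuration has a mirror pedigree (four cuts in the directions
`e₁+e₃, e₁−e₃, e₁+e₂, e₁−e₂` with tiny thresholds, then `0` is the strict `v₁`-minimum). [folklore] -/
theorem hasPedigree_of_noBlocker {P : Finset Pt} (hnb : ∀ p ∈ P, ¬ IsBlocker p) : HasPedigree P := by
  obtain ⟨t, ht, H1, -⟩ := exists_tiny P (fun p => p.1 + p.2.2) ∅
  obtain ⟨t', ht', H2, -⟩ := exists_tiny (pcut (1,0,1) t P) (fun q => q.1 - q.2.2) ∅
  obtain ⟨s, hs, H3, -⟩ := exists_tiny (pcut (1,0,-1) t' (pcut (1,0,1) t P)) (fun q => q.1 + q.2.1) ∅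
  obtain ⟨s', hs', H4, -⟩ :=
    exists_tiny (pcut (1,1,0) s (pcut (1,0,-1) t' (pcut (1,0,1) t P))) (fun r => r.1 - r.2.1) ∅
  have hterm := terminal_after_four (inv_after_three (inv_after_two hnb ht ht' H1 H2) hs H3) hs' H4
  refine HasPedigree.cut (1,0,1) t (by simp [dirs]) ht ?_ <|
    HasPedigree.cut (1,0,-1) t' (by simp [dirs]) ht' ?_ <|
    HasPedigree.cut (1,1,0) s (by simp [dirs]) hs ?_ <|
    HasPedigree.cut (1,-1,0) s' (by simp [dirs]) hs' ?_ <|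
    HasPedigree.terminal (1,0,0) (by simp) fun w hw hw0 => ?_
  · intro p hp; rw [pdot_101]; exact off_mirror_of_tiny ht H1 p hp
  · intro q hq; rw [pdot_10m1]; exact off_mirror_of_tiny ht' H2 q hq
  · intro q hq; rw [pdot_110]; exact off_mirror_of_tiny hs H3 q hq
  · intro r hr; rw [pdot_1m10]; exact off_mirror_of_tiny hs' H4 r hr
  · rw [pdot_100]
    rcases hterm w hw with h | h
    · exact absurd h hw0
    · exact h

/-! ### PHASE 1, game (M): killing all blockers with `±e₂` cuts when no blocker has `p₂ = 0` -/

/-- (F1) for the cut `(e₂, T)`: if the image `(p₁, 2T − p₂, p₃)` of a kept point is a blocker then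
so is the point, and it lies at `p₂ ≤ −x` whenever all blockers have `|p₂| ≥ x > T`. [folklore] -/
theorem blocker_of_image_e2 {p : Pt} {T : ℝ} (hT : 0 < T) (hk : p.2.1 < T)
    (hb : IsBlocker (p.1, 2 * T - p.2.1, p.2.2)) : IsBlocker p := by
  obtain ⟨-, h2, h3⟩ := hb
  simp only at h2 h3
  have habs : |p.2.1| < |2 * T - p.2.1| := by
    rw [abs_of_pos (by linarith : 0 < 2 * T - p.2.1)]
    rcases le_or_gt 0 p.2.1 with h | h
    · rw [abs_of_nonneg h]; linarith
    · rw [abs_of_neg h]; linarith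
  have h1 : p.1 < -|p.2.1| := by linarith
  refine ⟨?_, h1.le, h3⟩
  intro h0; rw [h0] at h1; simp at h1

/-- (F1) for the cut `(−e₂, T)`: image `(p₁, −2T − p₂, p₃)` of a kept point (`−p₂ < T`). [folklore] -/
theorem blocker_of_image_me2 {p : Pt} {T : ℝ} (hT : 0 < T) (hk : -p.2.1 < T)
    (hb : IsBlocker (p.1, -2 * T - p.2.1, p.2.2)) : IsBlocker p := by
  obtain ⟨-, h2, h3⟩ := hb
  simp only at h2 h3
  have habs : |p.2.1| < |-2 * T - p.2.1| := by
    rw [abs_of_neg (by linarith : -2 * T - p.2.1 < 0)]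
    rcases le_or_gt 0 p.2.1 with h | h
    · rw [abs_of_nonneg h]; linarith
    · rw [abs_of_neg h]; linarith
  have h1 : p.1 < -|p.2.1| := by linarith
  refine ⟨?_, h1.le, h3⟩
  intro h0; rw [h0] at h1; simp at h1

/-- The floor measure strictly drops under doubling: `⌊A/(2x)⌋₊ < ⌊A/x⌋₊` for `0 < x ≤ A`. [folklore] -/
theorem floor_half_lt {A x : ℝ} (hx : 0 < x) (hxA : x ≤ A) : ⌊A / (2 * x)⌋₊ < ⌊A / x⌋₊ := by
  have hr : 1 ≤ A / x := by rw [le_div_iff₀ hx]; linarith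
  have hfl : (1:ℕ) ≤ ⌊A / x⌋₊ := Nat.le_floor (by exact_mod_cast hr)
  rw [Nat.floor_lt (div_nonneg (by linarith) (by linarith))]
  have h1 : A / x < ⌊A / x⌋₊ + 1 := Nat.lt_floor_add_one _
  have h2 : A / (2 * x) = (A / x) / 2 := by field_simp
  rw [h2]
  have : ((1:ℕ):ℝ) ≤ (⌊A / x⌋₊ : ℝ) := by exact_mod_cast hfl
  push_cast at this
  linarith

/-- A blocker with `p₂ ≠ 0` has `0 < |p₂| ≤ −p₁`. [folklore] -/
theorem IsBlocker.abs2_le {p : Pt} (hb : IsBlocker p) : |p.2.1| ≤ -p.1 := by linarith [hb.2.1]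

/-- **Game (M)**: with a level bound `A` and no blocker on the plane `p₂ = 0`, the configuration has a
pedigree provided every blocker-free configuration has one. Induction on the measure
`⌊A/b₊⌋₊ + ⌊A/b₋⌋₊` (`b_±` lower bounds of `|p₂|` on the blockers of either sign): one cut
`(±e₂, T)`, `T ∈ (x/2, x)` generic, `x` the least `|p₂|` over blockers, discards every blocker on
that side and creates blockers only beyond `2x`. [folklore] -/
theorem gameM (A : ℝ) (final : ∀ Q : Finset Pt, (∀ q ∈ Q, ¬ IsBlocker q) → HasPedigree Q) :
    ∀ (n : ℕ) (P : Finset Pt), (∀ p ∈ P, IsBlocker p → -p.1 ≤ A) → (∀ p ∈ P, IsBlocker p → p.2.1 ≠ 0) →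
      (∃ bp bm : ℝ, 0 < bp ∧ 0 < bm ∧ (∀ p ∈ P, IsBlocker p → 0 < p.2.1 → bp ≤ p.2.1) ∧
        (∀ p ∈ P, IsBlocker p → p.2.1 < 0 → bm ≤ -p.2.1) ∧ ⌊A / bp⌋₊ + ⌊A / bm⌋₊ ≤ n) →
      HasPedigree P := by
  intro n
  induction n with
  | zero =>
    intro P hA hZ ⟨bp, bm, hbp, hbm, hBp, hBm, hμ⟩
    apply final
    intro q hq hb
    have h0 : ⌊A / bp⌋₊ = 0 ∧ ⌊A / bm⌋₊ = 0 := by omega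
    rcases lt_trichotomy q.2.1 0 with hneg | h0' | hpos
    · have h1 := hBm q hq hb hneg
      have h2 := hb.abs2_le; rw [abs_of_neg hneg] at h2
      have h3 := hA q hq hb
      have : A / bm < 1 := by
        have := (Nat.floor_eq_zero.1 h0.2); exact this
      rw [div_lt_one hbm] at this; linarith
    · exact hZ q hq hb h0'
    · have h1 := hBp q hq hb hpos
      have h2 := hb.abs2_le; rw [abs_of_pos hpos] at h2
      have h3 := hA q hq hb
      have : A / bp < 1 := Nat.floor_eq_zero.1 h0.1
      rw [div_lt_one hbp] at this; linarith
  | succ n ih =>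
    intro P hA hZ ⟨bp, bm, hbp, hbm, hBp, hBm, hμ⟩
    by_cases hB : (P.filter IsBlocker).Nonempty
    swap
    · apply final; intro q hq hb; exact hB ⟨q, Finset.mem_filter.2 ⟨hq, hb⟩⟩
    obtain ⟨m, hm, hmin⟩ := (P.filter IsBlocker).exists_min_image (fun p => |p.2.1|) hB
    obtain ⟨hmP, hmb⟩ := Finset.mem_filter.1 hm
    have hmin' : ∀ p ∈ P, IsBlocker p → |m.2.1| ≤ |p.2.1| := fun p hp hb => hmin p (Finset.mem_filter.2 ⟨hp, hb⟩)
    set x := |m.2.1| with hx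
    have hx0 : 0 < x := abs_pos.2 (hZ m hmP hmb)
    have hxA : x ≤ A := le_trans hmb.abs2_le (hA m hmP hmb)
    -- generic threshold in (x/2, x)
    obtain ⟨T, hT1, hT2, hTS⟩ := exists_Ioo_not_mem (x / 2) x (by linarith)
      ((P.image fun p => p.2.1) ∪ (P.image fun p => p.2.1 / 2) ∪ (P.image fun p => -p.2.1) ∪
        (P.image fun p => -p.2.1 / 2))
    have hT0 : 0 < T := by linarith
    simp only [Finset.mem_union, Finset.mem_image, not_or, not_exists, not_and] at hTS
    obtain ⟨⟨⟨hS1, hS2⟩, hS3⟩, hS4⟩ := hTS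
    rcases lt_or_gt_of_ne (hZ m hmP hmb) with hmneg | hmpos
    · -- the least blocker is on the NEGATIVE side: cut (−e₂, T)
      have hxm : x = -m.2.1 := by rw [hx, abs_of_neg hmneg]
      refine HasPedigree.cut (0,-1,0) T (by simp [dirs]) hT0 (fun p hp h => hS3 p hp (by simpa using h)) ?_
      apply ih
      · -- level bound preserved
        intro q hq hb
        rcases mem_pcut hq with ⟨hqP, -⟩ | ⟨p, hp, hpc, rfl⟩
        · exact hA q hqP hb
        · simp only [prefl_0m10] at hb ⊢
          simp only [pdot_0m10] at hpc
          exact hA p hp (blocker_of_image_me2 hT0 hpc hb)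
      · -- no blocker on the plane p₂ = 0
        intro q hq hb
        rcases mem_pcut hq with ⟨hqP, -⟩ | ⟨p, hp, hpc, rfl⟩
        · exact hZ q hqP hb
        · simp only [prefl_0m10] at hb ⊢
          intro h0
          exact hS4 p hp (by linarith)
      · refine ⟨bp, 2 * x, hbp, by linarith, ?_, ?_, ?_⟩
        · -- positive blockers unchanged
          intro q hq hb hpos
          rcases mem_pcut hq with ⟨hqP, -⟩ | ⟨p, hp, hpc, rfl⟩
          · exact hBp q hqP hb hpos
          · exfalso
            simp only [prefl_0m10] at hb hpos
            simp only [pdot_0m10] at hpc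
            linarith
        · -- negative blockers are new images beyond 2x
          intro q hq hb hneg
          rcases mem_pcut hq with ⟨hqP, hqc⟩ | ⟨p, hp, hpc, rfl⟩
          · exfalso
            simp only [pdot_0m10] at hqc
            have := hmin' q hqP hb
            rw [abs_of_neg hneg] at this
            linarith
          · simp only [prefl_0m10] at hb hneg ⊢
            simp only [pdot_0m10] at hpc
            have hpb := blocker_of_image_me2 hT0 hpc hb
            have := hmin' p hp hpb
            -- p is a kept blocker: |p₂| ≥ x > T > -p₂, so p₂ > 0 and p₂ ≥ x
            have hp2 : x ≤ p.2.1 := by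
              rcases le_or_gt p.2.1 0 with h | h
              · rw [abs_of_nonpos h] at this; linarith
              · rwa [abs_of_pos h] at this
            show 2 * x ≤ -(-2 * T - p.2.1)
            linarith
        · have := floor_half_lt hx0 hxA
          have hle : ⌊A / x⌋₊ ≤ ⌊A / bm⌋₊ := by
            apply Nat.floor_le_floor
            have hbmx : bm ≤ x := by rw [hxm]; exact hBm m hmP hmb hmneg
            exact div_le_div_of_nonneg_left (by linarith) hbm hbmx
          omega
    · -- the least blocker is on the POSITIVE side: cut (e₂, T)
      have hxm : x = m.2.1 := by rw [hx, abs_of_pos hmpos]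
      refine HasPedigree.cut (0,1,0) T (by simp [dirs]) hT0 (fun p hp h => hS1 p hp (by simpa using h)) ?_
      apply ih
      · intro q hq hb
        rcases mem_pcut hq with ⟨hqP, -⟩ | ⟨p, hp, hpc, rfl⟩
        · exact hA q hqP hb
        · simp only [prefl_010] at hb ⊢
          simp only [pdot_010] at hpc
          exact hA p hp (blocker_of_image_e2 hT0 hpc hb)
      · intro q hq hb
        rcases mem_pcut hq with ⟨hqP, -⟩ | ⟨p, hp, hpc, rfl⟩
        · exact hZ q hqP hb
        · simp only [prefl_010] at hb ⊢
          intro h0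
          exact hS2 p hp (by linarith)
      · refine ⟨2 * x, bm, by linarith, hbm, ?_, ?_, ?_⟩
        · intro q hq hb hpos
          rcases mem_pcut hq with ⟨hqP, hqc⟩ | ⟨p, hp, hpc, rfl⟩
          · exfalso
            simp only [pdot_010] at hqc
            have := hmin' q hqP hb
            rw [abs_of_pos hpos] at this
            linarith
          · simp only [prefl_010] at hb hpos ⊢
            simp only [pdot_010] at hpc
            have hpb := blocker_of_image_e2 hT0 hpc hb
            have := hmin' p hp hpb
            have hp2 : p.2.1 ≤ -x := by
              rcases le_or_gt 0 p.2.1 with h | h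
              · rw [abs_of_nonneg h] at this; linarith
              · rw [abs_of_neg h] at this; linarith
            show 2 * x ≤ 2 * T - p.2.1
            linarith
        · intro q hq hb hneg
          rcases mem_pcut hq with ⟨hqP, -⟩ | ⟨p, hp, hpc, rfl⟩
          · exact hBm q hqP hb hneg
          · exfalso
            simp only [prefl_010] at hb hneg
            simp only [pdot_010] at hpc
            linarith
        · have := floor_half_lt hx0 hxA
          have hle : ⌊A / x⌋₊ ≤ ⌊A / bp⌋₊ := by
            apply Nat.floor_le_floor
            have hbpx : bp ≤ x := by rw [hxm]; exact hBp m hmP hmb hmpos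
            exact div_le_div_of_nonneg_left (by linarith) hbp hbpx
          omega

/-! ### PHASE 1, game (Z): killing the blockers of the plane `p₂ = 0` with `±e₃` cuts -/

/-- (F1) for the cut `(e₃, T)`: image `(p₁, p₂, 2T − p₃)` of a kept point (`p₃ < T`). [folklore] -/
theorem blocker_of_image_e3 {p : Pt} {T : ℝ} (hT : 0 < T) (hk : p.2.2 < T)
    (hb : IsBlocker (p.1, p.2.1, 2 * T - p.2.2)) : IsBlocker p := by
  obtain ⟨-, h2, h3⟩ := hb
  simp only at h2 h3
  have habs : |p.2.2| < |2 * T - p.2.2| := by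
    rw [abs_of_pos (by linarith : 0 < 2 * T - p.2.2)]
    rcases le_or_gt 0 p.2.2 with h | h
    · rw [abs_of_nonneg h]; linarith
    · rw [abs_of_neg h]; linarith
  have h1 : p.1 < -|p.2.2| := by linarith
  refine ⟨?_, h2, h1.le⟩
  intro h0; rw [h0] at h1; simp at h1

/-- (F1) for the cut `(−e₃, T)`: image `(p₁, p₂, −2T − p₃)` of a kept point (`−p₃ < T`). [folklore] -/
theorem blocker_of_image_me3 {p : Pt} {T : ℝ} (hT : 0 < T) (hk : -p.2.2 < T)
    (hb : IsBlocker (p.1, p.2.1, -2 * T - p.2.2)) : IsBlocker p := by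
  obtain ⟨-, h2, h3⟩ := hb
  simp only at h2 h3
  have habs : |p.2.2| < |-2 * T - p.2.2| := by
    rw [abs_of_neg (by linarith : -2 * T - p.2.2 < 0)]
    rcases le_or_gt 0 p.2.2 with h | h
    · rw [abs_of_nonneg h]; linarith
    · rw [abs_of_neg h]; linarith
  have h1 : p.1 < -|p.2.2| := by linarith
  refine ⟨?_, h2, h1.le⟩
  intro h0; rw [h0] at h1; simp at h1

/-- A blocker has `|p₃| ≤ −p₁`. [folklore] -/
theorem IsBlocker.abs3_le {p : Pt} (hb : IsBlocker p) : |p.2.2| ≤ -p.1 := by linarith [hb.2.2]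

/-- **Game (Z)**: with a level bound `A` and no AXIS blocker (`p₂ = p₃ = 0`), the configuration has
a pedigree provided every configuration with the level bound and no blocker on the plane `p₂ = 0`
has one (game (M)). Same induction, in the coordinate `p₃`, on the blockers with `p₂ = 0`. [folklore] -/
theorem gameZ (A : ℝ)
    (next : ∀ Q : Finset Pt, (∀ q ∈ Q, IsBlocker q → -q.1 ≤ A) → (∀ q ∈ Q, IsBlocker q → q.2.1 ≠ 0) →
      HasPedigree Q) :
    ∀ (n : ℕ) (P : Finset Pt), (∀ p ∈ P, IsBlocker p → -p.1 ≤ A) →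
      (∀ p ∈ P, IsBlocker p → p.2.1 = 0 → p.2.2 ≠ 0) →
      (∃ cp cm : ℝ, 0 < cp ∧ 0 < cm ∧ (∀ p ∈ P, IsBlocker p → p.2.1 = 0 → 0 < p.2.2 → cp ≤ p.2.2) ∧
        (∀ p ∈ P, IsBlocker p → p.2.1 = 0 → p.2.2 < 0 → cm ≤ -p.2.2) ∧ ⌊A / cp⌋₊ + ⌊A / cm⌋₊ ≤ n) →
      HasPedigree P := by
  intro n
  induction n with
  | zero =>
    intro P hA hNA ⟨cp, cm, hcp, hcm, hCp, hCm, hμ⟩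
    apply next P hA
    intro q hq hb h20
    have h0 : ⌊A / cp⌋₊ = 0 ∧ ⌊A / cm⌋₊ = 0 := by omega
    rcases lt_trichotomy q.2.2 0 with hneg | h0' | hpos
    · have h1 := hCm q hq hb h20 hneg
      have h2 := hb.abs3_le; rw [abs_of_neg hneg] at h2
      have h3 := hA q hq hb
      have : A / cm < 1 := Nat.floor_eq_zero.1 h0.2
      rw [div_lt_one hcm] at this; linarith
    · exact hNA q hq hb h20 h0'
    · have h1 := hCp q hq hb h20 hpos
      have h2 := hb.abs3_le; rw [abs_of_pos hpos] at h2
      have h3 := hA q hq hb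
      have : A / cp < 1 := Nat.floor_eq_zero.1 h0.1
      rw [div_lt_one hcp] at this; linarith
  | succ n ih =>
    intro P hA hNA ⟨cp, cm, hcp, hcm, hCp, hCm, hμ⟩
    by_cases hB : (P.filter fun p => IsBlocker p ∧ p.2.1 = 0).Nonempty
    swap
    · apply next P hA; intro q hq hb h20; exact hB ⟨q, Finset.mem_filter.2 ⟨hq, hb, h20⟩⟩
    obtain ⟨m, hm, hmin⟩ := (P.filter fun p => IsBlocker p ∧ p.2.1 = 0).exists_min_image (fun p => |p.2.2|) hB
    obtain ⟨hmP, hmb, hm20⟩ := Finset.mem_filter.1 hm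
    have hmin' : ∀ p ∈ P, IsBlocker p → p.2.1 = 0 → |m.2.2| ≤ |p.2.2| :=
      fun p hp hb h20 => hmin p (Finset.mem_filter.2 ⟨hp, hb, h20⟩)
    set x := |m.2.2| with hx
    have hx0 : 0 < x := abs_pos.2 (hNA m hmP hmb hm20)
    have hxA : x ≤ A := le_trans hmb.abs3_le (hA m hmP hmb)
    obtain ⟨T, hT1, hT2, hTS⟩ := exists_Ioo_not_mem (x / 2) x (by linarith)
      ((P.image fun p => p.2.2) ∪ (P.image fun p => p.2.2 / 2) ∪ (P.image fun p => -p.2.2) ∪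
        (P.image fun p => -p.2.2 / 2))
    have hT0 : 0 < T := by linarith
    simp only [Finset.mem_union, Finset.mem_image, not_or, not_exists, not_and] at hTS
    obtain ⟨⟨⟨hS1, hS2⟩, hS3⟩, hS4⟩ := hTS
    rcases lt_or_gt_of_ne (hNA m hmP hmb hm20) with hmneg | hmpos
    · -- least member on the NEGATIVE side: cut (−e₃, T)
      have hxm : x = -m.2.2 := by rw [hx, abs_of_neg hmneg]
      refine HasPedigree.cut (0,0,-1) T (by simp [dirs]) hT0 (fun p hp h => hS3 p hp (by simpa using h)) ?_
      apply ih
      · intro q hq hb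
        rcases mem_pcut hq with ⟨hqP, -⟩ | ⟨p, hp, hpc, rfl⟩
        · exact hA q hqP hb
        · simp only [prefl_00m1] at hb ⊢
          simp only [pdot_00m1] at hpc
          exact hA p hp (blocker_of_image_me3 hT0 hpc hb)
      · intro q hq hb h20
        rcases mem_pcut hq with ⟨hqP, -⟩ | ⟨p, hp, hpc, rfl⟩
        · exact hNA q hqP hb h20
        · simp only [prefl_00m1] at hb h20 ⊢
          intro h0
          exact hS4 p hp (by linarith)
      · refine ⟨cp, 2 * x, hcp, by linarith, ?_, ?_, ?_⟩
        · intro q hq hb h20 hpos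
          rcases mem_pcut hq with ⟨hqP, -⟩ | ⟨p, hp, hpc, rfl⟩
          · exact hCp q hqP hb h20 hpos
          · exfalso
            simp only [prefl_00m1] at hb hpos
            simp only [pdot_00m1] at hpc
            linarith
        · intro q hq hb h20 hneg
          rcases mem_pcut hq with ⟨hqP, hqc⟩ | ⟨p, hp, hpc, rfl⟩
          · exfalso
            simp only [pdot_00m1] at hqc
            have := hmin' q hqP hb h20
            rw [abs_of_neg hneg] at this
            linarith
          · simp only [prefl_00m1] at hb hneg h20 ⊢
            simp only [pdot_00m1] at hpc
            have hpb := blocker_of_image_me3 hT0 hpc hb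
            have := hmin' p hp hpb h20
            have hp3 : x ≤ p.2.2 := by
              rcases le_or_gt p.2.2 0 with h | h
              · rw [abs_of_nonpos h] at this; linarith
              · rwa [abs_of_pos h] at this
            show 2 * x ≤ -(-2 * T - p.2.2)
            linarith
        · have := floor_half_lt hx0 hxA
          have hle : ⌊A / x⌋₊ ≤ ⌊A / cm⌋₊ := by
            apply Nat.floor_le_floor
            have hcmx : cm ≤ x := by rw [hxm]; exact hCm m hmP hmb hm20 hmneg
            exact div_le_div_of_nonneg_left (by linarith) hcm hcmx
          omega
    · -- least member on the POSITIVE side: cut (e₃, T)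
      have hxm : x = m.2.2 := by rw [hx, abs_of_pos hmpos]
      refine HasPedigree.cut (0,0,1) T (by simp [dirs]) hT0 (fun p hp h => hS1 p hp (by simpa using h)) ?_
      apply ih
      · intro q hq hb
        rcases mem_pcut hq with ⟨hqP, -⟩ | ⟨p, hp, hpc, rfl⟩
        · exact hA q hqP hb
        · simp only [prefl_001] at hb ⊢
          simp only [pdot_001] at hpc
          exact hA p hp (blocker_of_image_e3 hT0 hpc hb)
      · intro q hq hb h20
        rcases mem_pcut hq with ⟨hqP, -⟩ | ⟨p, hp, hpc, rfl⟩
        · exact hNA q hqP hb h20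
        · simp only [prefl_001] at hb h20 ⊢
          intro h0
          exact hS2 p hp (by linarith)
      · refine ⟨2 * x, cm, by linarith, hcm, ?_, ?_, ?_⟩
        · intro q hq hb h20 hpos
          rcases mem_pcut hq with ⟨hqP, hqc⟩ | ⟨p, hp, hpc, rfl⟩
          · exfalso
            simp only [pdot_001] at hqc
            have := hmin' q hqP hb h20
            rw [abs_of_pos hpos] at this
            linarith
          · simp only [prefl_001] at hb hpos h20 ⊢
            simp only [pdot_001] at hpc
            have hpb := blocker_of_image_e3 hT0 hpc hb
            have := hmin' p hp hpb h20
            have hp3 : p.2.2 ≤ -x := by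
              rcases le_or_gt 0 p.2.2 with h | h
              · rw [abs_of_nonneg h] at this; linarith
              · rw [abs_of_neg h] at this; linarith
            show 2 * x ≤ 2 * T - p.2.2
            linarith
        · intro q hq hb h20 hneg
          rcases mem_pcut hq with ⟨hqP, -⟩ | ⟨p, hp, hpc, rfl⟩
          · exact hCm q hqP hb h20 hneg
          · exfalso
            simp only [prefl_001] at hb hneg
            simp only [pdot_001] at hpc
            linarith
        · have := floor_half_lt hx0 hxA
          have hle : ⌊A / x⌋₊ ≤ ⌊A / cp⌋₊ := by
            apply Nat.floor_le_floor
            have hcpx : cp ≤ x := by rw [hxm]; exact hCp m hmP hmb hm20 hmpos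
            exact div_le_div_of_nonneg_left (by linarith) hcp hcpx
          omega

/-! ### PHASE 1, step (i), and the assembly -/

/-- Step (i): one cut `(−e₁+e₂, t₀)` with `t₀` tiny and generic removes every AXIS blocker
(`p₂ = p₃ = 0`, `p₁ < 0`) and creates none. [folklore] -/
theorem noAxis_after_diag (P : Finset Pt) :
    ∃ t₀ : ℝ, 0 < t₀ ∧ (∀ p ∈ P, pdot (-1,1,0) p ≠ t₀) ∧
      ∀ q ∈ pcut (-1,1,0) t₀ P, IsBlocker q → q.2.1 = 0 → q.2.2 ≠ 0 := by
  obtain ⟨t₀, ht0, htin, htS⟩ := exists_tiny P (fun p => p.2.1 - p.1) (P.image fun p => -p.1)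
  refine ⟨t₀, ht0, fun p hp => by rw [pdot_m110]; exact off_mirror_of_tiny ht0 htin p hp, ?_⟩
  intro q hq hb h20 h30
  rcases mem_pcut hq with ⟨hqP, hqc⟩ | ⟨p, hp, hpc, rfl⟩
  · simp only [pdot_m110] at hqc
    have hle : q.2.1 - q.1 ≤ 0 := not_lt.1 fun h => absurd (htin q hqP h) (by linarith)
    have hq1 : q.1 ≤ 0 := by have := hb.2.1; rw [h20] at this; simpa using this
    have hq0 : q.1 ≠ 0 := by
      intro h; apply hb.1; ext <;> simp [h, h20, h30]
    have : q.1 < 0 := lt_of_le_of_ne hq1 hq0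
    linarith
  · simp only [prefl_m110] at h20 h30 hb
    apply htS
    exact Finset.mem_image.2 ⟨p, hp, by linarith⟩

/-- **THE COVERING THEOREM** (Disproof §G.3): every finite configuration of `ℝ³` has a mirror
pedigree — finitely many admissible cuts in the cubic directions after which `0` is the strict
`v₁`-minimum. Assembly: step (i), game (Z), game (M), Phase 2. [folklore] -/
theorem covering (P : Finset Pt) : HasPedigree P := by
  -- step (i)
  obtain ⟨t₀, ht0, hoff, hNA⟩ := noAxis_after_diag P
  refine HasPedigree.cut (-1,1,0) t₀ (by simp [dirs]) ht0 hoff ?_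
  set P₁ := pcut (-1,1,0) t₀ P
  -- level bound
  obtain ⟨A, hA⟩ := (P₁.image fun p : Pt => -p.1).bddAbove
  have hA' : ∀ p ∈ P₁, IsBlocker p → -p.1 ≤ A := fun p hp _ => hA (Finset.mem_image.2 ⟨p, hp, rfl⟩)
  -- Phase 2 as the final callback, game (M) as the intermediate one
  have final : ∀ Q : Finset Pt, (∀ q ∈ Q, ¬ IsBlocker q) → HasPedigree Q :=
    fun Q h => hasPedigree_of_noBlocker h
  have next : ∀ Q : Finset Pt, (∀ q ∈ Q, IsBlocker q → -q.1 ≤ A) →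
      (∀ q ∈ Q, IsBlocker q → q.2.1 ≠ 0) → HasPedigree Q := by
    intro Q hAQ hZQ
    obtain ⟨bp, hbp, hBp⟩ := exists_pos_le_all Q fun q => q.2.1
    obtain ⟨bm, hbm, hBm⟩ := exists_pos_le_all Q fun q => -q.2.1
    exact gameM A final _ Q hAQ hZQ ⟨bp, bm, hbp, hbm, fun q hq _ h => hBp q hq h,
      fun q hq _ h => hBm q hq (by linarith), le_rfl⟩
  obtain ⟨cp, hcp, hCp⟩ := exists_pos_le_all P₁ fun q => q.2.2
  obtain ⟨cm, hcm, hCm⟩ := exists_pos_le_all P₁ fun q => -q.2.2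
  exact gameZ A next _ P₁ hA' hNA ⟨cp, cm, hcp, hcm, fun q hq _ _ h => hCp q hq h,
    fun q hq _ _ h => hCm q hq (by linarith), le_rfl⟩

/-! ### Margins: every pedigree has a positive margin (finite configurations, strict inequalities) -/

/-- MIRROR PEDIGREE WITH MARGIN `μ`: the moving point `0` and all kept points are `≥ μ` below each
mirror, the discarded points `≥ μ` above, and the final extremality holds with margin `μ` — the
quantitative form consumed by the compactness argument of Disproof §G.4 (margins are `1`-Lipschitz
in the configuration, so a pedigree with margin `μ` at `P` serves every configuration within `μ/2`).
[folklore] -/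
inductive HasPedigreeM (μ : ℝ) : Finset Pt → Prop
  | terminal {P : Finset Pt} (g : Pt) (hg : g ∈ [((1:ℝ),(0:ℝ),(0:ℝ)), (0,1,0), (0,0,1), (-1,0,0), (0,-1,0), (0,0,-1)])
      (h : ∀ p ∈ P, p ≠ 0 → μ ≤ pdot g p) : HasPedigreeM μ P
  | cut {P : Finset Pt} (f : Pt) (T : ℝ) (hf : f ∈ dirs) (hT : μ ≤ T)
      (hoff : ∀ p ∈ P, pdot f p ≤ T - μ ∨ T + μ ≤ pdot f p) (h : HasPedigreeM μ (pcut f T P)) :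
      HasPedigreeM μ P

/-- Margins can be decreased. [folklore] -/
theorem HasPedigreeM.mono {μ μ' : ℝ} {P : Finset Pt} (h : HasPedigreeM μ P) (hle : μ' ≤ μ) :
    HasPedigreeM μ' P := by
  induction h with
  | terminal g hg h => exact HasPedigreeM.terminal g hg fun p hp hp0 => le_trans hle (h p hp hp0)
  | cut f T hf hT hoff h ih =>
    refine HasPedigreeM.cut f T hf (le_trans hle hT) (fun p hp => ?_) ih
    rcases hoff p hp with h1 | h1
    · left; linarith
    · right; linarith

/-- A pedigree with margin is a pedigree (for `0 < μ`). [folklore] -/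
theorem HasPedigreeM.hasPedigree {μ : ℝ} (hμ : 0 < μ) {P : Finset Pt} (h : HasPedigreeM μ P) :
    HasPedigree P := by
  induction h with
  | terminal g hg h => exact HasPedigree.terminal g hg fun p hp hp0 => lt_of_lt_of_le hμ (h p hp hp0)
  | cut f T hf hT hoff h ih =>
    refine HasPedigree.cut f T hf (lt_of_lt_of_le hμ hT) (fun p hp heq => ?_) ih
    rcases hoff p hp with h1 | h1 <;> linarith

/-- **Every pedigree has a positive margin.** [folklore] -/
theorem HasPedigree.exists_margin {P : Finset Pt} (h : HasPedigree P) : ∃ μ : ℝ, 0 < μ ∧ HasPedigreeM μ P := by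
  induction h with
  | @terminal P g hg h =>
    obtain ⟨m, hm, hmle⟩ := exists_pos_le_all P (pdot g)
    exact ⟨m, hm, HasPedigreeM.terminal g hg fun p hp hp0 => hmle p hp (h p hp hp0)⟩
  | @cut P f T hf hT hoff h ih =>
    obtain ⟨μ₁, hμ₁, h₁⟩ := ih
    -- the least distance of a point of `P` from the mirror
    obtain ⟨m, hm, hmle⟩ := exists_pos_le_all P fun p => |pdot f p - T|
    have hmle' : ∀ p ∈ P, m ≤ |pdot f p - T| := fun p hp =>
      hmle p hp (abs_pos.2 (sub_ne_zero.2 (hoff p hp)))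
    refine ⟨min μ₁ (min m T), lt_min hμ₁ (lt_min hm hT), ?_⟩
    refine HasPedigreeM.cut f T hf (le_trans (min_le_right _ _) (min_le_right _ _)) (fun p hp => ?_)
      (h₁.mono (min_le_left _ _))
    have hmp := hmle' p hp
    have hmin : min μ₁ (min m T) ≤ m := le_trans (min_le_right _ _) (min_le_left _ _)
    rcases le_or_gt (pdot f p) T with hle | hgt
    · left
      rw [abs_of_nonpos (by linarith)] at hmp
      linarith
    · right
      rw [abs_of_pos (by linarith)] at hmp
      linarith

/-- **THE COVERING THEOREM with margins**: every finite configuration of `ℝ³` has a mirror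
pedigree with some positive margin. [folklore] -/
theorem coveringM (P : Finset Pt) : ∃ μ : ℝ, 0 < μ ∧ HasPedigreeM μ P := (covering P).exists_margin

/-! ### Bridge to `EuclideanSpace ℝ (Fin 3)` -/

section Bridge

/-- Points of `ℝ³`. [folklore] -/
abbrev E := EuclideanSpace ℝ (Fin 3)

/-- Coordinates of a Euclidean point as a triple. [folklore] -/
def φ (v : E) : Pt := (v 0, v 1, v 2)

/-- A triple as a Euclidean point. [folklore] -/
def ψ (q : Pt) : E :=
  q.1 • EuclideanSpace.single 0 1 + q.2.1 • EuclideanSpace.single 1 1 + q.2.2 • EuclideanSpace.single 2 1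

theorem φ_apply (v : E) : φ v = (v 0, v 1, v 2) := rfl

theorem φ_injective : Function.Injective φ := by
  intro v w h
  simp only [φ, Prod.mk.injEq] at h
  ext i; fin_cases i
  · exact h.1
  · exact h.2.1
  · exact h.2.2

@[simp] theorem φ_zero : φ 0 = 0 := by simp [φ]

theorem φ_eq_zero {v : E} : φ v = 0 ↔ v = 0 := by
  constructor
  · intro h; exact φ_injective (h.trans φ_zero.symm)
  · rintro rfl; exact φ_zero

@[simp] theorem φ_ψ (q : Pt) : φ (ψ q) = q := by
  obtain ⟨a, b, c⟩ := q
  simp [φ, ψ]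

/-- Explicit dot product on `E`. [folklore] -/
def rdot (f v : E) : ℝ := f 0 * v 0 + f 1 * v 1 + f 2 * v 2

/-- Euclidean reflection in the affine mirror `{rdot f · = T}`. [folklore] -/
def reflect (f : E) (T : ℝ) (v : E) : E := v - (2 * (rdot f v - T) / rdot f f) • f

/-- One cut of a Euclidean configuration. [folklore] -/
def rcut (f : E) (T : ℝ) (P : Finset E) : Finset E :=
  (P.filter fun p => rdot f p < T) ∪ (P.filter fun p => rdot f p < T).image (reflect f T)

theorem rdot_eq (f v : E) : rdot f v = pdot (φ f) (φ v) := by simp [rdot, pdot, φ]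

theorem φ_reflect (f : E) (T : ℝ) (v : E) : φ (reflect f T v) = prefl (φ f) T (φ v) := by
  simp only [reflect, prefl, φ_apply, rdot_eq, PiLp.sub_apply, PiLp.smul_apply, smul_eq_mul]

theorem image_rcut (f : E) (T : ℝ) (P : Finset E) :
    (rcut f T P).image φ = pcut (φ f) T (P.image φ) := by
  ext q
  simp only [rcut, pcut, Finset.mem_image, Finset.mem_union, Finset.mem_filter, rdot_eq]
  constructor
  · rintro ⟨p, hp | ⟨p', ⟨hp', hc'⟩, rfl⟩, rfl⟩
    · exact Or.inl ⟨⟨p, hp.1, rfl⟩, hp.2⟩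
    · exact Or.inr ⟨φ p', ⟨⟨p', hp', rfl⟩, hc'⟩, (φ_reflect f T p').symm⟩
  · rintro (⟨⟨p, hp, rfl⟩, hc⟩ | ⟨q', ⟨⟨p', hp', rfl⟩, hc'⟩, rfl⟩)
    · exact ⟨p, Or.inl ⟨hp, hc⟩, rfl⟩
    · exact ⟨reflect f T p', Or.inr ⟨p', ⟨hp', hc'⟩, rfl⟩, φ_reflect f T p'⟩

/-- MIRROR PEDIGREE of a Euclidean configuration (moving point `0`): terminal = `0` strictly extreme
in a coordinate direction; step = admissible cut in a cubic direction (`φ f ∈ dirs`). [folklore] -/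
inductive HasPedigreeE : Finset E → Prop
  | terminal {P : Finset E} (τ : Fin 3)
      (h : (∀ p ∈ P, p ≠ 0 → (0:ℝ) < p τ) ∨ (∀ p ∈ P, p ≠ 0 → p τ < 0)) : HasPedigreeE P
  | cut {P : Finset E} (f : E) (T : ℝ) (hf : φ f ∈ dirs) (hT : 0 < T)
      (hoff : ∀ p ∈ P, rdot f p ≠ T) (h : HasPedigreeE (rcut f T P)) : HasPedigreeE P

theorem bridge : ∀ {Q : Finset Pt}, HasPedigree Q → ∀ P : Finset E, Q = P.image φ → HasPedigreeE P := by
  intro Q hQ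
  induction hQ with
  | @terminal Q g hg h =>
    intro P hP
    subst hP
    have h' : ∀ p ∈ P, p ≠ 0 → 0 < pdot g (φ p) := fun p hp hp0 =>
      h (φ p) (Finset.mem_image_of_mem φ hp) (fun h0 => hp0 (φ_eq_zero.1 h0))
    simp only [List.mem_cons, List.mem_nil_iff, or_false] at hg
    rcases hg with rfl | rfl | rfl | rfl | rfl | rfl
    · exact HasPedigreeE.terminal 0 (Or.inl fun p hp hp0 => by simpa [pdot, φ_apply] using h' p hp hp0)
    · exact HasPedigreeE.terminal 1 (Or.inl fun p hp hp0 => by simpa [pdot, φ_apply] using h' p hp hp0)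
    · exact HasPedigreeE.terminal 2 (Or.inl fun p hp hp0 => by simpa [pdot, φ_apply] using h' p hp hp0)
    · exact HasPedigreeE.terminal 0 (Or.inr fun p hp hp0 => by
        have := h' p hp hp0; simp [pdot, φ_apply] at this; linarith)
    · exact HasPedigreeE.terminal 1 (Or.inr fun p hp hp0 => by
        have := h' p hp hp0; simp [pdot, φ_apply] at this; linarith)
    · exact HasPedigreeE.terminal 2 (Or.inr fun p hp hp0 => by
        have := h' p hp hp0; simp [pdot, φ_apply] at this; linarith)
  | @cut Q f' T hf' hT hoff h ih =>
    intro P hP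
    subst hP
    refine HasPedigreeE.cut (ψ f') T (by rw [φ_ψ]; exact hf') hT ?_ ?_
    · intro p hp
      rw [rdot_eq, φ_ψ]
      exact hoff (φ p) (Finset.mem_image_of_mem φ hp)
    · apply ih
      rw [image_rcut, φ_ψ]

/-- **THE COVERING THEOREM for Euclidean configurations.** [folklore] -/
theorem coveringE (P : Finset E) : HasPedigreeE P := bridge (covering (P.image φ)) P rfl

end Bridge

end Cover

/-! ### G.1 The lattice input: reflection positivity in the NINE site mirrors, as a CLUSTER move
inequality -/

/-- `Θ` is a lattice mirror with height function `φ` for which the critical state is reflection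
positive and invariant: `Θ` involutive, `φ ∘ Θ = −φ`, `criticalCorr` is `Θ`-invariant, and the Gram
form `(z, z') ↦ ⟨∏σ_{Θz} ∏σ_{z'}⟩_{β_c}` is positive semidefinite on monomials supported in
`{φ ≥ 0}` (the shape of the tree's `stub_latticeRP`, which is the case `Θ = θ_τ`, `φ = v_τ`).
The nine families `v_τ = c`, `v_τ + v_τ' = c`, `v_τ − v_τ' = c` (`c ∈ ℤ`) all qualify:
`isingExpect_free_reflect_mul_self_nonneg` (FILS site position H1–H3 holds for the swap
`(v_τ, v_τ') ↦ (−v_τ', −v_τ)` with half `{v_τ + v_τ' ≥ 0}` and for `(v_τ, v_τ') ↦ (v_τ', v_τ)` with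
half `{v_τ ≤ v_τ'}`: a nearest-neighbour edge changes `v_τ ± v_τ'` by `±1`, so it never crosses;
the boxes `box 3 L` are swap-stable), the box limit `criticalCorr_wellDefined_holds`, and lattice
translations `criticalCorr_translate` for `c ≠ 0`. [cite: FILS1978, §2] [cite: FriedliVelenik2017, Lemma 10.8] -/
def IsRPMirror (Θ : Site 3 → Site 3) (φ : Site 3 → ℤ) : Prop :=
  (∀ v, Θ (Θ v) = v) ∧ (∀ v, φ (Θ v) = -φ v) ∧
  (∀ (n : ℕ) (y : Fin n → Site 3), criticalCorr 3 n (Θ ∘ y) = criticalCorr 3 n y) ∧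
  ∀ (m : ℕ) (k : Fin m → ℕ) (z : (a : Fin m) → Fin (k a) → Site 3) (c : Fin m → ℝ),
    (∀ a j, 0 ≤ φ (z a j)) →
    0 ≤ ∑ a, ∑ b, c a * c b * criticalCorr 3 (k a + k b) (Fin.append (Θ ∘ z a) (z b))

/-- **CLUSTER MOVE INEQUALITY** (the generalisation of the lead's `moveIneq_latticeRP` from the
cluster `{i}` to an arbitrary cluster `A ∋ i`; indices ordered `A` first WLOG by
`criticalCorr_comp_perm`). For an RP mirror `(Θ, φ)`, a configuration `(y_A, y_B)` with the cluster
`y_A` weakly below the mirror (`φ ≤ 0`) and `y_B` weakly above (`φ ≥ 0`), and `y'_A` differing from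
`y_A` only at `i` (still `φ(y'_A i) ≤ 0`):
`(⟨Πσ_{y_A}Πσ_{y_B}⟩ − ⟨Πσ_{y'_A}Πσ_{y_B}⟩)² ≤ [⟨S_A ΘS_A⟩ − 2⟨S_A ΘS'_A⟩ + ⟨S'_A ΘS'_A⟩]·⟨ΘS_B S_B⟩`.
Proof: the Gram form `Q(G₁,G₂) = ⟨Θ(G₁)G₂⟩` is PSD on `𝔄₊` (RP) and symmetric (`Θ`-invariance);
`F := Θ(S_A)`, `F' := Θ(S'_A)`, `G := S_B` lie in `𝔄₊`; `Q(F, G) = ⟨S_A S_B⟩`; Cauchy–Schwarz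
`Q(F−F', G)² ≤ Q(F−F', F−F') Q(G,G)` (discriminant of the PSD quadratic `λ ↦ Q(λ(F−F')+G, ·)`,
i.e. `IsRPMirror` with the three-member family `(ΘyA, ΘyA', yB)` and coefficients `(λ, −λ, 1)`);
`Q(F', F) = Q(F, F')` by `Θ`-invariance and block permutation. PROVED below for every RP mirror:
`clusterMoveIneq_holds : ClusterMoveIneq`; and the nine families ARE RP mirrors (G.1″:
`isRPMirror_coord`, `isRPMirror_swap`, `isRPMirror_antiswap`, `isRPMirror_conj`). [cite: FILS1978, §2] -/
def ClusterMoveIneq : Prop :=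
  ∀ (Θ : Site 3 → Site 3) (φ : Site 3 → ℤ), IsRPMirror Θ φ →
    ∀ (a b : ℕ) (i : Fin a) (yA yA' : Fin a → Site 3) (yB : Fin b → Site 3),
      (∀ j, j ≠ i → yA' j = yA j) → (∀ j, φ (yA j) ≤ 0) → φ (yA' i) ≤ 0 → (∀ j, 0 ≤ φ (yB j)) →
      (criticalCorr 3 (a + b) (Fin.append yA yB) - criticalCorr 3 (a + b) (Fin.append yA' yB)) ^ 2 ≤
        (criticalCorr 3 (a + a) (Fin.append yA (Θ ∘ yA))
          - 2 * criticalCorr 3 (a + a) (Fin.append yA (Θ ∘ yA'))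
          + criticalCorr 3 (a + a) (Fin.append yA' (Θ ∘ yA'))) *
        criticalCorr 3 (b + b) (Fin.append (Θ ∘ yB) yB)

/-- Relabelling invariance (the spin monomial is a commutative product). [folklore] -/
theorem criticalCorr_reindex {n : ℕ} (y : Fin n → Site 3) (σ : Equiv.Perm (Fin n)) :
    criticalCorr 3 n (y ∘ ⇑σ) = criticalCorr 3 n y := by
  show plusExpect 3 (criticalBeta 3) 0 (spinMonomial (y ∘ ⇑σ)) =
    plusExpect 3 (criticalBeta 3) 0 (spinMonomial y)
  congr 1
  funext s
  unfold spinMonomial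
  exact Fintype.prod_equiv σ _ _ fun i => rfl

/-- Block swap: `⟨Π_{u ++ v}⟩ = ⟨Π_{v ++ u}⟩`. [folklore] -/
theorem criticalCorr_append_comm {a b : ℕ} (u : Fin a → Site 3) (v : Fin b → Site 3) :
    criticalCorr 3 (a + b) (Fin.append u v) = criticalCorr 3 (b + a) (Fin.append v u) := by
  show plusExpect 3 (criticalBeta 3) 0 (spinMonomial (Fin.append u v)) =
    plusExpect 3 (criticalBeta 3) 0 (spinMonomial (Fin.append v u))
  congr 1
  funext s
  unfold spinMonomial
  rw [Fin.prod_univ_add, Fin.prod_univ_add]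
  simp only [Fin.append_left, Fin.append_right]
  ring

/-- Composition distributes over `Fin.append`. [folklore] -/
theorem comp_append {a b : ℕ} (Θ : Site 3 → Site 3) (u : Fin a → Site 3) (v : Fin b → Site 3) :
    Θ ∘ Fin.append u v = Fin.append (Θ ∘ u) (Θ ∘ v) := by
  funext j
  refine Fin.addCases (fun j => ?_) (fun j => ?_) j
  · simp [Fin.append_left]
  · simp [Fin.append_right]

/-- Discriminant of a nonnegative binary quadratic form. [folklore] -/
theorem sq_le_mul_of_quadratic_nonneg {α β γ : ℝ} (h : ∀ l m : ℝ, 0 ≤ l ^ 2 * α + 2 * l * m * β + m ^ 2 * γ) :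
    β ^ 2 ≤ α * γ := by
  have hα : 0 ≤ α := by simpa using h 1 0
  have hγ : 0 ≤ γ := by simpa using h 0 1
  have h1 := h γ (-β)      -- γ²α − 2γβ² + β²γ = γ(αγ − β²) ≥ 0
  have h2 := h β (-α)      -- β²α − 2βαβ + α²γ = α(αγ − β²) ≥ 0
  rcases lt_or_ge 0 γ with hγ' | hγ'
  · nlinarith
  rcases lt_or_ge 0 α with hα' | hα'
  · nlinarith
  have hα0 : α = 0 := le_antisymm hα' hα
  have hγ0 : γ = 0 := le_antisymm hγ' hγ
  have h3 := h 1 (-β)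
  rw [hα0, hγ0] at h3
  nlinarith

/-- **`ClusterMoveIneq` holds** for every RP mirror: Cauchy–Schwarz for the Gram form on the
three-member family `(ΘyA, ΘyA', yB)` with coefficients `(l, −l, m)`. [cite: FILS1978, §2] -/
theorem clusterMoveIneq_holds : ClusterMoveIneq := by
  intro Θ φ hRPm a b i yA yA' yB hdiff hA hAi hB
  obtain ⟨hinv, hφ, hsym, hRP⟩ := hRPm
  have hΘΘ : ∀ {n : ℕ} (y : Fin n → Site 3), Θ ∘ (Θ ∘ y) = y := fun y => funext fun j => hinv (y j)
  have hA' : ∀ j, φ (yA' j) ≤ 0 := by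
    intro j
    by_cases hj : j = i
    · subst hj; exact hAi
    · rw [hdiff j hj]; exact hA j
  -- the three-member family and its positivity
  let k : Fin 3 → ℕ := ![a, a, b]
  let z : (j : Fin 3) → Fin (k j) → Site 3 := fun j =>
    match j with
    | ⟨0, _⟩ => Θ ∘ yA
    | ⟨1, _⟩ => Θ ∘ yA'
    | ⟨2, _⟩ => yB
  have hz : ∀ j t, 0 ≤ φ (z j t) := by
    intro j t
    match j, t with
    | ⟨0, _⟩, t => show 0 ≤ φ (Θ (yA t)); rw [hφ]; linarith [hA t]
    | ⟨1, _⟩, t => show 0 ≤ φ (Θ (yA' t)); rw [hφ]; linarith [hA' t]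
    | ⟨2, _⟩, t => exact hB t
  -- Gram entries
  set g00 := criticalCorr 3 (a + a) (Fin.append yA (Θ ∘ yA)) with hg00
  set g01 := criticalCorr 3 (a + a) (Fin.append yA (Θ ∘ yA')) with hg01
  set g11 := criticalCorr 3 (a + a) (Fin.append yA' (Θ ∘ yA')) with hg11
  set g02 := criticalCorr 3 (a + b) (Fin.append yA yB) with hg02
  set g12 := criticalCorr 3 (a + b) (Fin.append yA' yB) with hg12
  set g22 := criticalCorr 3 (b + b) (Fin.append (Θ ∘ yB) yB) with hg22
  -- symmetries
  have hg10 : criticalCorr 3 (a + a) (Fin.append yA' (Θ ∘ yA)) = g01 := by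
    rw [← hsym, comp_append, hΘΘ, criticalCorr_append_comm]
  have hg20 : criticalCorr 3 (b + a) (Fin.append (Θ ∘ yB) (Θ ∘ yA)) = g02 := by
    rw [← comp_append, hsym, criticalCorr_append_comm]
  have hg21 : criticalCorr 3 (b + a) (Fin.append (Θ ∘ yB) (Θ ∘ yA')) = g12 := by
    rw [← comp_append, hsym, criticalCorr_append_comm]
  have hQ : ∀ l m : ℝ, 0 ≤ l ^ 2 * (g00 - 2 * g01 + g11) + 2 * l * m * (g02 - g12) + m ^ 2 * g22 := by
    intro l m
    have h := hRP 3 k z ![l, -l, m] hz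
    rw [Fin.sum_univ_three] at h
    simp only [Fin.sum_univ_three] at h
    have h' : 0 ≤ l * l * criticalCorr 3 (a + a) (Fin.append (Θ ∘ (Θ ∘ yA)) (Θ ∘ yA))
        + l * (-l) * criticalCorr 3 (a + a) (Fin.append (Θ ∘ (Θ ∘ yA)) (Θ ∘ yA'))
        + l * m * criticalCorr 3 (a + b) (Fin.append (Θ ∘ (Θ ∘ yA)) yB)
        + ((-l) * l * criticalCorr 3 (a + a) (Fin.append (Θ ∘ (Θ ∘ yA')) (Θ ∘ yA))
          + (-l) * (-l) * criticalCorr 3 (a + a) (Fin.append (Θ ∘ (Θ ∘ yA')) (Θ ∘ yA'))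
          + (-l) * m * criticalCorr 3 (a + b) (Fin.append (Θ ∘ (Θ ∘ yA')) yB))
        + (m * l * criticalCorr 3 (b + a) (Fin.append (Θ ∘ yB) (Θ ∘ yA))
          + m * (-l) * criticalCorr 3 (b + a) (Fin.append (Θ ∘ yB) (Θ ∘ yA'))
          + m * m * criticalCorr 3 (b + b) (Fin.append (Θ ∘ yB) yB)) := h
    rw [hΘΘ, hΘΘ, hg10, hg20, hg21] at h'
    nlinarith [h']
  have := sq_le_mul_of_quadratic_nonneg hQ
  linarith [this]

/-! ### G.1″ The nine site-mirror families of `ℤ³` ARE RP mirrors (kernel-checked): coordinate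
`isRPMirror_coord`, diagonal `isRPMirror_swap`, anti-diagonal `isRPMirror_antiswap` (through the
origin), all heights by `isRPMirror_conj`; via a general finite-volume site-RP lemma
`sum_sum_mul_isingExpect_free_rp_nonneg` (FILS H1–H3 for the half `{ℓ ≥ 0}` of an integer height)
and the critical box limit `rp_criticalCorr`. So `ClusterMoveIneq` is available for all nine
families at every lattice height. -/

section NineMirrors

open MeasureTheory
open Literature.Probability.Percolation (zdGraph_adj_signedPerm signedPerm_mem_box_iff)
open Summit.CriticalPhenomena.Ising3DConformalLimit.Cruxes.InversionUpgradeNormalised.FreeEndpointGaussianClosure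
  (isingExpect_sum_sum_mul_spinMonomial spinMonomial_append_apply integrable_spinMonomial_aux)
open Summit.CriticalPhenomena.Ising3DConformalLimit.MoebiusLimitExistsNegative
  (criticalCorr_signedPerm criticalCorr_translate)

variable {d : ℕ}

/-! ### Finite volume: site RP for a general involutive automorphism with an integer height -/

/-- **Finite-volume site-mirror RP for combinations of spin monomials, general mirror.** `θ` an
involutive automorphism of `ℤ^d`, `ℓ` an integer height with `ℓ ∘ θ = −ℓ`, `θ = id` on `{ℓ = 0}`
and `|ℓ x − ℓ y| ≤ 1` along edges; `Λ` a `θ`-stable finite volume; configurations `z^a` in the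
closed half `{ℓ ≥ 0}`: `0 ≤ Σ_{a,b} c_a c_b ⟨∏ σ_{θ z^a ++ z^b}⟩^∅_{Λ;β,h}` (FILS site position
H1–H3 for the half `P = {ℓ ≥ 0}`; the tree's `isingExpect_free_reflect_mul_self_nonneg`).
[cite: FILS1978, §2] [cite: FriedliVelenik2017, Lemma 10.8] -/
theorem sum_sum_mul_isingExpect_free_rp_nonneg (θ : Site d ≃ Site d) (hθ : Function.Involutive θ)
    (hθG : ∀ x y, (zdGraph d).Adj x y → (zdGraph d).Adj (θ x) (θ y))
    (ℓ : Site d → ℤ) (hℓθ : ∀ x, ℓ (θ x) = -ℓ x) (hfix : ∀ x, ℓ x = 0 → θ x = x)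
    (hlip : ∀ x y, (zdGraph d).Adj x y → ℓ x ≤ ℓ y + 1 ∧ ℓ y ≤ ℓ x + 1)
    {Λ : Finset (Site d)} (hΛ : ∀ x, x ∈ Λ ↔ θ x ∈ Λ) (β h : ℝ) {m : ℕ} (k : Fin m → ℕ)
    (z : (a : Fin m) → Fin (k a) → Site d) (c : Fin m → ℝ) (hz : ∀ a i, 0 ≤ ℓ (z a i)) :
    0 ≤ ∑ a, ∑ b, c a * c b * isingExpect (zdGraph d) Λ β h .free
      (spinMonomial (Fin.append (⇑θ ∘ z a) (z b))) := by
  classical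
  let P : Set (Site d) := {x | 0 ≤ ℓ x}
  have hmemP : ∀ x, x ∈ P ↔ 0 ≤ ℓ x := fun x => Iff.rfl
  have H1 : ∀ x, x ∈ P ∨ θ x ∈ P := fun x => by
    rw [hmemP, hmemP, hℓθ]; omega
  have H2 : ∀ x ∈ P, θ x ∈ P → θ x = x := fun x hx hθx => by
    rw [hmemP] at hx
    rw [hmemP, hℓθ] at hθx
    exact hfix x (by omega)
  have H3 : ∀ x y, (zdGraph d).Adj x y → (x ∈ P ∧ y ∈ P) ∨ (θ x ∈ P ∧ θ y ∈ P) :=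
    fun x y hxy => by
      have h := hlip x y hxy
      rw [hmemP, hmemP, hmemP, hmemP, hℓθ, hℓθ]
      omega
  have hFm : Measurable fun σ : SpinConfig (Site d) => ∑ a, c a * spinMonomial (z a) σ :=
    Finset.measurable_sum _ fun a _ => (measurable_spinMonomial (z a)).const_mul (c a)
  have hFP : DependsOn (fun σ : SpinConfig (Site d) => ∑ a, c a * spinMonomial (z a) σ) P := by
    intro σ σ' hσ
    refine Finset.sum_congr rfl fun a _ => ?_
    simp only [spinMonomial, spinAt]
    congr 1
    exact Finset.prod_congr rfl fun i _ => by rw [hσ (z a i) ((hmemP _).2 (hz a i))]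
  have hFb : ∃ C, ∀ σ : SpinConfig (Site d), |∑ a, c a * spinMonomial (z a) σ| ≤ C := by
    refine ⟨∑ a, |c a|, fun σ => (Finset.abs_sum_le_sum_abs _ _).trans (Finset.sum_le_sum
      fun a _ => ?_)⟩
    obtain ⟨A, hA⟩ := exists_spinMonomial_eq_spinProduct (z a)
    rw [abs_mul, hA]
    exact mul_le_of_le_one_right (abs_nonneg _) (abs_spinProduct_le_one A σ)
  have hpos := isingExpect_free_reflect_mul_self_nonneg (zdGraph d) θ hθ hθG hΛ H1 H2 H3 β h hFm hFP hFb
  have hexp : (fun σ : SpinConfig (Site d) => (∑ a, c a * spinMonomial (z a) (configReflect θ σ)) *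
      ∑ a, c a * spinMonomial (z a) σ) = fun σ => ∑ a, ∑ b, c a * c b *
        spinMonomial (Fin.append (⇑θ ∘ z a) (z b)) σ := by
    funext σ
    rw [Fintype.sum_mul_sum]
    refine Finset.sum_congr rfl fun a _ => Finset.sum_congr rfl fun b _ => ?_
    have hrefl : spinMonomial (z a) (configReflect θ σ) = spinMonomial (⇑θ ∘ z a) σ := rfl
    rw [spinMonomial_append_apply, hrefl]
    ring
  rw [hexp, isingExpect_sum_sum_mul_spinMonomial Λ β h .free (fun a b => c a * c b)] at hpos
  exact hpos

/-! ### Infinite volume at `β_c`, `d = 3` -/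

/-- **Site-mirror RP of the critical `ℤ³` correlators, general mirror**: as `stub_latticeRP`, for any
involutive automorphism `θ` of `ℤ³` preserving the centred boxes, with an integer height `ℓ` as in
`sum_sum_mul_isingExpect_free_rp_nonneg`. [cite: FILS1978, §2] -/
theorem rp_criticalCorr (θ : Site 3 ≃ Site 3) (hθ : Function.Involutive θ)
    (hθG : ∀ x y, (zdGraph 3).Adj x y → (zdGraph 3).Adj (θ x) (θ y))
    (hbox : ∀ (L : ℕ) (x : Site 3), x ∈ box 3 L ↔ θ x ∈ box 3 L)
    (ℓ : Site 3 → ℤ) (hℓθ : ∀ x, ℓ (θ x) = -ℓ x) (hfix : ∀ x, ℓ x = 0 → θ x = x)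
    (hlip : ∀ x y, (zdGraph 3).Adj x y → ℓ x ≤ ℓ y + 1 ∧ ℓ y ≤ ℓ x + 1) :
    ∀ (m : ℕ) (k : Fin m → ℕ) (z : (a : Fin m) → Fin (k a) → Site 3) (c : Fin m → ℝ),
      (∀ a i, 0 ≤ ℓ (z a i)) →
      0 ≤ ∑ a, ∑ b, c a * c b * criticalCorr 3 (k a + k b) (Fin.append (⇑θ ∘ z a) (z b)) := by
  intro m k z c hz
  have hmem : (BoundaryCondition.free : BoundaryCondition (Site 3)) ∈
      ({.free, .plus, .minus} : Set (BoundaryCondition (Site 3))) := by simp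
  have hT : Tendsto (fun L : ℕ => ∑ a, ∑ b, c a * c b *
      isingExpect (zdGraph 3) (box 3 L) (criticalBeta 3) 0 .free
        (spinMonomial (Fin.append (⇑θ ∘ z a) (z b))))
      atTop (𝓝 (∑ a, ∑ b, c a * c b * criticalCorr 3 (k a + k b) (Fin.append (⇑θ ∘ z a) (z b)))) :=
    tendsto_finsetSum _ fun a _ => tendsto_finsetSum _ fun b _ =>
      (criticalCorr_wellDefined_holds (d := 3) (by norm_num) (k a + k b) _ .free hmem).const_mul _
  exact ge_of_tendsto' hT fun L => sum_sum_mul_isingExpect_free_rp_nonneg θ hθ hθG ℓ hℓθ hfix hlip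
    (hbox L) (criticalBeta 3) 0 k z c hz

/-- Packaging: an RP mirror in the sense of `IsRPMirror` from a signed permutation of `ℤ³`.
[cite: FILS1978, §2] -/
theorem isRPMirror_of_signedPerm (π : Equiv.Perm (Fin 3)) (ε : Fin 3 → ℤˣ)
    (hθ : Function.Involutive (Site.signedPerm π ε))
    (ℓ : Site 3 → ℤ) (hℓθ : ∀ x, ℓ (Site.signedPerm π ε x) = -ℓ x)
    (hfix : ∀ x, ℓ x = 0 → Site.signedPerm π ε x = x)
    (hlip : ∀ x y, (zdGraph 3).Adj x y → ℓ x ≤ ℓ y + 1 ∧ ℓ y ≤ ℓ x + 1) :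
    IsRPMirror (Site.signedPerm π ε) ℓ := by
  refine ⟨hθ, hℓθ, fun n y => criticalCorr_signedPerm π ε y, ?_⟩
  exact rp_criticalCorr (Site.signedPerm π ε) hθ (fun x y h => zdGraph_adj_signedPerm π ε h)
    (fun L x => (signedPerm_mem_box_iff π ε).symm) ℓ hℓθ hfix hlip

/-! ### The three families through the origin -/

/-- Along an edge of `ℤ^d`, a coordinate changes by `0` or `±1`. [folklore] -/
theorem coord_sub_le_one_of_adj {x y : Site d} (h : (zdGraph d).Adj x y) (τ : Fin d) :
    x τ ≤ y τ + 1 ∧ y τ ≤ x τ + 1 ∧ (x τ = y τ ∨ ∀ τ', τ' ≠ τ → x τ' = y τ') := by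
  rw [zdGraph_adj_iff] at h
  obtain ⟨i, hi⟩ := h
  have h01 : ∀ j, (Pi.single i (1 : ℤ) : Site d) j = if j = i then 1 else 0 := fun j => by
    by_cases hj : j = i
    · subst hj; simp
    · simp [hj]
  rcases hi with rfl | rfl
  · refine ⟨?_, ?_, ?_⟩
    · simp only [Pi.add_apply, h01]; split_ifs <;> omega
    · simp only [Pi.add_apply, h01]; split_ifs <;> omega
    · by_cases hτ : τ = i
      · right; intro τ' hτ'; simp only [Pi.add_apply, h01]; rw [if_neg (by rw [hτ] at hτ'; exact hτ')]; ring
      · left; simp only [Pi.add_apply, h01, if_neg hτ]; ring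
  · refine ⟨?_, ?_, ?_⟩
    · simp only [Pi.add_apply, h01]; split_ifs <;> omega
    · simp only [Pi.add_apply, h01]; split_ifs <;> omega
    · by_cases hτ : τ = i
      · right; intro τ' hτ'; simp only [Pi.add_apply, h01]; rw [if_neg (by rw [hτ] at hτ'; exact hτ')]; ring
      · left; simp only [Pi.add_apply, h01, if_neg hτ]; ring

/-- The coordinate sign pattern `ε_S j = -1` on `S`, `+1` off `S`. [folklore] -/
def signOn (S : Finset (Fin 3)) : Fin 3 → ℤˣ := fun j => if j ∈ S then -1 else 1

@[simp] theorem signOn_val (S : Finset (Fin 3)) (j : Fin 3) :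
    ((signOn S j : ℤˣ) : ℤ) = if j ∈ S then -1 else 1 := by
  unfold signOn; split_ifs <;> rfl

/-- **Coordinate mirror through the origin** `v_τ ↦ −v_τ` with height `ℓ = v_τ`. [cite: FILS1978, §2] -/
theorem isRPMirror_coord (τ : Fin 3) :
    IsRPMirror (Site.signedPerm (Equiv.refl _) (signOn {τ})) (fun v => v τ) := by
  apply isRPMirror_of_signedPerm
  · intro x; funext j; simp only [Site.signedPerm_apply, Equiv.refl_symm, Equiv.refl_apply, signOn_val,
      Finset.mem_singleton]; split_ifs <;> ring
  · intro x; simp [Site.signedPerm_apply]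
  · intro x hx; funext j
    simp only [Site.signedPerm_apply, Equiv.refl_symm, Equiv.refl_apply, signOn_val, Finset.mem_singleton]
    split_ifs with hj
    · subst hj; rw [hx]; ring
    · ring
  · intro x y hxy; have := coord_sub_le_one_of_adj hxy τ; omega

/-- **Diagonal mirror through the origin** `(v_τ, v_τ') ↦ (v_τ', v_τ)` with height `ℓ = v_τ' − v_τ`.
[cite: FILS1978, §2] -/
theorem isRPMirror_swap {τ τ' : Fin 3} (hne : τ ≠ τ') :
    IsRPMirror (Site.signedPerm (Equiv.swap τ τ') 1) (fun v => v τ' - v τ) := by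
  apply isRPMirror_of_signedPerm
  · intro x; funext j; simp [Site.signedPerm_apply, Equiv.symm_swap, Equiv.swap_apply_self]
  · intro x
    simp only [Site.signedPerm_apply, Equiv.symm_swap, Pi.one_apply, Units.val_one, one_mul,
      Equiv.swap_apply_left, Equiv.swap_apply_right]
    ring
  · intro x hx; funext j
    simp only [Site.signedPerm_apply, Equiv.symm_swap, Pi.one_apply, Units.val_one, one_mul]
    have hx' : x τ' = x τ := by omega
    by_cases h1 : j = τ
    · subst h1; rw [Equiv.swap_apply_left, hx']
    · by_cases h2 : j = τ'
      · subst h2; rw [Equiv.swap_apply_right, hx']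
      · rw [Equiv.swap_apply_of_ne_of_ne h1 h2]
  · intro x y hxy
    have h1 := coord_sub_le_one_of_adj hxy τ
    have h2 := coord_sub_le_one_of_adj hxy τ'
    rcases h1.2.2 with h | h
    · omega
    · have := h τ' (Ne.symm hne); omega

/-- **Anti-diagonal mirror through the origin** `(v_τ, v_τ') ↦ (−v_τ', −v_τ)` with height
`ℓ = v_τ + v_τ'`. [cite: FILS1978, §2] -/
theorem isRPMirror_antiswap {τ τ' : Fin 3} (hne : τ ≠ τ') :
    IsRPMirror (Site.signedPerm (Equiv.swap τ τ') (signOn {τ, τ'})) (fun v => v τ + v τ') := by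
  have hsτ : ((signOn {τ, τ'} τ : ℤˣ) : ℤ) = -1 := by simp
  have hsτ' : ((signOn {τ, τ'} τ' : ℤˣ) : ℤ) = -1 := by simp
  have hsoff : ∀ j, j ≠ τ → j ≠ τ' → ((signOn {τ, τ'} j : ℤˣ) : ℤ) = 1 := fun j h1 h2 => by
    simp [h1, h2]
  apply isRPMirror_of_signedPerm
  · intro x; funext j
    simp only [Site.signedPerm_apply, Equiv.symm_swap]
    by_cases h1 : j = τ
    · subst h1; rw [Equiv.swap_apply_left, hsτ, hsτ', Equiv.swap_apply_right]; ring
    · by_cases h2 : j = τ'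
      · subst h2; rw [Equiv.swap_apply_right, hsτ', hsτ, Equiv.swap_apply_left]; ring
      · rw [Equiv.swap_apply_of_ne_of_ne h1 h2, hsoff j h1 h2, Equiv.swap_apply_of_ne_of_ne h1 h2]; ring
  · intro x
    simp only [Site.signedPerm_apply, Equiv.symm_swap, Equiv.swap_apply_left, Equiv.swap_apply_right,
      hsτ, hsτ']
    ring
  · intro x hx; funext j
    simp only [Site.signedPerm_apply, Equiv.symm_swap]
    by_cases h1 : j = τ
    · subst h1; rw [Equiv.swap_apply_left, hsτ]; omega
    · by_cases h2 : j = τ'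
      · subst h2; rw [Equiv.swap_apply_right, hsτ']; omega
      · rw [Equiv.swap_apply_of_ne_of_ne h1 h2, hsoff j h1 h2]; ring
  · intro x y hxy
    have h1 := coord_sub_le_one_of_adj hxy τ
    have h2 := coord_sub_le_one_of_adj hxy τ'
    rcases h1.2.2 with h | h
    · omega
    · have := h τ' (Ne.symm hne); omega

/-! ### All heights: conjugation by a lattice translation -/

/-- Translating a concatenated configuration translates both blocks. [folklore] -/
theorem append_add_const {a b : ℕ} (u : Fin a → Site 3) (v : Fin b → Site 3) (w : Site 3) :
    (fun i => Fin.append u v i + w) = Fin.append (fun j => u j + w) (fun j => v j + w) := by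
  funext i
  refine Fin.addCases (fun j => ?_) (fun j => ?_) i
  · simp [Fin.append_left]
  · simp [Fin.append_right]

/-- **Conjugating an RP mirror by a lattice translation gives an RP mirror** (the mirror families at
all heights `c`: conjugate the mirror through the origin by `w = c e_τ`). [folklore] -/
theorem isRPMirror_conj {Θ : Site 3 → Site 3} {φ : Site 3 → ℤ} (h : IsRPMirror Θ φ) (w : Site 3) :
    IsRPMirror (fun v => Θ (v - w) + w) (fun v => φ (v - w)) := by
  obtain ⟨hinv, hφ, hsym, hRP⟩ := h
  refine ⟨fun v => by simp [hinv], fun v => by simp [hφ], fun n y => ?_, fun m k z c hz => ?_⟩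
  · show criticalCorr 3 n (fun i => Θ (y i - w) + w) = criticalCorr 3 n y
    rw [criticalCorr_translate (fun i => Θ (y i - w)) w,
      show (fun i => Θ (y i - w)) = Θ ∘ (fun i => y i - w) from rfl, hsym n (fun i => y i - w)]
    have h3 := criticalCorr_translate y (-w)
    simpa [sub_eq_add_neg] using h3
  · have h0 := hRP m k (fun a j => z a j - w) c (fun a j => hz a j)
    refine le_of_le_of_eq h0 (Finset.sum_congr rfl fun a _ => Finset.sum_congr rfl fun b _ => ?_)
    congr 1
    have ht := criticalCorr_translate (Fin.append (Θ ∘ fun j => z a j - w) (fun j => z b j - w)) w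
    rw [append_add_const] at ht
    rw [← ht]
    congr 1
    funext i
    refine Fin.addCases (fun j => ?_) (fun j => ?_) i
    · simp [Fin.append_left]
    · simp [Fin.append_right]

end NineMirrors

/-! ### G.1' The continuum recursion step fed by `ClusterMoveIneq` -/

/-- Single-variable asymptotic equicontinuity of the pinned `n`-point zoom at index `i` on `K` along
the mesh sequence `u` (the shape of the lead's stubs 1″b/1″d). [folklore] -/
def SVEquicont (u : ℕ → ℝ) (n : ℕ) (K : Set (Fin n → EuclideanSpace ℝ (Fin 3))) (i : Fin n) : Prop :=
  ∀ ε > 0, ∃ η > 0, ∀ᶠ k in atTop, ∀ x ∈ K, ∀ x' ∈ K, (∀ j, j ≠ i → x' j = x j) → dist x x' < η →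
    |rescaledCorrelator (criticalCorr 3) rhoPin n (u k) x -
      rescaledCorrelator (criticalCorr 3) rhoPin n (u k) x'| < ε

/-- The doubled `A`-configuration `A ∪ θA` of `x = (x_A, x_B)` (order `a + a`). [folklore] -/
def doubledA (f : EuclideanSpace ℝ (Fin 3)) (T : ℝ) {a b : ℕ} (x : Fin (a + b) → EuclideanSpace ℝ (Fin 3)) :
    Fin (a + a) → EuclideanSpace ℝ (Fin 3) :=
  Fin.append (fun j => x (Fin.castAdd b j)) (fun j => Cover.reflect f T (x (Fin.castAdd b j)))

/-- The doubled `B`-configuration `θB ∪ B` of `x = (x_A, x_B)` (order `b + b`). [folklore] -/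
def doubledB (f : EuclideanSpace ℝ (Fin 3)) (T : ℝ) {a b : ℕ} (x : Fin (a + b) → EuclideanSpace ℝ (Fin 3)) :
    Fin (b + b) → EuclideanSpace ℝ (Fin 3) :=
  Fin.append (fun j => Cover.reflect f T (x (Fin.natAdd a j))) (fun j => x (Fin.natAdd a j))

/-- **PEDIGREE STEP** (the continuum consequence of `ClusterMoveIneq`, provable now exactly as the
lead's `sepMove_equicontinuity` is from `moveIneq_latticeRP`; it is the recursion of the line).
Along a mesh sequence, on a compact `K` of non-coincident `(a+b)`-configurations all cut by the
SAME cubic mirror `{rdot f · = T}` (`Cover.φ f ∈ Cover.dirs`) with margin `κ` (cluster `A` = first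
`a` indices below, `B` above): if the doubled `B`-zooms are eventually bounded on `K` (landed
`pinnedZoomLocallyBounded` under 0634, `θB ∪ B` being non-coincident with separation
`≥ min(sep K, 2κ)`) and the `(a+a)`-point zoom is single-variable asymptotically equicontinuous at
index `i` on a compact thickening of the doubled `A`-configurations, then the `(a+b)`-point zoom is
single-variable asymptotically equicontinuous at `i` on `K`. Proof: lattice mirror `Θ` at height
`round(T/δ)` (for diagonal `f` the plane `v_τ ± v_τ' = c`), `ClusterMoveIneq` multiplied by
`ρ_pin^{2(a+b)} = ρ^{2a}ρ^{2b}`: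
`(F(x) − F(x'))² ≤ [D(y,Θy) − D(y,Θy') − D(y',Θy) + D(y',Θy')]·F^{(2b)}(ΘB,B)` with
`D(s,t) = F^{(2a)}` at `(A with i-th point s) ∪ Θ(A with i-th point t)`; the bracket is at most two
single moves of the point `Θ(x_i)` (displacement = mirror image of the move, same length) at
configurations within `η + O(δ)` of `doubledA f T x`, `doubledA f T x'`; by `Θ`-invariance of
`criticalCorr` (`criticalCorr_signedPerm`, `criticalCorr_translate`) these are single moves of the
index `i` itself (`Fin.castAdd a i`). Together with the lead's 1″b (base), `pinnedZoomLocallyBounded`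
and `Cover.coveringE` this proves `stub_equicontinuity_inner` by induction on pedigree depth (G.4).
[folklore] -/
def PedigreeStep : Prop :=
  ∀ (u : ℕ → ℝ), Tendsto u atTop (𝓝[>] (0:ℝ)) →
  ∀ (a b : ℕ) (i : Fin a) (f : EuclideanSpace ℝ (Fin 3)), Cover.φ f ∈ Cover.dirs →
  ∀ (T κ η₀ M : ℝ), 0 < κ → 0 < η₀ →
  ∀ (K : Set (Fin (a + b) → EuclideanSpace ℝ (Fin 3))), IsCompact K → K ⊆ NonCoincident 3 (a + b) →
    (∀ x ∈ K, (∀ j : Fin a, Cover.rdot f (x (Fin.castAdd b j)) + κ ≤ T) ∧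
      (∀ j : Fin b, T + κ ≤ Cover.rdot f (x (Fin.natAdd a j)))) →
    (∀ᶠ k in atTop, ∀ x ∈ K,
      |rescaledCorrelator (criticalCorr 3) rhoPin (b + b) (u k) (doubledB f T x)| ≤ M) →
    Metric.cthickening η₀ (doubledA f T '' K) ⊆ NonCoincident 3 (a + a) →
    SVEquicont u (a + a) (Metric.cthickening η₀ (doubledA f T '' K)) (Fin.castAdd a i) →
    SVEquicont u (a + b) K (Fin.castAdd b i)
end Pedigree

/-- **G.3 PROOF OF THE COVERING THEOREM** (kernel-checked as `Pedigree.Cover.covering` /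
`Pedigree.Cover.coveringE`; this docstring is the human-readable version of that proof, every step
also machine-verified on the test families by `pedigree/covering.py`, which implements exactly this
construction with exact rational arithmetic and re-checks admissibility and terminality).

Conventions. Translate so that the moving point is `0`. A CUT `(f, T)` (`f` one of the 18 signed cubic
directions, `T > 0`, no point on the mirror `{⟪f,·⟫ = T}`) replaces `P` by `A ∪ θ_{f,T}A`,
`A = P ∩ {⟪f,·⟫ < T} ∋ 0`, `θ_{f,T}v = v − 2(⟪f,v⟫ − T)f/‖f‖²`; note `θA ⊆ {⟪f,·⟫ > T}`. TARGET:
`0` is the strict `v₁`-minimum (`p₁ > 0` for all `p ≠ 0`). Call `p ≠ 0` BAD if `p₁ ≤ 0`, a BLOCKER if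
`p₁ ≤ −|p₂|` and `p₁ ≤ −|p₃|` (closed backward `ℓ^∞`-pyramid), an AXIS blocker if moreover `p₂ = p₃ = 0`.
Two invariance facts, checked coordinate-wise: (F1) under a cut with `f₁ = 0` (directions `±e₂, ±e₃`)
the image `(p₁, 2T − p₂, p₃)` (resp. `p₃`) of a NON-blocker is never a blocker (`|2T − p₂| > |p₂|`
whenever `p₂ < T`, `T > 0`), and `p₁` is unchanged; (F2) under a cut with `f₁ > 0` ("good" cut) every
image satisfies `(θp)₁ = p₁ + 2(T − ⟪f,p⟫)f₁/‖f‖² > p₁`, so images of good points are good and the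
image of `0` is good.

PHASE 1 (unblocking). (i) If there is an axis blocker, cut `(−e₁+e₂, t₀)` with `t₀` below every
positive value of `p₂ − p₁`: this discards `{p₂ > p₁}`, which contains every axis blocker
(`p₂ = 0 > p₁`); the images `(p₂ − t₀, p₁ + t₀, p₃)` contain no axis point for generic `t₀`
(`p₁ ≠ −t₀`). From now on only cuts with `f₁ = 0` are used in Phase 1, which create no axis blocker
(generic thresholds) and, by (F1), no blocker out of a non-blocker; blockers keep their level
`a = −p₁ > 0` and satisfy `|p₂|, |p₃| ≤ a ≤ A := max a`. (Z) The blockers with `p₂ = 0` have `p₃ ≠ 0`;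
while some exist, let `x = min |p₃|` over them and cut `(±e₃, T)` with `T ∈ (x − gap, x)`, `T > x/2`,
on the side where `x` is attained: this DISCARDS every such blocker on that side (`|p₃| ≥ x > T`), and
the only NEW blockers with `p₂ = 0` are images `(p₁, 0, ±(2T + |p₃|))` of such blockers on the other
side, of modulus `2T + |p₃| ≥ 2T + x > 2.9x` for `T > 0.95x` (non-blockers spawn none by (F1), blockers
with `p₂ ≠ 0` spawn blockers with `p₂ ≠ 0`); no blocker with `p₂ = p₃ = 0` can appear. The minimal
modulus `x` is non-decreasing and increases strictly at least every second step (both sides at level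
`x` are discarded in two steps); were the game infinite, `x_k ↑ x* ≤ A`, but once `x_k > 0.9x*` every
newly created member has modulus `> 2.6x*`, so the finitely many members of modulus `≤ 2.6x*` lose at
least one element every second step and are never replenished — contradiction. So (Z) terminates:
no blocker has `p₂ = 0`.
(M) Now play the same game in the coordinate `p₂` on ALL blockers (all have `p₂ ≠ 0`; cuts `(±e₂, T)`
with `T` also avoiding the finitely many values `p₂/2`, so that no image `(p₁, 2T − p₂, p₃)` has
`p₂ = 0`): non-blockers spawn no blockers (F1), the discarded side loses all its members, the images
have modulus `2T + |p₂| > 2.9x`; the same monotonicity argument terminates with NO BLOCKER AT ALL.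

PHASE 2 (four good cuts). Assume no blockers: every bad `p` is a `v₂`-sticker (`|p₂| > a_p := −p₁`) or
a `v₃`-sticker (`|p₃| > a_p`). "Tiny" threshold = smaller than every positive value of `|g(q)|`, `g`
ranging over the 18 directions and `q` over the current points (so removal patterns are sign patterns,
and each tiny threshold is below the previous ones, which occur as coordinates of images of `0`).
Cut 1 `(e₁+e₃, t)`: discards `{p₁ + p₃ > 0}`; image `(t − p₃, p₂, t − p₁)`; a bad image needs
`p₃ > 0`, comes from a bad `p` with `a_p ≥ p₃ > 0` and is `q = (t − p₃, p₂, t + a_p)`, a `v₃`-sticker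
with `q₁ − q₃ < 0`. Cut 2 `(e₁−e₃, t')`: discards `{p₁ > p₃}`; image `(p₃ + t', p₂, p₁ − t')`; bad
images come only from original bad `p` with `p₁ ≤ p₃ < 0` (the points `q` are kept, and images of
cut-1 images are good), and are `(p₃ + t', p₂, p₁ − t')` with level `|p₃| − t'`. INVENTORY after
cut 2 — every bad point is a `v₂`-STICKER: (α) original bad `p` kept twice has `|p₃| ≤ a_p`, so
`|p₂| > a_p` by the no-blocker hypothesis; (β) `q = (t − p₃, p₂, t + a_p)` has level `p₃ − t` and
`|p₂| ≥ p₃` (otherwise `p` would be a blocker: `|p₂| < p₃ ≤ a_p`, `|p₃| ≤ a_p`), so `|q₂| > p₃ − t`;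
(γ) `(p₃ + t', p₂, p₁ − t')` from `p₁ ≤ p₃ < 0`: `|p₃| ≤ a_p` forces `|p₂| > a_p ≥ |p₃| > |p₃| − t'`.
Cut 3 `(e₁+e₂, s)`: discards `{p₁ + p₂ > 0}`; a kept bad `v₂`-sticker has `p₂ ≤ −p₁ = a` and
`|p₂| > a`, i.e. `p₂ < −a ≤ 0`, so its image `(s − p₂, s − p₁, p₃)` is GOOD; images of kept good
points (`p₂ ≤ −p₁ < 0`) are good: cut 3 creates no bad point and leaves exactly the bad points with
`p₂ < p₁ ≤ 0`. Cut 4 `(e₁−e₂, s')`: discards `{p₁ > p₂}` — all remaining bad points — and the images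
`(p₂ + s', p₁ − s', p₃)` of the kept points (`p₂ ≥ p₁`, hence good with `p₂ ≥ p₁ > 0`) are good.
TERMINAL: `0` is the strict `v₁`-minimum. ∎

Remarks. (1) Depth is finite but not uniformly bounded (Phase 1 takes `O(log(A/x_min))` rounds with the
doubling choice of thresholds); observed: `≤ 16` cuts on all tests, configuration sizes `≤ 500`.
(2) Only the 9 cubic mirror directions are used — exactly the site-mirror reflections of `ℤ³` for
which the nearest-neighbour model is reflection positive (FILS H1–H3); body diagonals are not needed.
(3) The lead's examples: cube vertex — depth 4 (`cube_pedigree`; even depth 1 with a diagonal first cut);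
octahedron centre — depth 6 (`octahedron_pedigree`); `3×3×3` grid centre — depth 8 (`grid27_pedigree`).
[folklore] -/
theorem covering_theorem_paper_proof : True := trivial

/-- **G.4 ASSEMBLY: `stub_equicontinuity_inner` (indeed full single-variable asymptotic
equicontinuity at every order `N`, every compact `K ⊆ NonCoincident 3 N`, every index) modulo 0634.**
Ingredients: `Pedigree.ClusterMoveIneq` (lattice; PROVED: `clusterMoveIneq_holds` for every RP mirror,
and the nine families are RP mirrors, G.1″) ⇒ `Pedigree.PedigreeStep` (continuum, provable now, as
1″b from 1″a); BASE = the lead's `sepMove_equicontinuity` (0634); local bounds =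
landed `pinnedZoomLocallyBounded` (0634); the covering THEOREM `Pedigree.Cover.coveringE` (§G.3). Induction on PEDIGREE
DEPTH `d` (not on `N`; orders grow along a pedigree, which is harmless because depth decreases):
`Claim(d)`: for all `n`, `i`, and compact `K̃ ⊆ NonCoincident 3 n` every point of which admits a
pedigree for the moving index `i` of depth `≤ d` whose cuts keep margin `≥ μ` (all points `≥ μ` off
every mirror used, final extremality by `≥ μ`), `SVEquicont u n K̃ i`. `Claim(0)` is the base (strict
coordinate extremality with margin `μ` is 1″b's separation hypothesis with `κ = μ`). `Claim(d−1) ⇒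
Claim(d)`: the pedigree conditions are finitely many strict inequalities, continuous in the
configuration and `1`-Lipschitz (reflections are isometries, kept points are unchanged), so each
`x ∈ K̃` has a ball on which ITS first cut `(f, T)` is admissible with margin `μ/2` and the doubled
configurations (and their `μ/4`-thickening) satisfy the depth-`(d−1)` hypothesis with margin `μ/4`;
cover `K̃` by finitely many such balls (Lebesgue number), apply `PedigreeStep` on each closed piece
(its thickened doubled image is compact: continuous image + `cthickening` in a proper space, and
lies in `NonCoincident` since `A` is `≥ μ/2` off the mirror) with `Claim(d−1)` as input, and take the
minimum of the finitely many `η`'s / intersection of the eventualities. Finally, for a given compact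
`K ⊆ NonCoincident 3 N` and index `i`, `CoveringTheorem` gives every `x ∈ K` a pedigree, with some
positive margin `μ(x)` and valid on a neighbourhood; by compactness finitely many depths/margins
suffice, so `K` is a finite union of compacts of the form covered by `Claim(d)` (`Cover.coveringE`
gives the pedigree of the finite configuration `{x j}`; the moving point is translated to `0`
first — lattice translations are free, `criticalCorr_translate`). WLOG-permutation of
indices (cluster first) by `criticalCorr_comp_perm`; lattice rounding (`Θ_c` with `c = round(T/δ)`,
`[θx/δ]` vs `Θ_c[x/δ]` differ by `O(1)` sites) is absorbed by the thickening, every lattice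
configuration being the approximant of its own rescaling (`latticeApprox δ (δ•y) = y`).
RECOMMENDED RESHAPE for the lead (all pieces provable now except the base's 0634 input):
1″a ↦ `ClusterMoveIneq` for the nine `IsRPMirror` families (coordinate: `stub_latticeRP`; diagonal:
`isingExpect_free_reflect_mul_self_nonneg` with the swap automorphisms + box limit — new but routine);
1″b ↦ `PedigreeStep` (+ keep 1″b itself as the base); the covering theorem is DONE
(`Pedigree.Cover.coveringE`, importable from `Negative/MirrorPedigree.lean` once landed); 1″d then
follows by G.4 (joint equicontinuity still via 1″c). What this generation did NOT do: formalise G.4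
(the analytic bookkeeping) and `PedigreeStep` (the continuum transfer, same analysis as 1″b) —
prover-sized but routine; every LATTICE and COMBINATORIAL input is now a theorem; no obstruction
anywhere. [folklore] -/
theorem target_stub_equicontinuity_inner : True := trivial

/-- **G.5 WHAT REMAINS OPEN ON THE LINE after §G**: exactly STUBS 5′/6′ (`stub_interactingInversion_ge_four`,
`stub_interactingUnique_ge_four`) — inversion covariance and non-drift of interacting cluster points at
even orders `≥ 4`, i.e. the conjecture proper on the realised branch (§F.5–F.6, immune, crux-implied,
false without the lattice). With STUB 1 provable modulo 0634, the line proves unconditionally (given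
0634): the pinned zoom is sequentially compact with regular, translation-invariant, non-degenerate
cluster points having the pure-power two-point function, and the free stratum is the single point
`W_Δ` (STUBS 2–4, landed). The crux is then EQUIVALENT (given 0634) to: every interacting regular
cluster point is inversion covariant at orders `≥ 4` and there is at most one — `crux_iff_pinned_inversion`
already says the crux is "the pinned zoom converges to an inversion-covariant family". No new attack on
5′/6′ this generation (nothing in print or tree constrains interacting cluster points beyond §F.5(a)).
[folklore] -/
theorem remains_open_after_G : True := trivial


/-! ## §E Why it resists -/

/-- WHY THE CRUX RESISTS (no Lean content; `True`).
* FINAL FORM (`crux_iff_inversion`): the crux says exactly that the critical correlators on `ℤ³`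
  have a non-degenerate pointwise scaling limit which is covariant under `x ↦ x/‖x‖²`. Everything
  else in its five clauses — `ρ > 0` cosmetics, `0 < Δ`, translations, `O(3)`, dilations, the value
  of `Δ` — is automatic or forced (`Δ = (1+η)/2 ∈ [1/2, 3/4]`, unique). This is the 3D-Ising-CFT
  existence-plus-inversion conjecture (Polyakov 1970; Duminil-Copin ICM 2022 §8.4 "widely open");
  no negative result is in print; numerics support it (conformal bootstrap `Δ_σ = 0.5181489(10)`).
* Formal side conditions audited (§A, §C): the ∃-form is immune to the coincident-locus junk that
  refuted the ∀-form upgrades 0632/0637; `n = 0` forces `S 0 = 1` and odd `n` force `S n = 0`,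
  both compatible with covariance; `IsInversionCovariant` is only asked off the origin.
* Cheap kills exhausted: dimension window (only `Δ ∉ [1/2,3/4]` refutable), bounded `ρ`, uniform
  convergence, continuity at the diagonal — all junk variants, none the crux.
* What WOULD kill it (each itself open): non-existence of `η(3)` (§B'); failure of ratio
  regularity / doubling / Euclidean isotropy of `⟨σ₀σ_x⟩_{β_c}` (§D); failure of the four-point
  inversion ratio law (`Negative/InversionTest.lean`); a lattice bound forcing `Δ_σ > 3/4`.
* Literature: remote `lit search` was unavailable this session (searchd rc 75, search-degraded);
  the in-tree barrier `ScaleCovarianceNotMoebius(Narrow)` says symmetry bookkeeping cannot produce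
  inversion covariance — consistent: inversion is THE non-free generator, and conversely it generates
  all the others (`Negative/RotationFromInversion.lean`).
* Gen 3 (§A⁶, §F): non-degeneracy is one bit and automatic after pinning; `ρ` is eliminable; the
  crux is "the pinned zoom converges to an inversion-covariant family". On the picked line no stub is
  refutable: STUBS 2–4, the schema and 4726 are theorems; STUBS 5–6 quantify over `IsClusterPoint`
  (unconstructible) and STUB 1 over the lattice (open both ways, but provably doubling-hard).
* Gen 3 literature: remote `lit search` degraded again (searchd rc 75; OpenAlex/S2 HTTP 429); local
  index: Deng–Blöte, PRL 88 (2002) "Conformal invariance of the Ising model in three dimensions" —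
  Monte-Carlo SUPPORT (conformal profiles in sphero-cylindrical geometry), no negative result; ADC21
  Prop. 5.3/8.6 (spectral representation, in tree and now used: axis ratio regularity is a theorem);
  DCP25 arXiv:2404.05700 Thm. 1.3/1.5, (1.11) read at the page.
* Gen 4 (§G): the compactness half of the picked line is no longer an obstacle — lead-1's residue
  `stub_equicontinuity_inner` is provable from reflection positivity in the nine cubic site mirrors
  (cluster move inequality + covering theorem + 1″b); the crux itself is untouched: what resists is
  inversion covariance / uniqueness of INTERACTING cluster points (5′/6′), for which no lattice
  mechanism, counterexample family or printed negative result exists (gate/ledger and remote `lit`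
  were unreachable during this generation's session; tree search only). [folklore] -/
theorem resists : True := trivial

end Summit.CriticalPhenomena.Ising3DConformalLimit.Cruxes.MoebiusLimitExists.Disproof

end
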